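import Summits.BirchSwinnertonDyer.BirchSwinnertonDyer.Theses.KolyvaginRankRigidityAtTwo
import Summits.BirchSwinnertonDyer.BirchSwinnertonDyer.Theorems.KolyvaginRankRigidityAtTwoWalkEngineAdapter
import Literature.NumberTheory.EllipticCurves.CasselsTateSelmerKolyvaginValue
import Literature.NumberTheory.EllipticCurves.HeegnerPointsKolyvaginConjugation
import Summits.BirchSwinnertonDyer.BirchSwinnertonDyer.Theorems.KolyvaginRankRigidityAtTwoShapeCutAtTwo
import Summits.BirchSwinnertonDyer.BirchSwinnertonDyer.Theorems.KolyvaginRankRigidityAtTwoChebotarevWindowPrimeAtTwo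
import Summits.BirchSwinnertonDyer.BirchSwinnertonDyer.Theorems.KolyvaginRankRigidityAtTwoWalkStepTransfer
import Summits.BirchSwinnertonDyer.BirchSwinnertonDyer.Theorems.KolyvaginRankRigidityAtTwoSwapFromPiecesPrelims
import Summits.BirchSwinnertonDyer.BirchSwinnertonDyer.Theorems.Rank1ResidualJetCompatibleData
import Summits.BirchSwinnertonDyer.BirchSwinnertonDyer.Theorems.Rank1ResidualJetRingClassFields
import Summits.BirchSwinnertonDyer.BirchSwinnertonDyer.Theorems.ByReductionTypeAtTwoRankOneAtTwoOffBigImageOddLocalEngineEndToEnd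
import Literature.NumberTheory.EllipticCurves.Jetchev2008.CoreVertices
import Summits.BirchSwinnertonDyer.BirchSwinnertonDyer.Theorems.KolyvaginRankRigidityAtTwoRegularCoreSupplyAtTwoRegularConductors
import Summits.BirchSwinnertonDyer.BirchSwinnertonDyer.Theorems.KolyvaginRankRigidityAtTwoWalkNearCore
import Summits.BirchSwinnertonDyer.BirchSwinnertonDyer.Theorems.KolyvaginRankRigidityAtTwoStartFrameOfParity
import Summits.BirchSwinnertonDyer.BirchSwinnertonDyer.Theorems.KolyvaginRankRigidityAtTwoStartFrameNearCoreHolds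
import Summits.BirchSwinnertonDyer.BirchSwinnertonDyer.Theorems.GenusKolyvaginAtTwoKolyvaginRelationAtTwo
import Summits.BirchSwinnertonDyer.BirchSwinnertonDyer.Theorems.GenusKolyvaginAtTwoVisiblePairAtTwoKolyvaginClassSign
import Summits.BirchSwinnertonDyer.BirchSwinnertonDyer.Theorems.KolyvaginRankRigidityAtTwoWalkBridge
import Summits.BirchSwinnertonDyer.BirchSwinnertonDyer.Theorems.KolyvaginRankRigidityAtTwoSwapOfNamedFacts
import Summits.BirchSwinnertonDyer.BirchSwinnertonDyer.Theorems.KolyvaginRankRigidityAtTwoSwapPairingLowerBoundGlobalOfIndex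
import Summits.BirchSwinnertonDyer.BirchSwinnertonDyer.Theorems.GenusKolyvaginAtTwoPowDvdShaCardAtTwoRTKolyvaginClassLevels
import Summits.BirchSwinnertonDyer.BirchSwinnertonDyer.Theorems.KolyvaginRankRigidityAtTwoRegularValueEngineTwoLevel
import Summits.BirchSwinnertonDyer.BirchSwinnertonDyer.Theorems.KolyvaginRankRigidityAtTwoSignedRefillSupplyAtTwo
import Summits.BirchSwinnertonDyer.BirchSwinnertonDyer.Theorems.KolyvaginRankRigidityAtTwoOppositeSignReciprocityAtTwo
import Summits.BirchSwinnertonDyer.BirchSwinnertonDyer.Theorems.KolyvaginRankRigidityAtTwoStartShapeAtTwo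
import Summits.BirchSwinnertonDyer.BirchSwinnertonDyer.Theorems.KolyvaginRankRigidityAtTwoLevelDropAtTwo
import Summits.BirchSwinnertonDyer.BirchSwinnertonDyer.Theorems.KolyvaginRankRigidityAtTwoShapeRefillAtTwo
import Summits.BirchSwinnertonDyer.BirchSwinnertonDyer.Theorems.Rank1ResidualJetCompatibleDataDown
import HarnessLib
import Summits.BirchSwinnertonDyer.BirchSwinnertonDyer.Theorems.GenusKolyvaginAtTwoPowDvdShaCardAtTwoRTKolyvaginClassOrder
import Summits.BirchSwinnertonDyer.BirchSwinnertonDyer.Theorems.KolyvaginRoadThreeLevelData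
import Summits.BirchSwinnertonDyer.Rank1Residual.X11b.Three.KolyvaginNonvanishing
import Literature.NumberTheory.EllipticCurves.HeegnerPointsOfConductorRationalityProofs
import Literature.NumberTheory.EllipticCurves.RingClassGalOverCyclicProofs

set_option linter.dupNamespace false

/-!
**v8.6 (g17, 2026-08-29 ~17:45Z) — LINE COMPLETE MODULO INPUT + PRINT: sorries EXACTLY 2 = S0ʳ `stub_roomSeedAtTwo` (INPUT: Kolyvagin's conjecture
at 2) · P372 `stub_heegnerCongruence` (print: Gross 1991 Prop. 3.7(2)) (NOT registered — W-79; v7.2r stays the LEAD's file of record).**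
The three typed M-stubs of SWα⁗ are all DISCHARGED: SC BY NAME from the TREE (`shapeCutAtTwo_holds := KolyvaginAtTwo.RegularWalk.shapeCutAtTwo`,
p729679, krr2-p2 g18, `gC a = 3a + 2`), SRF BY NAME from the TREE (v8.3: `shapeRefillAtTwo_holds := KolyvaginAtTwo.RegularWalk.shapeRefillAtTwo`,
p728771, `gR a = 2a + 8`), and ES IN THE KERNEL (§ES: the pen's two landable Theorems files — farm-checked rc 0 / 0 sorry / axioms standard, tree
landing p735554 `KolyvaginRankRigidityAtTwoDeepEngineAdapter` pending + `KolyvaginRankRigidityAtTwoEngineSupplyAtTwo` to follow — inlined verbatim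
under `ESInline.*`; `engineSupplyAtTwo_holds := ESInline.RegularWalk.engineSupplyAtTwo`, loss constant `C = 4`): DL = deep homothety loss (a homothety
`λ ∈ Γ_K` on `E[2^I]` turns vanishing on `Γ_{K(E[2^I])}` into `(λ−1)`-torsion of `[x, ·]` on `Γ_{K(E[2^M])}`; `λ = 9 = 3²`,
`RatClosure.exists_smul_eq_of_sq`), the deep sign transfer, and DA = the TREE adapter `RegularValueEngine.exists_regular_kolyvaginPrime_killing` run at
level `I − 1` on `torsionH1OfDvd`-inflated classes (regularity descends with `P := 2^{I−1−k} P'`; local statements pulled back by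
`mem_torsionLocalKer_iff_torsionH1OfDvd_mem` + `JET.GlobalDuality.galoisRep_toLocal_apply_eq_self`) — NO new engine port.  v8.7 (mechanical, once both
files land): §ES replaced by `engineSupplyAtTwo_holds := KolyvaginAtTwo.RegularWalk.engineSupplyAtTwo`.  Single crux-concluding theorem
`KolyvaginBoundedDefectAtTwo_of_stubs`.  Kernel on this line: EV, OSR (mod P372), SRS (tree), LD (tree), START (tree), VG, the class sign, Zζ (mod P372),
ES, SC (tree), SRF (tree), SWα⁗ (mod P372), SW⁗, the walk / bounded-defect bookkeeping.  What remains is exactly the INPUT S0ʳ and the PRINT fact P372.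
No crux / rung / summit is proved by a line; U1 NOT proved; **BSD NOT proved.**

**v8.2 (g15, 2026-08-29 ~15:20Z) — TREE-FED (NOT registered — W-79).**  Same statements and stubs as v8.1; the inlined proof blocks
`OSRProof` / `LDProof` / `STARTProof` (§§ of v7.8–v8.0) are DELETED and the three kernel theorems are fed from the TREE by name:
`oppositeSignReciprocityAtTwo_holds := KolyvaginLowerBoundAtTwo.oppositeSignReciprocityAtTwo_of_frobeniusCongruence stub_heegnerCongruence`
(p724710), `levelDropAtTwo_holds := KolyvaginAtTwo.RegularWalk.levelDropAtTwo` (p727017), `startShapeAtTwo_holds :=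
KolyvaginAtTwo.RegularWalk.startShapeAtTwo` (p725345), next to `signedRefillSupplyAtTwo_holds := KolyvaginAtTwo.RegularWalk.signedRefillSupplyAtTwo`
(p723829).  Sorry census unchanged: 5 = S0ʳ (INPUT) · ES · SC · SRF (M-stubs of SWα⁗) · P372 (print).  No crux / summit proved; BSD NOT proved.

**v8.1 (g15, 2026-08-29 ~15:30Z) — SWα⁗ DERIVED IN THE KERNEL (proposal; NOT registered — W-79; v7.2r stays the LEAD's file of record).**
The load-bearing stub SWα⁗ `ShedSeedPrimeShapedAtTwo` (statement byte-identical since v7.7) is now a THEOREM of the line,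
`shedSeedPrimeShapedAtTwo_holds := shedSeedPrimeShapedAtTwo_of stub_engineSupplyAtTwo stub_shapeCutAtTwo stub_shapeRefillAtTwo
oppositeSignReciprocityAtTwo_holds signedRefillSupplyAtTwo_holds` (§5b, sorry-free composition: the exact sign `u = −w(E)(−1)^{#(se)}` from `2c ≠ 0`,
the partner (basis class `g₀` if `t ≥ 1`; SRS at a second seed prime if `t = 0`, the corner), ES's engine prime, OSR's named seed prime `q' ∣ s`,
JET UP/DOWN data, cardinal / `KolSupp` / margin bookkeeping, the new shape from SC or SRF), modulo THREE typed M-stubs — the critic's endorsed split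
«ES + SRP» (#328) with SRP cut into its two cases: ES `EngineSupplyAtTwo` (deep REGULAR engine supply: the tree's engine adapter
`WalkEngineAdapter.exists_regular_kolyvaginPrime_killing` ⊗ the tree's deep pair window `ChebotarevWindowPrimeAtTwo.exists_kolyvaginPrime_notMem_pair_of_heegner`),
SC `ShapeCutAtTwo` (shape persistence `Sh(t+1, a) ↦ Sh(t, gC a)` when the basis class is cut at `ℓ` and the others are killed) and SRF `ShapeRefillAtTwo`
(`Sh(0, a) ↦ Sh(1, gR a)`: the supply half of the signed refill law AT the engine prime plus near-cyclicity of the refill).  Stubs (5): S0ʳ `stub_roomSeedAtTwo`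
(INPUT) · ES · SC · SRF (M each) · P372 `stub_heegnerCongruence` (print).  Sorry count 5, zero elsewhere; single crux-concluding theorem
`KolyvaginBoundedDefectAtTwo_of_stubs`.  Kernel so far on this line: EV, OSR (mod P372), SRS (tree), LD, START, VG, the class sign, Zζ (mod P372),
SWα⁗ (mod ES/SC/SRF/P372), the walk / bounded-defect bookkeeping.  Nothing here proves ES, SC, SRF, S0ʳ, U1 or BSD.

**v8.0 (g15, 2026-08-29 ~14:25Z) — SRS DISCHARGED BY NAME (proposal; NOT registered — W-79; v7.2r stays the LEAD's file of record).**
The width seat krr2-p2 g18 LANDED the supply half of the signed refill law: tree theorem `KolyvaginAtTwo.RegularWalk.signedRefillSupplyAtTwo`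
(p723829, `Theorems/KolyvaginRankRigidityAtTwoSignedRefillSupplyAtTwo.lean`, on p722230 signed refill law + p723417 in situ; constant `C = 7`) =
this file's `SignedRefillSupplyAtTwo` byte-for-byte with `OppShape … 0` unfolded, so `signedRefillSupplyAtTwo_holds : SignedRefillSupplyAtTwo :=
KolyvaginAtTwo.RegularWalk.signedRefillSupplyAtTwo` closes by definitional unfolding (below).  Hence Zζ `LoneSeedPartnerAtTwo` is a kernel theorem
modulo P372 (`loneSeedPartnerAtTwo_of oppositeSignReciprocityAtTwo_holds signedRefillSupplyAtTwo_holds`).  Stubs (3): S0ʳ `stub_roomSeedAtTwo`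
(INPUT) · SWα⁗ `stub_shedSeedPrimeShapedAtTwo` (L, THE hand: = OSR(proved)+SRS(proved)+ES+SRP+bookkeeping) · P372 `stub_heegnerCongruence` (print).
Sorry count 3, zero elsewhere; single crux-concluding theorem `KolyvaginBoundedDefectAtTwo_of_stubs`.  Kernel so far on this line: EV, OSR (mod P372),
SRS (tree), LD, START, VG, the class sign, Zζ (mod P372), the walk/bounded-defect bookkeeping.  Nothing here proves SWα⁗, S0ʳ, U1 or BSD.

**v7.9 (g15, 2026-08-29 ~14:20Z) — LD and START DISCHARGED (proposal; NOT registered — W-79; v7.2r stays the LEAD's file of record).**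
The two support stubs of v7.8 are now KERNEL THEOREMS: LD `levelDropAtTwo_holds : LevelDropAtTwo` (section `LDProof` = pen file
`line17/LevelDropAtTwo.lean` sha16 c34440b925a76365: `c_M ≠ 0 ⇒ 2 ≤ M` by the class's own `2^{M−1}`-torsion, McCallum's Lemma 4.6 in the tree
`GenusExact.KolyvaginClassLevels.zsmul_kolyvaginClass_eq_torsionH1OfDvd` + value transport `RegularValueEngine.h1Eval_torsionH1OfDvd`) and START⁗
`startShapeAtTwo_holds : StartShapeAtTwo` (section `STARTProof` = pen file `line17/StartShapeAtTwo.lean` sha16 9525f9590cfe0bbb: the tree's start frame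
`RegularWalk.startFrameAtTwo_holds` restricted to the `(−u)`-signed sub-family, `a₀ = max (J+1) d`, plus the `(1 − uτ)`-symmetrisation of the span
relation — PHANTOMS ARE `τ`-STABLE, `phantom_conjAct`).  OSR's docstring now states that the corner `m = n` (conclusion `False`) is contained and used
(critic T-OSR-1, #317).  Stubs (4): S0ʳ `stub_roomSeedAtTwo` (INPUT) · SWα⁗ `stub_shedSeedPrimeShapedAtTwo` (L: = OSR(proved)+SRS+ES+SRP+bookkeeping) ·
SRS `stub_signedRefillSupplyAtTwo` (M, krr2-p2 g18's claim) · P372 `stub_heegnerCongruence` (print).  Sorry count 4, zero elsewhere; single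
crux-concluding theorem `KolyvaginBoundedDefectAtTwo_of_stubs`.  Nothing here proves SWα⁗, SRS, U1 or BSD.

**v7.8 (g15, 2026-08-29 ~13:45Z) — OSR DISCHARGED modulo P372 (proposal; NOT registered — W-79; v7.2r stays the LEAD's file of record).**
The stub (d″) OSR `OppositeSignReciprocityAtTwo` of v7.7 (the critic's named beyond-print load of the line) is now a KERNEL THEOREM
`oppositeSignReciprocityAtTwo_holds := KolyvaginLowerBoundAtTwo.oppositeSignReciprocityAtTwo_of_frobeniusCongruence stub_heegnerCongruence`
(section `OSRProof` below = pen file `line17/OppositeSignReciprocityAtTwo.lean` sha16 67c18ff6e0b42450, 0 sorries: §1 k-term reciprocity P6ₖ,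
§2 the core in S1's frame currency, §3 the frame discharged on the hybrid-transverse structures — P8 `dualTransported_eq_of_hybrid`, P4
`JET.localization_kolyvaginClass_mem_globalTransverse_two`, P7a `swapPairing_pow_smul_ne_zero_at_two_of_index` (c₇ = 2, index ≥ M+1, no Frobenius
class), Q2 `GenusExact.kolyvaginRelationAtTwo_of_frobeniusCongruence`, T2 `pow_zsmul_kolyvaginClass_two_mem_selmerLocalKer` —, §4 the frame BUILT
(Poitou–Tate = tree theorem `poitouTate_selmerStructure_duality_conj_holds`, Weil data `exists_weilDatum_liftAut_two_pow`, hybrid structures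
`exists_hybridTransverseFamily`), the Jetchev bridge `H_{𝓕(m)} = H¹_{selmerF 𝒯_M (placesDividing m)}` and the sign squeeze by the kernel sign law
(`ε(nℓ) = −ε(n)`; `u ≠ ε(n) ⟹ 2c_M(n) = 0 ⟹ b = 0 ⟹ a ≥ M ⟹ ⊥`); constant `C = |Δ_min| + 6`).  Stubs (6): S0ʳ `stub_roomSeedAtTwo` (INPUT) · LD
`stub_levelDropAtTwo` (S) · START `stub_startShapeAtTwo` (S) · SWα⁗ `stub_shedSeedPrimeShapedAtTwo` (L: = OSR(proved)+SRS+ES+SRP+bookkeeping) · SRS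
`stub_signedRefillSupplyAtTwo` (M) · P372 `stub_heegnerCongruence` (print).  Sorry count 6, zero elsewhere; single crux-concluding theorem
`KolyvaginBoundedDefectAtTwo_of_stubs`.  Nothing here proves SWα⁗, SRS, U1 or BSD.

**v7.7 (g15, 2026-08-29 ~13:30Z) — (d″) TYPED, Zζ DERIVED, EV PROVED (proposal; NOT registered — W-79; v7.2r stays the LEAD's file of record).**
The critic's one remaining beyond-print load of the line, (d″) «opposite-sign reciprocity with a Kummer partner», is now ONE typed Prop
`OppositeSignReciprocityAtTwo` (OSR): the MULTI-TERM generalisation of S1's LANDED two-term swap `KolyvaginLowerBoundAtTwo.primeSwapAtTwoLossy_core`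
(partner `z ∈ H_{𝓕(m)}` of exact sign `−u`, Kummer at the seed primes of `n/m` and at the engine prime `ℓ`; auxiliary class `2^t·c_M(nℓ)`;
Poitou–Tate leaves `B_ℓ + Σ_{q' ∣ n/m} ⟨z, c_M(nℓ)⟩_{q'} = 0`; `B_ℓ ≠ 0` beyond `2^{M+C}` by P7a `swapPairing_pow_smul_ne_zero_at_two` (same-sign
`f × tr` perfectness, `c₇ = 2`) and Q2-UP at `ℓ`; hence SOME seed term is non-zero, i.e. `2^j·c_M(nℓ) ∉ H¹_𝓕` at some `q' ∣ n/m`).  Every input of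
OSR's proof is a tree theorem except the k-term Poitou–Tate bookkeeping (S1's `localTatePairing_add_eq_zero_of_swap` is the 2-term case) — proposed
price M.  The supply half of the signed refill law is the second typed Prop `SignedRefillSupplyAtTwo` (SRS: shape `Sh(0,a)` of the `(−u)`-part of
`H_{𝓕(e)}` + a seed prime `q` ⟹ an exact `(−u)`-class `z ∈ H_{𝓕(qe)}` of order `≥ 2^{M−a−C}`; heart = per-eigen-plane Lagrangian rigidity:
`⟨x,x⟩ = 2^{α+β+1}θ₀ = 0` forces `#A·#B ≥ 2^{M−1}`; price M, risk (α) = the O(1) bits).  With these two, the corner stub Zζ `LoneSeedPartnerAtTwo`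
is now a KERNEL THEOREM `loneSeedPartnerAtTwo_of` (OSR at `m := n`, where `(n/n).primeFactors = ∅`, + SRS + the tree's pair Čebotarev
`KolyvaginLowerBoundAtTwo.exists_kolyvaginPrime_notMem_pair_of_heegner` + data UP `JET.exists_compatible_data_of_grossCM`), and EV
`SingularToVisibleAtTwo` (re-typed class-generally, margin one) is a KERNEL THEOREM `singularToVisibleAtTwo_holds` (Φ-KILL
`RegularRefill.localization_eq_zero_of_forall_h1Eval_eq_zero` + `mem_torsionLocalKer_two_pow_iff`).  SWα⁗ keeps its v7.6 statement (the LEAD is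
closing SWα on v7.2r — no churn); its docstring now records the derivation map SWα⁗ = OSR + SRS + ES (deep regular engine supply) + SRP (shape
persistence, (a⁗)) + data DOWN (`JET.exists_compatible_datum_of_dvd_of_grossCM`) + casts.  Stubs (7): S0ʳ `stub_roomSeedAtTwo` (INPUT) · LD
`stub_levelDropAtTwo` (S) · START `stub_startShapeAtTwo` (S) · SWα⁗ `stub_shedSeedPrimeShapedAtTwo` (L: = OSR+SRS+ES+SRP+bookkeeping) · OSR
`stub_oppositeSignReciprocityAtTwo` (M) · SRS `stub_signedRefillSupplyAtTwo` (M) · P372 `stub_heegnerCongruence` (print).  Sorry count 7, zero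
elsewhere; single crux-concluding theorem `KolyvaginBoundedDefectAtTwo_of_stubs`.  Nothing here proves SWα⁗, OSR, SRS, U1 or BSD.

v7.6 (g14, after critic #303 (T4) and the LEAD's cycle-1 find): START⁗ part (i) — the EXACT sign law at 2 — is now a KERNEL THEOREM
`kolyvaginClassSignAtTwo_holds` (from the tree's `GenusExact.KolyvaginClassSign.sign_conjAct_kolyvaginClass_two`); the stub `stub_startShapeAtTwo` keeps
only part (ii), the start shape.  Risk (c″) «exact signs at 2» is thereby DISCHARGED for Kolyvagin classes (it remains only inside OppShape's exact
families, where the LEAD may symmetrise).  Loss functions: `κ_SW a = max (κ_α a) (κ₀ a) ≥ κ₀ a ≥ a + 1`, so `κ_SW ≥ id` as critic #303 (T1) asks.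
Everything else = v7.5.


**v7.5 (g14, 2026-08-29 ~11:40Z) — critic #298 (ζ) ANSWERED IN THE TYPING (proposal; NOT registered; v7.2r stays the file of record).**
The rank `t` of the nearly-free `(−u)`-family is now an explicit argument of `OppShape`; SWα⁗ `ShedSeedPrimeShapedAtTwo` carries the
main-case hypothesis `1 ≤ t ∨ 2 ≤ #s` (a partner `g₁` exists, or the refill-forced partner `z ∈ H_{𝓕(qe)}` can shed a seed prime `q* ≠ q`);
the corner `t = 0 ∧ #s ≤ 1` is the NEW STUB Zζ `LoneSeedPartnerAtTwo` — it is VACUOUS: reciprocity for `(z, c_M(qeℓ))` has no seed term left,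
so the adapter's `ℓ` bounds the visible order of `c_M(qe)` by `2^{κ₀ a}` (critic #298's computation read as a lemma; no new input).  The cut
`seedPrimeSwapShapedAtTwo_of` takes `κ_SW a := max (κ_α a) (κ₀ a)` and splits cases (`vis_mono`); `walk` threads `t`.  Stubs: 7.

v7.4 (g14, 2026-08-29 ~12Z) — THE SIGNED REFILL LAW, TYPED (proposal; NOT registered; v7.2r stays the file of record).  The walk now
threads the SHAPE `OppShape` of the exact `(−u)`-part of the engine Selmer group `H_{𝓕(e)}(K,E[2^M])` (`u` = the exact sign of the walking class,
constant along the walk): «nearly free of some rank `t` up to `2^a` ⊕ no class outside the span beyond `2^a`», in the ADAPTER's currency (membership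
and relations modulo classes vanishing on `Γ_{K(E[2^{M+1}])}`, the one-bit phantom line K1⁺).  By the SIGNED REFILL LAW (card §v7.4: the reader's
co-cyclic refill law `RegularRefill.natCard_le_two_mul_of_lagrangian_of_cyclic` applied inside each eigen-plane `H_f^ε ⊕ H_tr^ε`, where co-cyclicity
is automatic, + isotropy/same-sign perfectness for the upper bound) the shape PERSISTS under every shed with `a ↦ g a` and costs `κ a` bits of room
(`∃ κ g : ℕ → ℕ`, uniform in `M`), and it SUPPLIES the partner (rank `≥ 1`: a nearly-free generator; rank `0`: the forced nearly-full `(−u)`-refill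
in the self-dual `H_{𝓕(qe)}` at any seed prime `q`).  MARGIN ONE (`M+1 ≤` every Kolyvagin index) is threaded so that the UP-class is EXACTLY
transverse (`kolyvaginClass_mem_transverseKer_two`); it is obtained for free from the seed by the one-bit LEVEL DROP `LevelDropAtTwo`.  START at
`e = 1` = the tree's `RegularWalk.startFrameAtTwo_holds` (eigen-frame, near-independence `2^{k−d}`, span up to `2^J`, uniform in `k`) read per sign
+ Gross's exact class sign (§5 (5.4)).  Stubs (6): `stub_roomSeedAtTwo` (S0ʳ INPUT, unchanged) · `stub_levelDropAtTwo` (LD, S) ·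
`stub_startShapeAtTwo` (START⁗, S) · `stub_shedSeedPrimeShapedAtTwo` (SWα⁗, THE hand, L) · `stub_heegnerCongruence` (P372 print) ·
`stub_singularToVisibleAtTwo` (EV, S).  Kernel (sorry-free): `seedPrimeSwapShapedAtTwo_of` (SWα⁗ + Q2 + EV ⟹ SW⁗), `room`/`walk` (threads `a`),
`deepSeedAtTwo_of_swap` (both signs' data fixed BEFORE the seed is drawn: room `R = max` over `u = ±1`), `Vertical.*` (v6, unchanged),
`KolyvaginBoundedDefectAtTwo_of_stubs` (the single crux-concluding theorem).  Nothing here proves SWα⁗, U1 or BSD.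

**v7.3 (g14, 2026-08-29 ~11Z) — FRAMELESS.**  The frame clauses of SW/SWα (a class of exact order `2^M` in `H_{𝓕(e)}` assumed at `e`
and returned at `e·f`) and the start line's role in the kernel are DELETED: the SWα blueprint no longer uses a near-core vertex or a frame
(eigen-dichotomy G/L on `H_{𝓕(e)}`: a big opposite-sign class IS the partner, else the Lagrangian complement at a seed prime builds one), so the
critic's relocated load (a″) «near-core reachability uniformly in M» disappears from the line; `walk` threads no frame; `StartLineAtTwo` stays as an
unused tree-backed support theorem.  Stub NAMES unchanged (`stub_roomSeedAtTwo`, `stub_shedSeedPrimeAtTwo`, `stub_heegnerCongruence`,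
`stub_singularToVisibleAtTwo`); only the TEXTS of SW/SWα change (v7.2 minus two conjuncts each).  Nothing here proves SWα, U1 or BSD.
# LINE 17 (v7.7 header above; v7.2r = the LEAD's registered file of record) `kolyvagin_swap` (v7.1 with the swap GENERALISED: shed one seed prime per BLOCK of `B+1` engine primes; §4–§5) — crux U1 `KolyvaginBoundedDefectAtTwo` (stmt-BirchSwinnertonDyer-28083)
# of route `KolyvaginRankRigidityAtTwo` (KRR); ideator seat `bsd-idea-1` (D-0145, gen 14; technique card
# «compactness–contradiction / RIGIDITY»; director focus: beyond-print theorems at the prime 2).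

TARGET BY NAME: `Summit.BirchSwinnertonDyer.BirchSwinnertonDyer.Theses.KolyvaginRankRigidityAtTwo.KolyvaginBoundedDefectAtTwo`.
No summit, no rung and no crux is proved by this file; BSD is NOT proved; U1 is NOT proved.

## Why v7 (2026-08-29, pen g14) — THE FREENESS SUBSTITUTE IS KOLYVAGIN'S OWN PRIME SWAP
The registered line of record v6 (`regular_core_rigidity_v6.lean`, sha 2a399f69403a) reduces U1 to {S0 input, P17 print, S2♭
`HorizontalCoreRigidityAtTwo`}, and the critic (#282) prices S2♭ as XL / research-grade: Mazur–Rubin / Howard freeness of the Kolyvagin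
system over `ℤ/2^L`, whose hypotheses (H.3)/(H.5) FAIL at 2 — «0 prover hands until a planner names the freeness substitute».
v7 NAMES it, from print: Kolyvagin never used freeness.  In *On the structure of Selmer groups* (Math. Ann. 291 (1991); held:
`paper:doi-10-1007-bf01445205`), proof of Thm. 2.2 (PDF p. 6): «Let η₁′ = p₀p₁′…p_f′ ∈ Λ^f_{m_f+1} be such that m(η₁′) = m_f.  By means of
[1, Proposition 8] we can, by induction, REPLACE p₁′, …, p_f′ by p₁, …, p_f such that η₁ = p₀…p_f ∈ Λ^f_{n₀} and m(η₁) = m_f» — the shallow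
primes of a seed conductor are SWAPPED one at a time for primes as deep as desired, keeping the divisibility exponent; and after Conj. 2.5
(PDF p. 8), for an ARBITRARY prime `ℓ` (so `ℓ = 2`, «with a natural modification for ℓ ∉ B(E)», p. 9): «there exists k(r) ≥ k₀ such that the
condition (2.1) [= strong nonzero system = our parent crux `KolyvaginStrongNonzeroSystemAtTwo`] is equivalent to the condition that
∃ n, V^r_{n,k(r)} ≠ 0» — a ROOM-SEED at relative depth `k(r)` gives the strong system.  [1] = Kolyvagin, *On the structure of
Shafarevich–Tate groups*, LNM 1479 (1991) 94–121 (`Kolyvagin1991StructureSha`; not held, acq-08093).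

## The swap at 2 (blueprint of the load-bearing stub `stub_seedPrimeSwapAtTwo`)
State: a Kolyvagin conductor `n = s·e` (seed part `s`, engine part `e` = regular Kolyvagin primes of index `≥ I` chosen by us), a level
`M ≤ M(n)`, a Kolyvagin–Heegner datum `d` with class `c = c_M(n)` of VISIBLE order `> 2^{v+κ}` (visible = after restriction to
`Γ_{K(E[2^M])}`, i.e. some `[c, ρ] = h1Eval c ρ ≠ 0`-multiple survives; the invisible part is the ONE-BIT phantom line
`H¹(K(E[2^M])/K, E[2^M]) ≤ ℤ/2`, K1⁺ `PhantomLineAtTwo`, landing by krr2-p2 g17), and a FRAME at the engine part: a class `x ∈ H_{𝓕(e)}(K, E[2^M])`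
(`Jetchev2008.modifiedSelmerGroup W K ι 2^M e`: Kummer condition off `e`, transverse at `e`) of exact order `2^M` (at `e = 1` this is the
tree theorem `RegularWalk.startFrameAtTwo_holds`, unconditional since Monsky's parity landed).  STEP: choose by the in-tree regular value
engine `RegularValueEngine.exists_regular_kolyvaginPrime_values_of_heegner` a regular Kolyvagin prime `ℓ ∤ n` of index `≥ I` whose Frobenius
`ρ ∈ Γ_{K(E[2^M])}` gives `loc_λ c = [c, ρ]` and `loc_λ x = [x, ρ]` their full visible orders and aligned under the local Tate pairing, so that
`B := ⟨φ_ℓ(loc^f_λ c), loc^f_λ x⟩_λ` has order `> 2^v` (`φ_ℓ : H¹_f(K_λ) → H¹_s(K_λ)` the finite-to-singular map; the engine also serves the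
parity lift of `((ℓ+1) ± a_ℓ)/2^M` that makes `φ_ℓ` injective on the line of `loc c`, and keeps a frame at `e·ℓ`).  By the UP relation
(Kolyvagin [1, Prop. 1]/Gross Prop. 6.2(2); the tree's Q2♭↑ reading `KolyvaginTransferUpAtTwo`) `loc^s_λ c_M(nℓ) = φ_ℓ(loc^f_λ c)`.  POITOU–TATE
for the pair `(c_M(nℓ), x)`: `Σ_w inv_w(c_M(nℓ) ∪ x) = 0`; the terms vanish at the primes of `e` (both classes transverse — a Lagrangian), off
`nℓ·N·2·∞` (both unramified), at `∞` (complex place) and — up to a BOUNDED index absorbed in `κ` (component groups at `v ∣ N`, `E(K_v)[2^∞]`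
at `v ∣ 2`) — at `v ∣ 2N`; what is left is `B + Σ_{q ∣ s} ⟨loc^s_q c_M(nℓ), loc^f_q x⟩ = 0`.  Hence SOME seed prime `q ∣ s` has
`loc^s_q c_M(nℓ)` of order `> 2^v`, and by the DOWN reading of the same relation at `q` (`loc^s_q c_M(nℓ) = φ_q(loc^f_q c_M(nℓ/q))`, `φ_q` a
homomorphism — no invertibility needed in this direction) `loc^f_q c_M(nℓ/q) = [c_M(nℓ/q), Frob_q]` has order `> 2^v`: the class at the
conductor `nℓ/q = (s/q)·(eℓ)` — ONE SEED PRIME FEWER, same depth, same level — is visibly of order `> 2^v`.  Iterating `#s` times (kernel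
below: induction on the number of seed primes, room budget `κ` per step) reaches a conductor made of engine primes only, of index `≥ I`, with
`c_{M}(·) ≠ 0` at the FIXED seed level: that is `DeepSeedAtTwo`, and `DeepSeedAtTwo → U1` is the v6 kernel theorem (vertical growth,
McCallum 4.5 at 2, PROVED, §2–§3 below verbatim from v6).

v7.1 (§5) CUTS SW: SW ⟸ SWα `ShedSeedPrimeAtTwo` (reciprocity shedding, NEW, L) + Q2 at 2 = GK2 item 24880 BY NAME
(tree theorem modulo the PRINT fact `GrossLMS1991.prop37_2_frobeniusCongruence`, p614530) + EV `SingularToVisibleAtTwo` (routine, S); stubs of v7.1 =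
{S0ʳ input, SWα, P372 print, EV routine} — sorry count 4, zero elsewhere.  (v7 proper:) REGISTERED-SHAPE STUBS v7 = {S0ʳ `stub_roomSeedAtTwo` (INPUT: Kolyvagin's conjecture at 2 in Kolyvagin's own k(r)-form — classes of
UNBOUNDED visible order at one depth), SW `stub_seedPrimeSwapAtTwo` (THE theorem of the line, L: the reciprocity swap at 2 on engine primes)}
— sorry count 2, zero elsewhere; the start frame is the tree theorem BY NAME (`startLineAtTwo_holds`, no sorry);
`KolyvaginBoundedDefectAtTwo_of_stubs ⊢ U1` BY NAME.  S0ʳ sits between the S0 cell's frame `KolyvaginNonvanishingAtTwoFrame` (24622: one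
non-zero class) and U1 (U1 ⟹ S0ʳ given K1⁺; S0ʳ ⟹ 24622 trivially); the gap 24622 ↛ S0ʳ is the honest residue of «weak ⟹ strong» at 2
(a seed that IS the phantom, or has no room, cannot be swapped) and is exactly Kolyvagin's k(r).  NOT a costume: SW is a local-to-the-seed
statement (any visibly roomy class at any (n, M) can shed a seed prime), not a reading of U1; S0ʳ alone gives no deep conductor at a fixed level.
Why SW might fail (for the card): (a) ALIGNMENT — if `c_M(n)` and the frame class `x` are visibly DEPENDENT mod 2 the engine cannot make `B ≠ 0`
(reciprocity then forces `B = 0`); the prover must re-frame (`x ↦ x + y`) or detour through one UP step; (b) the bad-prime terms at `v ∣ 2N` must be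
bounded uniformly in `M` (Kummer images vs unramified classes: component groups, bounded); (c) frame propagation `e ↦ eℓ` jointly with the value
prescription (the tree's RegularWalk step does each separately).  NOT registered by the pen (W-79); v6 stays the line of record until the
director / critic rule.  BSD is NOT proved; U1 is NOT proved (S0ʳ, SW open).

## v7.2 (pen g14, ~09:50Z) — SIGN-LINE ISOTROPY and the NEAR-CORE SQUEEZE (why the swap now adds a BLOCK of engine primes)
Self-audit of SWα's blueprint found the precise form of risk (a): at a regular prime `λ` (Frobenius `h`, `h² = 1`, `E[2^M]` free of rank one
over `ℤ/2^M[h]`) the two lines `N_± = (1 ± h)E[2^M] ≅ ℤ/2^M` are each ISOTROPIC for the local Tate (Weil) pairing and `e(N_+, N_−) = 2·(perfect)`;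
the localisation of a class `c` with `c^{τ} = ε c` at any admissible `λ` lies in (an offset inside) `N_ε`, and `φ_ℓ` preserves `N_ε`.  Hence the
reciprocity term `B = ⟨φ_ℓ loc_λ c_M(n), loc_λ x⟩` VANISHES IDENTICALLY whenever the partner `x` is visibly of the seed's sign `ε_n` — exactly
Kolyvagin's sign alternation (p odd: `E⁺ ⊥ E⁺`), which survives at 2 as line-isotropy.  A partner of the opposite line need not exist in
`H_{𝓕(e)}` (e.g. Ш[2^∞] small, rank one, seed of the wrong parity).  REPAIR = Kolyvagin's own freedom to insert primes BEFORE removing one: the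
swap step may first take `t ≤ B` UP steps `n ↦ nℓ₁⋯ℓ_t` (aligned engine values keep the class big: Q2-up, tree) that (i) make `H_{𝓕(eℓ₁⋯ℓ_t)}`
NEAR-CORE (`2^κ H ⊆ ℤx'`, the tree's S1b mechanism `RegularWalk.nearCoreExistenceAtTwo_holds`) and (ii) flip the class sign `ε ↦ −ε` once if
needed; then the NEAR-CORE SQUEEZE: `x'` is `τ`-eigen up to `2^κ` (automatic for a near-cyclic `τ`-stable group: `u² ≡ 1`) with some sign `u`, the
prolonged class `c'` has sign `−u`, so if ALL seed-prime singular parts of `c'` were `≤ 2^v` then `2^{v+b} c' ∈ H_{𝓕(e')}` would be a big class of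
sign `−u` inside `ℤx' + (2^κ-torsion)` of sign `u`, forcing `2·2^κ·2^{v+b} c' = 0` — contradiction with the room.  So SOME seed prime `q` carries a
singular part of `c'` of order `> 2^v`, and the DOWN reading (Q2 + EV, §5) sheds it.  No partner and no Poitou–Tate sum is needed on this branch
(reciprocity with an opposite-line partner remains plan B).  Consequently SW / SWα are RE-TYPED (v7.2): one shed = remove ONE seed prime and add
a block `f` of exactly `B+1` new regular engine primes of index `≥ I` (`B` uniform, chosen by the prover together with `κ`; `B = 0` is v7.1's
statement, so v7.2's SW/SWα are WEAKER than v7.1's); the kernel `walk` carries the invariant `#primes(n) + B·#primes(s) = r(1+B)` and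
`DeepSeedAtTwo` gets depth `r + B·r`.  Sorry count unchanged (4: S0ʳ, SWα, P372, EV).  BC7 re-probed for the re-typed SW/SWα.
-/

namespace Summit.BirchSwinnertonDyer.BirchSwinnertonDyer.Cruxes.KolyvaginBoundedDefectAtTwo.KolyvaginSwap.Vertical

open scoped Classical
open WeierstrassCurve NumberField Field
open Literature.NumberTheory.GaloisRepresentations Literature.NumberTheory.EllipticCurves Literature.NumberTheory
open Literature.NumberTheory.EllipticCurves.ModularForms Literature.NumberTheory.EllipticCurves.KolyvaginCocycle
open Summit.BirchSwinnertonDyer.Rank1Residual.X11b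
open Summit.BirchSwinnertonDyer.BirchSwinnertonDyer.Theorems
open Summit.BirchSwinnertonDyer.BirchSwinnertonDyer.Theorems.GenusExact.PlusDescent
open Summit.BirchSwinnertonDyer.BirchSwinnertonDyer.Theses.KolyvaginRankRigidityAtTwo

/-! ## §1 `P(n) ∉ 2^{M₁} E(K[n]) ⟹ 2^j · c_M(n) ≠ 0` for `j + M₁ ≤ M` -/

section Family

variable {W : WeierstrassCurve ℚ} [NeZero (W.conductorNorm ℤ)] {K : Type} [Field K] [NumberField K]
  {Dt : ModularParametrizationData W (W.conductorNorm ℤ)} {β : ℤ} {ι : K →+* ℂ}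

/-- **`2^j·c_M(n) ≠ 0` for `j + M₁ ≤ M` when `P(n) ∉ 2^{M₁}E(K[n])`** on U1's frame (GK2's `pow_zsmul_kolyvaginClass_two_ne_zero` with
`2` replaced by `2^{M₁}`): `2^j·c_M(n) = c_M(2^j P(n))` vanishes iff `2^j P(n) = 2^M B` with `B ∈ E(K[n])` (McCallum Cor. 4.5), and then
`2^j (2^{M−j} B − P(n)) = 0` with `E(K[n])[2^∞] = 0` gives `P(n) = 2^{M₁}·(2^{M−j−M₁} B)`.
[cite: McCallumLMS1991, §4 Cor. 4.5] [cite: GrossLMS1991, Prop. 4.7 (1) and Lemma 4.3] -/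
theorem pow_zsmul_kolyvaginClass_two_ne_zero_of_not_pDiv [W.IsElliptic] [W.IsGloballyMinimal] (hK : IsImaginaryQuadratic K)
    (hodd : Odd (NumberField.discr K)) (h3 : NumberField.discr K ≠ -3)
    (hH : SatisfiesHeegnerHypothesis (W.conductorNorm ℤ) K) (hsurj : W.HasSurjectiveModNGaloisRep ((2 : ℤ) ^ 1))
    {n M : ℕ} (hn : Squarefree n)
    (hkol : ∀ q ∈ n.primeFactors,
      Zhang2014.IsKolyvaginPrime (W.conductorNorm ℤ) W K 2 q ∧ M ≤ Zhang2014.kolyvaginIndex W 2 q)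
    (d : (m : ℕ) → m ∣ n → KolyvaginHeegnerData Dt β ι m) {M₁ : ℕ}
    (hprim : ¬ Three.Koly.PDiv (d n dvd_rfl) 2 M₁) {j : ℕ} (hj : j + M₁ ≤ M) :
    (((2 ^ j : ℕ) : ℤ)) • (d n dvd_rfl).kolyvaginClass Nat.prime_two M ≠ 0 := by
  have hA := GenusKoly.isAdmissible_pointsSubgroup_two hK hodd hH hsurj hn.ne_zero (d n dvd_rfl) M
  have hP := Three.KolyCert.toGeomPoints_derivedPoint_mem_invPoints_of_dvd_zhang hK ι Dt Nat.prime_two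
    (GenusKoly.heegner_isCoprime_conductorNorm_discr hK hH) (GenusKoly.discr_lt_neg_four_of_odd hK hodd h3) hn hkol d n
    dvd_rfl
  set dn := d n dvd_rfl with hdn
  rw [dn.kolyvaginClass_of_admissible Nat.prime_two M hA hP, ← kolyvaginClass_zsmul]
  have hpt : (((2 ^ j : ℕ) : ℤ)) • dn.toGeomPoints dn.derivedPoint =
      dn.toGeomPoints ((((2 ^ j : ℕ) : ℤ)) • dn.derivedPoint) := (map_zsmul _ _ _).symm
  rw [KolyvaginDescent.kolyvaginClass_congr_point hA
      (hP' := by rw [← hpt]; exact AddSubgroup.zsmul_mem _ hP _) hpt]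
  intro h0
  obtain ⟨_, ⟨B, rfl⟩, hB⟩ := (kolyvaginClass_eq_zero_iff hA _
      (N := {g : absoluteGaloisGroup K | ∀ x : ringClassField K ι n,
        (show AlgebraicClosure K ≃ₐ[K] AlgebraicClosure K from g) (dn.emb x) = dn.emb x})
      (fun g hg ↦ Three.KolyCert.smul_toGeomPoints_of_forall_emb dn g hg _)
      (fun v hv ↦ Three.KolyCert.mem_pointsSubgroup_of_forall_smul_eq dn v fun g hg ↦ hv g hg)).mp h0
  -- `2^M • B = 2^j • P(n)` in `E(K[n])`
  have hB' : (((2 ^ M : ℕ) : ℤ)) • B = (((2 ^ j : ℕ) : ℤ)) • dn.derivedPoint := by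
    apply Affine.Point.map_injective (W' := W) dn.emb.toRatAlgHom
    change dn.toGeomPoints ((((2 ^ M : ℕ) : ℤ)) • B) = dn.toGeomPoints ((((2 ^ j : ℕ) : ℤ)) • dn.derivedPoint)
    rw [map_zsmul]
    exact hB
  obtain ⟨e, he⟩ := Nat.exists_eq_add_of_le hj
  -- `2^j • (2^{M₁+e} • B − P(n)) = 0`, hence `P(n) = 2^{M₁} • (2^e • B)`
  have hzero : (((2 ^ j : ℕ) : ℤ)) • ((((2 ^ (M₁ + e) : ℕ) : ℤ)) • B - dn.derivedPoint) = 0 := by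
    rw [zsmul_sub, smul_smul, ← hB', he]
    push_cast
    ring_nf
    simp
  have hfree := GenusKoly.heegner_two_pow_torsion_free (ι := ι) hK hodd hH hsurj hn.ne_zero j _ hzero
  rw [sub_eq_zero] at hfree
  apply hprim
  refine ⟨(((2 ^ e : ℕ) : ℤ)) • B, ?_⟩
  rw [smul_smul, ← hfree]
  push_cast
  ring_nf

/-- **Vertical growth, family form**: `c_{M₁}(n) ≠ 0 ∧ M₁ ≤ M ≤ M(n) ⟹ 2^{M−M₁} · c_M(n) ≠ 0`. [cite: McCallumLMS1991, §4 Cor. 4.5, Lemma 4.6] -/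
theorem two_pow_sub_zsmul_kolyvaginClass_two_ne_zero [W.IsElliptic] [W.IsGloballyMinimal] (hK : IsImaginaryQuadratic K)
    (hodd : Odd (NumberField.discr K)) (h3 : NumberField.discr K ≠ -3)
    (hH : SatisfiesHeegnerHypothesis (W.conductorNorm ℤ) K) (hsurj : W.HasSurjectiveModNGaloisRep ((2 : ℤ) ^ 1))
    {n M : ℕ} (hn : Squarefree n)
    (hkol : ∀ q ∈ n.primeFactors,
      Zhang2014.IsKolyvaginPrime (W.conductorNorm ℤ) W K 2 q ∧ M ≤ Zhang2014.kolyvaginIndex W 2 q)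
    (d : (m : ℕ) → m ∣ n → KolyvaginHeegnerData Dt β ι m) {M₁ : ℕ}
    (hseed : (d n dvd_rfl).kolyvaginClass Nat.prime_two M₁ ≠ 0) (hM₁ : M₁ ≤ M) :
    (((2 ^ (M - M₁) : ℕ) : ℤ)) • (d n dvd_rfl).kolyvaginClass Nat.prime_two M ≠ 0 :=
  pow_zsmul_kolyvaginClass_two_ne_zero_of_not_pDiv hK hodd h3 hH hsurj hn hkol d
    (Three.Koly.not_pDiv_of_kolyvaginClass_ne_zero _ hseed) (by omega)

end Family

/-! ## §2 VERTICAL GROWTH in U1's single-datum currency — PROVED -/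

/-- VG · VERTICAL GROWTH AT 2 (U1's frame and currency, one Kolyvagin–Heegner datum `d` at `n`): a non-zero class at ONE level `M₁`
forces `2^{M−M₁}·c_M(n) ≠ 0` at every level `M₁ ≤ M ≤ M(n)` (order `≥ 2^{M−M₁+1}`, defect `≤ M₁ − 1`).  PROVED below
(`verticalGrowthAtTwo_holds`); stated as a `def` so that skeletons can take it BY NAME. [cite: McCallumLMS1991, §4 Cor. 4.5, Lemma 4.6] -/
def VerticalGrowthAtTwo : Prop :=
  ∀ (W : WeierstrassCurve ℚ) [W.IsElliptic] [W.IsGloballyMinimal], (∀ m : ℕ, W.HasSurjectiveModNGaloisRep (2 ^ m : ℕ)) →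
    ∀ (K : Type) [Field K] [NumberField K], IsImaginaryQuadratic K → ∀ [NeZero (W.conductorNorm ℤ)],
    SatisfiesHeegnerHypothesis (W.conductorNorm ℤ) K → Odd (NumberField.discr K) → NumberField.discr K ≠ -3 →
    ∀ (Dt : ModularParametrizationData W (W.conductorNorm ℤ)) (β : ℤ) (ι : K →+* ℂ) (n : ℕ) (d : KolyvaginHeegnerData Dt β ι n)
      (M₁ M : ℕ), KolyvaginDescent.KolSupp (Zhang2014.IsKolyvaginPrime (W.conductorNorm ℤ) W K 2) n →
      ((M : ℕ) : ℕ∞) ≤ Zhang2014.levelIndex W 2 n → M₁ ≤ M → d.kolyvaginClass Nat.prime_two M₁ ≠ 0 →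
      (2 ^ (M - M₁) : ℤ) • d.kolyvaginClass Nat.prime_two M ≠ 0

/-- **VG holds** (sorry-free): data at the divisors of `n` from Gross's two CM facts (both PROVED in Literature:
`phi_heegnerPointOfConductor_mem_range_map_ringClassField_holds`, `exists_generator_ringClassGalOver_holds`) via
`nonempty_kolyvaginHeegnerData_of_grossCM`, patched to the given `d` at `n`; then §1.
[cite: McCallumLMS1991, §4 Cor. 4.5] [cite: GrossLMS1991, §3–§4] -/
theorem verticalGrowthAtTwo_holds : VerticalGrowthAtTwo := by
  intro W _ _ hsurj K _ _ hK _ hH hodd h3 Dt β ι n d M₁ M hKol hidx hM₁ hseed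
  have hsurj1 : W.HasSurjectiveModNGaloisRep ((2 : ℤ) ^ 1) := by simpa using hsurj 1
  have hn : Squarefree n := hKol.1
  have hkol : ∀ q ∈ n.primeFactors,
      Zhang2014.IsKolyvaginPrime (W.conductorNorm ℤ) W K 2 q ∧ M ≤ Zhang2014.kolyvaginIndex W 2 q :=
    fun q hq ↦ ⟨hKol.2 q hq, Zhang2014.natCast_le_levelIndex_iff.mp hidx q hq⟩
  have hinert : ∀ q ∈ n.primeFactors, (Ideal.span {(q : 𝓞 K)}).IsPrime := fun q hq ↦ (hKol.2 q hq).2.2.2.2.1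
  have hCM1 : phi_heegnerPointOfConductor_mem_range_map_ringClassField (W.conductorNorm ℤ) W K :=
    phi_heegnerPointOfConductor_mem_range_map_ringClassField_holds (W.conductorNorm ℤ) W K
  have hCM2 : exists_generator_ringClassGalOver K := exists_generator_ringClassGalOver_holds
  have hne : ∀ m : ℕ, m ∣ n → Nonempty (KolyvaginHeegnerData Dt β ι m) := fun m hm ↦
    nonempty_kolyvaginHeegnerData_of_grossCM hCM1 hCM2 hK hH Dt β ι d.dvd_sq_sub (hn.squarefree_of_dvd hm)
      (fun q hq ↦ hinert q (Nat.primeFactors_mono hm hn.ne_zero hq))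
  let data : (m : ℕ) → m ∣ n → KolyvaginHeegnerData Dt β ι m := fun m hm ↦
    if h : m = n then h ▸ d else (hne m hm).some
  have hdata : data n dvd_rfl = d := by simp [data]
  have h := two_pow_sub_zsmul_kolyvaginClass_two_ne_zero hK hodd h3 hH hsurj1 hn hkol data (M₁ := M₁)
    (by rw [hdata]; exact hseed) hM₁
  rw [hdata] at h
  simpa only [Nat.cast_pow, Nat.cast_ofNat] using h

/-! ## §3 DEEP SEED ⟹ U1 (kernel-checked reading of the crux) -/

/-- S0⁺ · DEEP SEED AT 2 — Kolyvagin's conjecture at 2 in DEEP FIXED-LEVEL form on U1's habitat and frame: a depth `r` and ONE level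
`M₁ ≥ 1` such that for every `M* ≥ M₁` some square-free Kolyvagin conductor `n` with exactly `r` prime factors, all of Kolyvagin index
`≥ M*`, carries a Kolyvagin–Heegner datum with `c_{M₁}(n) ≠ 0`.  Beyond print at 2 (W. Zhang 2014 / BCGS are `p` odd; at `p ≥ 5` it is
what Zhang's theorem gives at the core vertices of `Sel_p(E/K)`, which exist at every index).  Implies U1 (next theorem) and is implied
by U1 (level reduction) — so it is a READING of the crux, not a weakening.  Why it might fail: only with Kolyvagin's conjecture at 2 itself.
[cite: Kolyvagin1991StructureSha] [cite: WZhang2014, Thm. 1.1] -/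
def DeepSeedAtTwo : Prop :=
  ∀ (W : WeierstrassCurve ℚ) [W.IsElliptic] [W.IsGloballyMinimal], ¬ W.HasCM →
    (Literature.NumberTheory.EllipticCurves.Rank1Residual.GoodOrd W 2 ∨ Literature.NumberTheory.EllipticCurves.Rank1Residual.Mult W 2) →
    (∀ m : ℕ, W.HasSurjectiveModNGaloisRep (2 ^ m : ℕ)) → ∀ (K : Type) [Field K] [NumberField K],
    IsImaginaryQuadratic K → ∀ [NeZero (W.conductorNorm ℤ)], SatisfiesHeegnerHypothesis (W.conductorNorm ℤ) K →
    Odd (NumberField.discr K) → NumberField.discr K ≠ -3 → AddSubgroup.torsionBy (W.baseChange K).toAffine.Point (2 : ℤ) = ⊥ →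
    SatisfiesHeegnerHypothesis 2 K →
    ∀ (Dt : ModularParametrizationData W (W.conductorNorm ℤ)) (β : ℤ) (ι : K →+* ℂ),
      (4 * (W.conductorNorm ℤ : ℤ)) ∣ β ^ 2 - NumberField.discr K →
      ∃ r M₁ : ℕ, 1 ≤ M₁ ∧ ∀ Mstar : ℕ, M₁ ≤ Mstar →
        ∃ (n : ℕ) (d : KolyvaginHeegnerData Dt β ι n),
          KolyvaginDescent.KolSupp (Zhang2014.IsKolyvaginPrime (W.conductorNorm ℤ) W K 2) n ∧ n.primeFactors.card = r ∧
          ((Mstar : ℕ) : ℕ∞) ≤ Zhang2014.levelIndex W 2 n ∧ d.kolyvaginClass Nat.prime_two M₁ ≠ 0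

/-- **DEEP SEED ⟹ U1** (sorry-free; `r := r`, `m := M₁ − 1`, the vertex for level `M` is the deep seed's vertex at `M* := M`, and the
order bound is VERTICAL GROWTH §2).  GATE SKELETON RULE (ladder-directors (372), 09:45Z): the crux decl `KolyvaginBoundedDefectAtTwo`
may be the conclusion BY NAME of EXACTLY ONE theorem in the file (`KolyvaginBoundedDefectAtTwo_of_stubs`, zero hypotheses); every intermediate
concludes the ALIAS `CruxAlias` (unfolds to the crux; the gate matches conclusions by name without unfolding). -/
def CruxAlias : Prop := KolyvaginBoundedDefectAtTwo

theorem cruxAlias_iff : CruxAlias ↔ KolyvaginBoundedDefectAtTwo := Iff.rfl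

theorem boundedDefect_of_deepSeed (h : DeepSeedAtTwo) : CruxAlias := by
  show KolyvaginBoundedDefectAtTwo
  intro W _ _ hCM hred hsurj K _ _ hK _ hH hodd hd3 htors hH2 Dt β ι hβ
  obtain ⟨r, M₁, hM₁, hdeep⟩ := h W hCM hred hsurj K hK hH hodd hd3 htors hH2 Dt β ι hβ
  refine ⟨r, M₁ - 1, fun M hM ↦ ?_⟩
  obtain ⟨n, d, hKol, hcard, hidx, hseed⟩ := hdeep M (by omega)
  refine ⟨n, d, hKol, hcard, hidx, ?_⟩
  have hMm : M - (M₁ - 1) - 1 = M - M₁ := by omega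
  rw [hMm]
  exact verticalGrowthAtTwo_holds W hsurj K hK hH hodd hd3 Dt β ι n d M₁ M hKol hidx (by omega) hseed

end Summit.BirchSwinnertonDyer.BirchSwinnertonDyer.Cruxes.KolyvaginBoundedDefectAtTwo.KolyvaginSwap.Vertical

/-! ## §4 (v7.4) KOLYVAGIN'S PRIME SWAP AT 2 WITH THE SIGNED SHAPE: {S0ʳ, LD, START⁗, SW⁗} ⟹ DeepSeedAtTwo ⟹ U1 -/

namespace Summit.BirchSwinnertonDyer.BirchSwinnertonDyer.Cruxes.KolyvaginBoundedDefectAtTwo.KolyvaginSwap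

open scoped Classical
open WeierstrassCurve NumberField IsDedekindDomain Field
open Literature.NumberTheory.GaloisRepresentations Literature.NumberTheory.EllipticCurves
open Literature.NumberTheory
open Rat.HeightOneSpectrum
open Summit.BirchSwinnertonDyer.BirchSwinnertonDyer.Theorems
open Summit.BirchSwinnertonDyer.BirchSwinnertonDyer.Theses.KolyvaginRankRigidityAtTwo

/-- S0ʳ · ROOM SEED AT 2 (THE INPUT of the line; Kolyvagin's conjecture at 2 in Kolyvagin's `k(r)`-form).  On U1's habitat and frame:
there is a depth `r` such that for every room `k` some square-free Kolyvagin conductor `n` with exactly `r` prime factors, some level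
`1 ≤ M ≤ M(n)` and some Kolyvagin–Heegner datum `d` have `c_M(n)` of VISIBLE order `> 2^k`: `2^k · [c_M(n), ρ] ≠ 0` for some
`ρ ∈ Γ_{K(E[2^M])}` (`torsionFixing`, `h1Eval` — the tree's Gross §9 pairing).  Between the S0 cell's frame `KolyvaginNonvanishingAtTwoFrame`
(implied: a visible class is non-zero) and U1 (which implies it, given the one-bit phantom line K1⁺); it does NOT by itself put a non-zero
class of a FIXED level on conductors of unbounded index (that is what SW adds).  In print for `ℓ` odd with surjective `ρ̄` this much is what
Zhang 2014 / Kolyvagin's `m_r < ∞` give; at 2 it is beyond print like every form of Kolyvagin's conjecture.  Why it might fail: only with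
Kolyvagin's conjecture at 2 itself, or if all depth-`r` classes at 2 were phantoms / of bounded order (no known mechanism).
[cite: Kolyvagin1991MathAnn, §2 (2.1), Conj. 2.5 and the k(r) remark] [cite: WZhang2014, Thm. 1.1] [cite: GrossLMS1991, §9] -/
def KolyvaginRoomSeedAtTwo : Prop :=
  ∀ (W : WeierstrassCurve ℚ) [W.IsElliptic] [W.IsGloballyMinimal], ¬ W.HasCM → (Literature.NumberTheory.EllipticCurves.Rank1Residual.GoodOrd W 2 ∨ Literature.NumberTheory.EllipticCurves.Rank1Residual.Mult W 2) → (∀ m : ℕ, W.HasSurjectiveModNGaloisRep (2 ^ m : ℕ)) → ∀ (K : Type) [Field K] [NumberField K], Literature.NumberTheory.EllipticCurves.IsImaginaryQuadratic K → ∀ [NeZero (W.conductorNorm ℤ)], Literature.NumberTheory.EllipticCurves.SatisfiesHeegnerHypothesis (W.conductorNorm ℤ) K → Odd (NumberField.discr K) → NumberField.discr K ≠ -3 → AddSubgroup.torsionBy (W.baseChange K).toAffine.Point (2 : ℤ) = ⊥ → Literature.NumberTheory.EllipticCurves.SatisfiesHeegnerHypothesis 2 K → ∀ (Dt : Literature.NumberTheory.EllipticCurves.ModularForms.ModularParametrizationData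 W (W.conductorNorm ℤ)) (β : ℤ) (ι : K →+* ℂ), (4 * (W.conductorNorm ℤ : ℤ)) ∣ β ^ 2 - NumberField.discr K →
    ∃ r : ℕ, ∀ k : ℕ, ∃ (n : ℕ) (d : Literature.NumberTheory.EllipticCurves.KolyvaginHeegnerData Dt β ι n) (M : ℕ),
      Literature.NumberTheory.EllipticCurves.KolyvaginDescent.KolSupp (Literature.NumberTheory.EllipticCurves.Zhang2014.IsKolyvaginPrime (W.conductorNorm ℤ) W K 2) n ∧
      n.primeFactors.card = r ∧ 1 ≤ M ∧ ((M : ℕ) : ℕ∞) ≤ Literature.NumberTheory.EllipticCurves.Zhang2014.levelIndex W 2 n ∧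
      ∃ ρ ∈ torsionFixing (W.baseChange K) ((2 ^ M : ℕ) : ℤ),
        ((2 ^ k : ℕ) : ℤ) • h1Eval (W.baseChange K) ((2 ^ M : ℕ) : ℤ) (d.kolyvaginClass Nat.prime_two M) ρ ≠ 0

/-! ## §5 (v7.4) THE SIGNED SHAPE, THE SHAPED SHED AND ITS CUT -/

/-- **THE SHAPE `Sh(t, a)` OF THE `(−u)`-PART OF THE ENGINE SELMER GROUP** (v7.4; the invariant the signed refill law preserves).  In the engine
adapter's currency (`WalkEngineAdapter.exists_regular_kolyvaginPrime_killing`: relations read modulo classes vanishing on `Γ_{K(E[2^{M+1}])}` — the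
phantom line K1⁺, one bit): there are exact `(−u)`-eigenclasses `g₁,…,g_t ∈ H := H_{𝓕(e)}(K,E[2^M])` (`Jetchev2008.modifiedSelmerGroup … e`) that are
NEARLY FREE (`Σ bᵢ gᵢ ≡ 0 ⟹ 2^{M−a} ∣ bᵢ`) and such that every exact `(−u)`-eigenclass `y ∈ H` has `2^a y ≡ Σ bᵢ gᵢ` (NO MEDIUM CLASSES outside the
span).  At `e = 1` this is the tree's start frame read per sign (`RegularWalk.startFrameAtTwo_holds`: `J`, `d` uniform in the level). -/
def OppShape (W : WeierstrassCurve ℚ) [W.IsElliptic] (K : Type) [Field K] [NumberField K] (ι : K →+* ℂ)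
    [∀ k : ℕ, NumberField (ringClassField K ι k)] (τ : K ≃ₐ[ℚ] K) (M e : ℕ) (u : ℤ) (a t : ℕ) : Prop :=
  ∃ (g : Fin t → galH1Torsion (W.baseChange K) ((2 ^ M : ℕ) : ℤ)),
    (∀ i, g i ∈ Jetchev2008.modifiedSelmerGroup W K ι ((2 ^ M : ℕ) : ℤ) e) ∧
    (∀ i, conjAct W τ ((2 ^ M : ℕ) : ℤ) (g i) = (-u) • g i) ∧
    (∀ b : Fin t → ℤ, (∀ σ ∈ torsionFixing (W.baseChange K) ((2 ^ (M + 1) : ℕ) : ℤ),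
        h1Eval (W.baseChange K) ((2 ^ M : ℕ) : ℤ) (∑ i, b i • g i) σ = 0) → ∀ i, (2 : ℤ) ^ (M - a) ∣ b i) ∧
    (∀ y : galH1Torsion (W.baseChange K) ((2 ^ M : ℕ) : ℤ), y ∈ Jetchev2008.modifiedSelmerGroup W K ι ((2 ^ M : ℕ) : ℤ) e →
      conjAct W τ ((2 ^ M : ℕ) : ℤ) y = (-u) • y →
      ∃ b : Fin t → ℤ, ∀ σ ∈ torsionFixing (W.baseChange K) ((2 ^ (M + 1) : ℕ) : ℤ),
        h1Eval (W.baseChange K) ((2 ^ M : ℕ) : ℤ) (((2 : ℤ) ^ a) • y - ∑ i, b i • g i) σ = 0)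

/-- LD · LEVEL DROP (routine support, S): visible order survives one level down at the cost of one bit, and a class of visible order `> 2`
has level `≥ 2`: `c_{M−1}(n) = (·2)_* c_M(n)` (`E(K_n)/2^M → E(K_n)/2^{M−1}` on the Kummer side), `[c_{M−1}(n), ρ] = 2·[c_M(n), ρ]` for
`ρ ∈ Γ_{K(E[2^M])} ≤ Γ_{K(E[2^{M−1}])}` (K1⁺ level-change API `RegularValueEngine.h1Eval_torsionH1OfDvd`), and `2^M` kills `[c_M(n), ρ] ∈ E[2^M]`.
This is how the kernel gets MARGIN ONE for free: the whole walk runs at level `M−1` where the seed had level `M ≤ M(n)`. -/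
def LevelDropAtTwo : Prop :=
  ∀ (W : WeierstrassCurve ℚ) [W.IsElliptic] [W.IsGloballyMinimal], ¬ W.HasCM → (Literature.NumberTheory.EllipticCurves.Rank1Residual.GoodOrd W 2 ∨ Literature.NumberTheory.EllipticCurves.Rank1Residual.Mult W 2) → (∀ m : ℕ, W.HasSurjectiveModNGaloisRep (2 ^ m : ℕ)) → ∀ (K : Type) [Field K] [NumberField K], Literature.NumberTheory.EllipticCurves.IsImaginaryQuadratic K → ∀ [NeZero (W.conductorNorm ℤ)], Literature.NumberTheory.EllipticCurves.SatisfiesHeegnerHypothesis (W.conductorNorm ℤ) K → Odd (NumberField.discr K) → NumberField.discr K ≠ -3 → AddSubgroup.torsionBy (W.baseChange K).toAffine.Point (2 : ℤ) = ⊥ → Literature.NumberTheory.EllipticCurves.SatisfiesHeegnerHypothesis 2 K → ∀ (Dt : Literature.NumberTheory.EllipticCurves.ModularForms.ModularParametrizationData W (W.conductorNorm ℤ)) (β : ℤ) (ι : K →+* ℂ) [∀ k : ℕ, NumberField (ringClassField K ι k)], (4 * (W.conductorNorm ℤ : ℤ)) ∣ β ^ 2 - NumberField.discr K →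
    ∀ (n M k : ℕ) (d : Literature.NumberTheory.EllipticCurves.KolyvaginHeegnerData Dt β ι n), 1 ≤ M →
      (∃ ρ ∈ torsionFixing (W.baseChange K) ((2 ^ M : ℕ) : ℤ),
          ((2 ^ (k + 1) : ℕ) : ℤ) • h1Eval (W.baseChange K) ((2 ^ M : ℕ) : ℤ) (d.kolyvaginClass Nat.prime_two M) ρ ≠ 0) →
      2 ≤ M ∧ ∃ ρ ∈ torsionFixing (W.baseChange K) ((2 ^ (M - 1) : ℕ) : ℤ),
          ((2 ^ k : ℕ) : ℤ) • h1Eval (W.baseChange K) ((2 ^ (M - 1) : ℕ) : ℤ) (d.kolyvaginClass Nat.prime_two (M - 1)) ρ ≠ 0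

/-- SIGN LAW AT 2 (START⁗ part (i), v7.6: NO LONGER A STUB — proved below from the tree theorem
`GenusExact.KolyvaginClassSign.sign_conjAct_kolyvaginClass_two`, Gross 1991 Prop. 5.4 at `p = 2`, located by the LEAD cruxlead-28083 g0):
every Kolyvagin class `c_M(n)` on a square-free Kolyvagin conductor of level `≥ M ≥ 1` is an EXACT `τ`-eigenclass of sign `u = −w(E)·(−1)^{#n}`.
[cite: GrossLMS1991, §5 Prop. 5.3, Prop. 5.4] [cite: McCallumLMS1991, §5] -/
def KolyvaginClassSignAtTwo : Prop :=
  ∀ (W : WeierstrassCurve ℚ) [W.IsElliptic] [W.IsGloballyMinimal], ¬ W.HasCM → (Literature.NumberTheory.EllipticCurves.Rank1Residual.GoodOrd W 2 ∨ Literature.NumberTheory.EllipticCurves.Rank1Residual.Mult W 2) → (∀ m : ℕ, W.HasSurjectiveModNGaloisRep (2 ^ m : ℕ)) → ∀ (K : Type) [Field K] [NumberField K], Literature.NumberTheory.EllipticCurves.IsImaginaryQuadratic K → ∀ [NeZero (W.conductorNorm ℤ)], Literature.NumberTheory.EllipticCurves.SatisfiesHeegnerHypothesis (W.conductorNorm ℤ)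 K → Odd (NumberField.discr K) → NumberField.discr K ≠ -3 → AddSubgroup.torsionBy (W.baseChange K).toAffine.Point (2 : ℤ) = ⊥ → Literature.NumberTheory.EllipticCurves.SatisfiesHeegnerHypothesis 2 K → ∀ (Dt : Literature.NumberTheory.EllipticCurves.ModularForms.ModularParametrizationData W (W.conductorNorm ℤ)) (β : ℤ) (ι : K →+* ℂ) [∀ k : ℕ, NumberField (ringClassField K ι k)], (4 * (W.conductorNorm ℤ : ℤ)) ∣ β ^ 2 - NumberField.discr K →
    ∀ (τ : K ≃ₐ[ℚ] K), τ ≠ 1 →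
      ∀ (n M : ℕ) (d : Literature.NumberTheory.EllipticCurves.KolyvaginHeegnerData Dt β ι n),
        Literature.NumberTheory.EllipticCurves.KolyvaginDescent.KolSupp (Literature.NumberTheory.EllipticCurves.Zhang2014.IsKolyvaginPrime (W.conductorNorm ℤ) W K 2) (n) → 1 ≤ M → ((M : ℕ) : ℕ∞) ≤ Literature.NumberTheory.EllipticCurves.Zhang2014.levelIndex W 2 n →
        ∃ u : ℤ, (u = 1 ∨ u = -1) ∧ conjAct W τ ((2 ^ M : ℕ) : ℤ) (d.kolyvaginClass Nat.prime_two M) = u • d.kolyvaginClass Nat.prime_two M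

/-- KERNEL: the sign law at 2 holds (tree theorem `sign_conjAct_kolyvaginClass_two`; `d_K` odd ⟹ `d_K ≠ −4`; `ρ̄_{E,2}` onto from `∀ m`;
the index clause `M ≤ M(ℓ)` for `ℓ ∣ n` from `M ≤ M(n)` by `Zhang2014.natCast_le_levelIndex_iff`). -/
theorem kolyvaginClassSignAtTwo_holds : KolyvaginClassSignAtTwo := by
  intro W _ _ hCM hred hsurj K _ _ hK _ hH hodd hd3 htors hH2 Dt β ι _ hβ τ hτ1 n M d hKol hM hidx
  have hD4 : NumberField.discr K ≠ -4 := by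
    intro h4
    rw [h4] at hodd
    have := Int.odd_iff.mp hodd
    omega
  have h2 : W.HasSurjectiveModNGaloisRep ((2 : ℤ) ^ 1) := by simpa using hsurj 1
  have hnK : ∀ ℓ ∈ n.primeFactors, Literature.NumberTheory.EllipticCurves.Zhang2014.IsKolyvaginPrime (W.conductorNorm ℤ) W K 2 ℓ ∧
      M ≤ Literature.NumberTheory.EllipticCurves.Zhang2014.kolyvaginIndex W 2 ℓ :=
    fun ℓ hℓ ↦ ⟨hKol.2 ℓ hℓ, Zhang2014.natCast_le_levelIndex_iff.mp hidx ℓ hℓ⟩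
  obtain ⟨hu, hc⟩ :=
    Summit.BirchSwinnertonDyer.BirchSwinnertonDyer.Theorems.GenusExact.KolyvaginClassSign.sign_conjAct_kolyvaginClass_two
      hK hd3 hD4 hodd hH h2 τ hτ1 Dt β ι hKol.1 hM hnK d
  exact ⟨_, hu, hc⟩

/-- START⁗ · THE START SHAPE (support, S; v7.6 = part (ii) only — part (i), the sign law, is the kernel theorem above): at `e = 1` the shape
`Sh(t, a₀)` holds for BOTH signs with ONE error `a₀` uniform in `M` and some rank `t` — the tree's `RegularWalk.startFrameAtTwo_holds`
(eigen-frame of `Sel_{2^k}(E/K)`, span up to `2^J`, near-independence `2^{k−d}`) restricted to the `(−u)`-signed sub-frame (`(1−uτ)`-symmetrisation,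
`a₀ = max(J,d) + 1`).  Any `2^∞`-Selmer rank: U1 is rank-agnostic and so is this. [cite: Greenberg1999, §1–2] [cite: GrossLMS1991, §5] -/
def StartShapeAtTwo : Prop :=
  ∀ (W : WeierstrassCurve ℚ) [W.IsElliptic] [W.IsGloballyMinimal], ¬ W.HasCM → (Literature.NumberTheory.EllipticCurves.Rank1Residual.GoodOrd W 2 ∨ Literature.NumberTheory.EllipticCurves.Rank1Residual.Mult W 2) → (∀ m : ℕ, W.HasSurjectiveModNGaloisRep (2 ^ m : ℕ)) → ∀ (K : Type) [Field K] [NumberField K], Literature.NumberTheory.EllipticCurves.IsImaginaryQuadratic K → ∀ [NeZero (W.conductorNorm ℤ)], Literature.NumberTheory.EllipticCurves.SatisfiesHeegnerHypothesis (W.conductorNorm ℤ) K → Odd (NumberField.discr K) → NumberField.discr K ≠ -3 → AddSubgroup.torsionBy (W.baseChange K).toAffine.Point (2 : ℤ) = ⊥ → Literature.NumberTheory.EllipticCurves.SatisfiesHeegnerHypothesis 2 K → ∀ (Dt : Literature.NumberTheory.EllipticCurves.ModularForms.ModularParametrizationData W (W.conductorNorm ℤ)) (β : ℤ) (ι : K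 →+* ℂ) [∀ k : ℕ, NumberField (ringClassField K ι k)], (4 * (W.conductorNorm ℤ : ℤ)) ∣ β ^ 2 - NumberField.discr K →
    ∀ (τ : K ≃ₐ[ℚ] K), τ ≠ 1 →
      ∃ a₀ : ℕ, ∀ (M : ℕ) (u : ℤ), 1 ≤ M → (u = 1 ∨ u = -1) → ∃ t : ℕ, OppShape W K ι τ M 1 u a₀ t

/-- SW⁗ · THE SHAPED SEED-PRIME SWAP AT 2 (the theorem of the line, v7.4 form: visible conclusion).  On U1's habitat, for the complex conjugation
`τ` and a sign `u`, there are a LOSS FUNCTION `κ` and a SHAPE-ERROR FUNCTION `g` (both `ℕ → ℕ`, uniform in the level) such that: if `n = s·e` is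
a square-free Kolyvagin conductor with seed part `s ≠ 1`, engine part `e` of index `≥ I ≥ M+1` and REGULAR at level `2^M`, MARGIN ONE
(`M+1 ≤ M(n)`), the `(−u)`-part of `H_{𝓕(e)}` has shape `Sh(·, a)`, and `c_M(se)` is an exact `u`-eigenclass of visible order `> 2^{v + κ a}` —
then for some seed prime `q ∣ s` and a block `f` of new regular engine primes of index `≥ I` with `#(s'·e·f) = #(s·e)` (net one-for-one; `f` =
one prime, or DOWN-then-UP in the direct-shed corner) there is a datum at `s'·(e·f)` whose class is an exact `u`-eigenclass of visible order
`> 2^v`, with margin one and the shape `Sh(·, g a)` at `e·f`.  Derived from SWα⁗ + Q2 + EV by `seedPrimeSwapShapedAtTwo_of`. -/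
def SeedPrimeSwapShapedAtTwo : Prop :=
  ∀ (W : WeierstrassCurve ℚ) [W.IsElliptic] [W.IsGloballyMinimal], ¬ W.HasCM → (Literature.NumberTheory.EllipticCurves.Rank1Residual.GoodOrd W 2 ∨ Literature.NumberTheory.EllipticCurves.Rank1Residual.Mult W 2) → (∀ m : ℕ, W.HasSurjectiveModNGaloisRep (2 ^ m : ℕ)) → ∀ (K : Type) [Field K] [NumberField K], Literature.NumberTheory.EllipticCurves.IsImaginaryQuadratic K → ∀ [NeZero (W.conductorNorm ℤ)], Literature.NumberTheory.EllipticCurves.SatisfiesHeegnerHypothesis (W.conductorNorm ℤ) K → Odd (NumberField.discr K) → NumberField.discr K ≠ -3 → AddSubgroup.torsionBy (W.baseChange K).toAffine.Point (2 : ℤ) = ⊥ → Literature.NumberTheory.EllipticCurves.SatisfiesHeegnerHypothesis 2 K → ∀ (Dt : Literature.NumberTheory.EllipticCurves.ModularForms.ModularParametrizationData W (W.conductorNorm ℤ)) (β : ℤ) (ι : K →+* ℂ) [∀ k : ℕ, NumberField (ringClassField K ι k)], (4 * (W.conductorNorm ℤ : ℤ)) ∣ β ^ 2 - NumberField.discr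 K →
    ∀ (τ : K ≃ₐ[ℚ] K), τ ≠ 1 → ∀ (u : ℤ), (u = 1 ∨ u = -1) →
    ∃ κ g : ℕ → ℕ, ∀ (a t I M v s e : ℕ) (d : Literature.NumberTheory.EllipticCurves.KolyvaginHeegnerData Dt β ι (s * e)),
      Literature.NumberTheory.EllipticCurves.KolyvaginDescent.KolSupp (Literature.NumberTheory.EllipticCurves.Zhang2014.IsKolyvaginPrime (W.conductorNorm ℤ) W K 2) (s * e) →
      s ≠ 1 → 1 ≤ M → M + 1 ≤ I → (((M + 1 : ℕ) : ℕ) : ℕ∞) ≤ Literature.NumberTheory.EllipticCurves.Zhang2014.levelIndex W 2 (s * e) →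
      (∀ p ∈ (e).primeFactors, I ≤ Literature.NumberTheory.EllipticCurves.Zhang2014.kolyvaginIndex W 2 p ∧ (∃ (pl : HeightOneSpectrum (𝓞 ℚ)) (𝔓 : Ideal (absIntegers (𝓞 ℚ) ℚ)) (h : absoluteGaloisGroup ℚ), (p : 𝓞 ℚ) ∈ pl.asIdeal ∧ 𝔓 ∈ pl.primesAbove ∧ IsArithFrobAt (𝓞 ℚ) h 𝔓 ∧ (∀ X : geomTorsion W ((2 ^ M : ℕ) : ℤ), h • h • X = X) ∧ ∃ P : geomTorsion W ((2 ^ M : ℕ) : ℤ), (2 : ℤ) ^ (M - 1) • (P + h • P) ≠ 0)) →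
      OppShape W K ι τ M e u a t →
      conjAct W τ ((2 ^ M : ℕ) : ℤ) (d.kolyvaginClass Nat.prime_two M) = u • d.kolyvaginClass Nat.prime_two M →
      (∃ ρ ∈ torsionFixing (W.baseChange K) ((2 ^ M : ℕ) : ℤ),
          ((2 ^ (v + κ a) : ℕ) : ℤ) • h1Eval (W.baseChange K) ((2 ^ M : ℕ) : ℤ) (d.kolyvaginClass Nat.prime_two M) ρ ≠ 0) →
      ∃ (q s' f t' : ℕ) (d' : Literature.NumberTheory.EllipticCurves.KolyvaginHeegnerData Dt β ι (s' * (e * f))),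
        s = q * s' ∧ q.Prime ∧
        (∀ p ∈ (e * f).primeFactors, I ≤ Literature.NumberTheory.EllipticCurves.Zhang2014.kolyvaginIndex W 2 p ∧ (∃ (pl : HeightOneSpectrum (𝓞 ℚ)) (𝔓 : Ideal (absIntegers (𝓞 ℚ) ℚ)) (h : absoluteGaloisGroup ℚ), (p : 𝓞 ℚ) ∈ pl.asIdeal ∧ 𝔓 ∈ pl.primesAbove ∧ IsArithFrobAt (𝓞 ℚ) h 𝔓 ∧ (∀ X : geomTorsion W ((2 ^ M : ℕ) : ℤ), h • h • X = X) ∧ ∃ P : geomTorsion W ((2 ^ M : ℕ) : ℤ), (2 : ℤ) ^ (M - 1) • (P + h • P) ≠ 0)) ∧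
        s'.primeFactors.card + 1 = s.primeFactors.card ∧
        (s' * (e * f)).primeFactors.card = (s * e).primeFactors.card ∧
        Literature.NumberTheory.EllipticCurves.KolyvaginDescent.KolSupp (Literature.NumberTheory.EllipticCurves.Zhang2014.IsKolyvaginPrime (W.conductorNorm ℤ) W K 2) (s' * (e * f)) ∧
        (((M + 1 : ℕ) : ℕ) : ℕ∞) ≤ Literature.NumberTheory.EllipticCurves.Zhang2014.levelIndex W 2 (s' * (e * f)) ∧
        OppShape W K ι τ M (e * f) u (g a) t' ∧
        conjAct W τ ((2 ^ M : ℕ) : ℤ) (d'.kolyvaginClass Nat.prime_two M) = u • d'.kolyvaginClass Nat.prime_two M ∧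
        (∃ ρ ∈ torsionFixing (W.baseChange K) ((2 ^ M : ℕ) : ℤ),
          ((2 ^ (v) : ℕ) : ℤ) • h1Eval (W.baseChange K) ((2 ^ M : ℕ) : ℤ) (d'.kolyvaginClass Nat.prime_two M) ρ ≠ 0)

/-- SWα⁗ · SHED A SEED PRIME BY RECIPROCITY, SHAPED (THE hand of v7.4, size L if the signed refill law survives; replaces v7.3's SWα and
carries (a⁗) as a THREADED INVARIANT instead of an existence problem).  Hypotheses of SW⁗; conclusion: the conductor bookkeeping, the new
shape `Sh(·, g a)` at `e·f`, the exact sign of the new class, and a datum `dup` at `(s'·e·f)·q` compatible with `d'` in GK2's Q2 sense whose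
class `2^v · c_M((s'ef)q)` is NOT Selmer-local at the prime `w ∣ q` (singular order `> 2^v`).  BLUEPRINT (card §v7.4): PARTNER `z` of exact
sign `−u`, nearly full — rank `t ≥ 1`: `z := g₁`; `t = 0`: the signed refill law for `𝓕(e) → 𝓕(qe)` at any seed prime `q`
(`#A_q^{−u} ≤ 2^{a+1}` ⟹ `B_q^{−u}` nearly full) gives `z ∈ H_{𝓕(qe)}`; ENGINE `ℓ` by `WalkEngineAdapter.exists_regular_kolyvaginPrime_killing`
(`p := c`, `q := z`, kept `g₂…g_t`, index `≥ I`); `B := ⟨loc_ℓ z, φ_ℓ loc_ℓ c⟩` of exponent `≥ e(c) − 2a − O(1)` (same-sign lines pair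
perfectly: `RegularRefillSign`, `invWeilPairing_symm`, `localTatePairingZMod_conjActPlace`); RECIPROCITY for `(z, c_M(seℓ))` — engine places and
(`t = 0`) the place `q` vanish (`tr ⊥ tr`, exact transversality at margin one: `kolyvaginClass_mem_transverseKer_two`), `v ∣ 2N` killed by `2^b`,
so some seed prime `q*` carries singular order `> 2^v` once `κ a ≥ 2a + b + O(1)` (`t = 0` ⟹ `q* ≠ q`, available since then `#s ≥ 2`:
the corner `#s = 1 ∧ t = 0` is EXCLUDED by hypothesis here and VACUOUS by Zζ `LoneSeedPartnerAtTwo`, v7.5).  PERSISTENCE by the signed refill law at `ℓ`: `t ≥ 1` ⟹ tiny `(−u)`-refill, `Sh(t−1, 2a+O(1))`; `t = 0` ⟹ nearly-full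
`(−u)`-refill FORCED, `Sh(1, 2a+O(1))`.  Why it might fail: (α) the `O(1)` bits of the per-eigen-plane refill law must not grow with `M`
(split-type `E[2^M]^± ≅ ℤ/2^M ⊕ ℤ/2`); (β) (b″) uniform `2^b` at `v ∣ 2N`; (γ) (c″) exact signs at 2; (δ) Q2 needs P372.
[cite: Kolyvagin1991StructureSha, Prop. 8] [cite: MazurRubin2004, §4.1 Prop. 4.1.5, Lemma 4.1.7, Thm. 2.3.4] [cite: GrossLMS1991, §5, §9]
[cite: McCallumLMS1991, §5] -/
def ShedSeedPrimeShapedAtTwo : Prop :=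
  ∀ (W : WeierstrassCurve ℚ) [W.IsElliptic] [W.IsGloballyMinimal], ¬ W.HasCM → (Literature.NumberTheory.EllipticCurves.Rank1Residual.GoodOrd W 2 ∨ Literature.NumberTheory.EllipticCurves.Rank1Residual.Mult W 2) → (∀ m : ℕ, W.HasSurjectiveModNGaloisRep (2 ^ m : ℕ)) → ∀ (K : Type) [Field K] [NumberField K], Literature.NumberTheory.EllipticCurves.IsImaginaryQuadratic K → ∀ [NeZero (W.conductorNorm ℤ)], Literature.NumberTheory.EllipticCurves.SatisfiesHeegnerHypothesis (W.conductorNorm ℤ) K → Odd (NumberField.discr K) → NumberField.discr K ≠ -3 → AddSubgroup.torsionBy (W.baseChange K).toAffine.Point (2 : ℤ) = ⊥ → Literature.NumberTheory.EllipticCurves.SatisfiesHeegnerHypothesis 2 K → ∀ (Dt : Literature.NumberTheory.EllipticCurves.ModularForms.ModularParametrizationData W (W.conductorNorm ℤ)) (β : ℤ) (ι : K →+* ℂ) [∀ k : ℕ, NumberField (ringClassField K ι k)], (4 * (W.conductorNorm ℤ : ℤ)) ∣ β ^ 2 - NumberField.discr K →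
    ∀ (τ : K ≃ₐ[ℚ] K), τ ≠ 1 → ∀ (u : ℤ), (u = 1 ∨ u = -1) →
    ∃ κ g : ℕ → ℕ, ∀ (a t I M v s e : ℕ) (d : Literature.NumberTheory.EllipticCurves.KolyvaginHeegnerData Dt β ι (s * e)),
      Literature.NumberTheory.EllipticCurves.KolyvaginDescent.KolSupp (Literature.NumberTheory.EllipticCurves.Zhang2014.IsKolyvaginPrime (W.conductorNorm ℤ) W K 2) (s * e) →
      s ≠ 1 → 1 ≤ M → M + 1 ≤ I → (((M + 1 : ℕ) : ℕ) : ℕ∞) ≤ Literature.NumberTheory.EllipticCurves.Zhang2014.levelIndex W 2 (s * e) →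
      (∀ p ∈ (e).primeFactors, I ≤ Literature.NumberTheory.EllipticCurves.Zhang2014.kolyvaginIndex W 2 p ∧ (∃ (pl : HeightOneSpectrum (𝓞 ℚ)) (𝔓 : Ideal (absIntegers (𝓞 ℚ) ℚ)) (h : absoluteGaloisGroup ℚ), (p : 𝓞 ℚ) ∈ pl.asIdeal ∧ 𝔓 ∈ pl.primesAbove ∧ IsArithFrobAt (𝓞 ℚ) h 𝔓 ∧ (∀ X : geomTorsion W ((2 ^ M : ℕ) : ℤ), h • h • X = X) ∧ ∃ P : geomTorsion W ((2 ^ M : ℕ) : ℤ), (2 : ℤ) ^ (M - 1) • (P + h • P) ≠ 0)) →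
      OppShape W K ι τ M e u a t →
      (1 ≤ t ∨ 2 ≤ s.primeFactors.card) →
      conjAct W τ ((2 ^ M : ℕ) : ℤ) (d.kolyvaginClass Nat.prime_two M) = u • d.kolyvaginClass Nat.prime_two M →
      (∃ ρ ∈ torsionFixing (W.baseChange K) ((2 ^ M : ℕ) : ℤ),
          ((2 ^ (v + κ a) : ℕ) : ℤ) • h1Eval (W.baseChange K) ((2 ^ M : ℕ) : ℤ) (d.kolyvaginClass Nat.prime_two M) ρ ≠ 0) →
      ∃ (q s' f t' : ℕ) (d' : Literature.NumberTheory.EllipticCurves.KolyvaginHeegnerData Dt β ι (s' * (e * f))),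
        s = q * s' ∧ q.Prime ∧
        (∀ p ∈ (e * f).primeFactors, I ≤ Literature.NumberTheory.EllipticCurves.Zhang2014.kolyvaginIndex W 2 p ∧ (∃ (pl : HeightOneSpectrum (𝓞 ℚ)) (𝔓 : Ideal (absIntegers (𝓞 ℚ) ℚ)) (h : absoluteGaloisGroup ℚ), (p : 𝓞 ℚ) ∈ pl.asIdeal ∧ 𝔓 ∈ pl.primesAbove ∧ IsArithFrobAt (𝓞 ℚ) h 𝔓 ∧ (∀ X : geomTorsion W ((2 ^ M : ℕ) : ℤ), h • h • X = X) ∧ ∃ P : geomTorsion W ((2 ^ M : ℕ) : ℤ), (2 : ℤ) ^ (M - 1) • (P + h • P) ≠ 0)) ∧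
        s'.primeFactors.card + 1 = s.primeFactors.card ∧
        (s' * (e * f)).primeFactors.card = (s * e).primeFactors.card ∧
        Literature.NumberTheory.EllipticCurves.KolyvaginDescent.KolSupp (Literature.NumberTheory.EllipticCurves.Zhang2014.IsKolyvaginPrime (W.conductorNorm ℤ) W K 2) (s' * (e * f)) ∧
        (((M + 1 : ℕ) : ℕ) : ℕ∞) ≤ Literature.NumberTheory.EllipticCurves.Zhang2014.levelIndex W 2 (s' * (e * f)) ∧
        OppShape W K ι τ M (e * f) u (g a) t' ∧
        conjAct W τ ((2 ^ M : ℕ) : ℤ) (d'.kolyvaginClass Nat.prime_two M) = u • d'.kolyvaginClass Nat.prime_two M ∧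
        ∃ dup : Literature.NumberTheory.EllipticCurves.KolyvaginHeegnerData Dt β ι (s' * (e * f) * q),
        Squarefree (s' * (e * f) * q) ∧ ¬ q ∣ s' * (e * f) ∧
        (∀ l' ∈ (s' * (e * f) * q).primeFactors, Literature.NumberTheory.EllipticCurves.Zhang2014.IsKolyvaginPrime (W.conductorNorm ℤ) W K 2 l' ∧ M ≤ Literature.NumberTheory.EllipticCurves.Zhang2014.kolyvaginIndex W 2 l') ∧
        (∀ l' ∈ (s' * (e * f)).primeFactors, ∀ (x : Literature.NumberTheory.EllipticCurves.ringClassField K ι (s' * (e * f))) (x' : Literature.NumberTheory.EllipticCurves.ringClassField K ι (s' * (e * f) * q)), (x : ℂ) = x' → ((dup.σ l' x' : Literature.NumberTheory.EllipticCurves.ringClassField K ι (s' * (e * f) * q)) : ℂ) = (d'.σ l' x : ℂ)) ∧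
        (∀ t ∈ d'.S, ∃ t' ∈ dup.S, ∀ (x : Literature.NumberTheory.EllipticCurves.ringClassField K ι (s' * (e * f))) (x' : Literature.NumberTheory.EllipticCurves.ringClassField K ι (s' * (e * f) * q)), (x : ℂ) = x' → ((t' x' : Literature.NumberTheory.EllipticCurves.ringClassField K ι (s' * (e * f) * q)) : ℂ) = (t x : ℂ)) ∧
        (∀ t' ∈ dup.S, ∃ t ∈ d'.S, ∀ (x : Literature.NumberTheory.EllipticCurves.ringClassField K ι (s' * (e * f))) (x' : Literature.NumberTheory.EllipticCurves.ringClassField K ι (s' * (e * f) * q)), (x : ℂ) = x' → ((t' x' : Literature.NumberTheory.EllipticCurves.ringClassField K ι (s' * (e * f) * q)) : ℂ) = (t x : ℂ)) ∧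
        (∀ (x : Literature.NumberTheory.EllipticCurves.ringClassField K ι (s' * (e * f))) (x' : Literature.NumberTheory.EllipticCurves.ringClassField K ι (s' * (e * f) * q)), (x : ℂ) = x' → dup.emb x' = d'.emb x) ∧
        ∃ w : IsDedekindDomain.HeightOneSpectrum (NumberField.RingOfIntegers K), (q : NumberField.RingOfIntegers K) ∈ w.asIdeal ∧
          ((2 ^ v : ℕ) : ℤ) • dup.kolyvaginClass Nat.prime_two M ∉ WeierstrassCurve.selmerLocalKer (W.baseChange K) (w.adicCompletion K) ((2 ^ M : ℕ) : ℤ)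

/-- Zζ · THE LONE SEED PRIME HAS A PARTNER (v7.7: NO LONGER A STUB — derived below, `loneSeedPartnerAtTwo_of`, from OSR + SRS + the tree's pair
Čebotarev; v7.5; answers critic #298 (ζ); size S–M GIVEN the signed refill law, the engine adapter and reciprocity —
no new input).  The corner `t = 0 ∧ #s = 1` of the shaped shed is VACUOUS once the walking class is visible beyond `2^{κ₀ a}`: if the `(−u)`-part
of `H_{𝓕(e)}` has shape `Sh(0, a)` (every exact `(−u)`-class `y` has `2^a y ≡ 0`), the seed part is a single prime `q` (`#s ≤ 1`, `s ≠ 1`), and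
`c = c_M(qe)` is an exact `u`-class, then `c` has visible order `≤ 2^{κ₀ a}`, `κ₀ a = a + b + O(1)`.  PROOF ROUTE (LEAD): the signed refill law at
`q` for `𝓕(e) → 𝓕(qe)` in sign `−u` (`α ≤ a + d + 1` ⟹ `β ≥ M − a − C`) gives `z ∈ H_{𝓕(qe)}` exact of sign `−u`, visible order `≥ 2^{M−a−C′}`;
the adapter `WalkEngineAdapter.exists_regular_kolyvaginPrime_killing` (`p := c`, `q := z`, no kept classes) gives a deep Kolyvagin `ℓ` with
`n_c(ℓ)` = visible order of `c` and `n_z(ℓ) ≥ M − a − C′`; `B := ⟨loc_ℓ z, loc_{ℓ,tr} c_M(qeℓ)⟩ = ⟨loc_ℓ z, φ_ℓ loc_ℓ c⟩` (Q2) has exponent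
`≥ n_z + n_c − M − O(1)` (same-sign `f × tr` lines pair perfectly: `RegularRefillSign`); RECIPROCITY for `(z, c_M(qeℓ))`: `z ∈ H_{𝓕(qe)}` and
`c_M(qeℓ) ∈ H_{𝓕(qeℓ)}` (margin one, `kolyvaginClass_mem_transverseKer_two`) are BOTH transverse at `q` and at `e`, both finite off `2Nqeℓ`, so the
law reads `B + (v ∣ 2N terms, ≤ 2^{b′}) = 0` — hence `n_c(ℓ) ≤ a + b′ + C″`, i.e. the visible order of `c` is `≤ 2^{κ₀ a}`.  (This is the critic's
own computation in #298 (ζ), read as a LEMMA: «ρ = 0 at the last seed prime» contradicts visibility; so (ζ1) «t ≥ 1 whenever #s = 1» is FORCED,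
non-circularly, by the walk's visibility hypothesis.  Consistency: at `e = 1`, `t(−u) = r_{u₁}` is odd by 2-parity, Gross 5.4.)  Why it might fail:
only with the signed refill law's `O(1)` (α) or (b″); the reciprocity and adapter inputs are tree theorems / the line's own (d″).
[cite: Kolyvagin1991StructureSha, Prop. 8] [cite: MazurRubin2004, §4.1] [cite: GrossLMS1991, §9] -/
def LoneSeedPartnerAtTwo : Prop :=
  ∀ (W : WeierstrassCurve ℚ) [W.IsElliptic] [W.IsGloballyMinimal], ¬ W.HasCM → (Literature.NumberTheory.EllipticCurves.Rank1Residual.GoodOrd W 2 ∨ Literature.NumberTheory.EllipticCurves.Rank1Residual.Mult W 2) → (∀ m : ℕ, W.HasSurjectiveModNGaloisRep (2 ^ m : ℕ)) → ∀ (K : Type) [Field K] [NumberField K], Literature.NumberTheory.EllipticCurves.IsImaginaryQuadratic K → ∀ [NeZero (W.conductorNorm ℤ)], Literature.NumberTheory.EllipticCurves.SatisfiesHeegnerHypothesis (W.conductorNorm ℤ) K → Odd (NumberField.discr K) → NumberField.discr K ≠ -3 → AddSubgroup.torsionBy (W.baseChange K).toAffine.Point (2 : ℤ) = ⊥ → Literature.NumberTheory.EllipticCurves.SatisfiesHeegnerHypothesis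 2 K → ∀ (Dt : Literature.NumberTheory.EllipticCurves.ModularForms.ModularParametrizationData W (W.conductorNorm ℤ)) (β : ℤ) (ι : K →+* ℂ) [∀ k : ℕ, NumberField (ringClassField K ι k)], (4 * (W.conductorNorm ℤ : ℤ)) ∣ β ^ 2 - NumberField.discr K →
    ∀ (τ : K ≃ₐ[ℚ] K), τ ≠ 1 → ∀ (u : ℤ), (u = 1 ∨ u = -1) →
    ∃ κ₀ : ℕ → ℕ, ∀ (a I M s e : ℕ) (d : Literature.NumberTheory.EllipticCurves.KolyvaginHeegnerData Dt β ι (s * e)),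
      Literature.NumberTheory.EllipticCurves.KolyvaginDescent.KolSupp (Literature.NumberTheory.EllipticCurves.Zhang2014.IsKolyvaginPrime (W.conductorNorm ℤ) W K 2) (s * e) →
      s ≠ 1 → s.primeFactors.card ≤ 1 → 1 ≤ M → M + 1 ≤ I → (((M + 1 : ℕ) : ℕ) : ℕ∞) ≤ Literature.NumberTheory.EllipticCurves.Zhang2014.levelIndex W 2 (s * e) →
      (∀ p ∈ (e).primeFactors, I ≤ Literature.NumberTheory.EllipticCurves.Zhang2014.kolyvaginIndex W 2 p ∧ (∃ (pl : HeightOneSpectrum (𝓞 ℚ)) (𝔓 : Ideal (absIntegers (𝓞 ℚ) ℚ)) (h : absoluteGaloisGroup ℚ), (p : 𝓞 ℚ) ∈ pl.asIdeal ∧ 𝔓 ∈ pl.primesAbove ∧ IsArithFrobAt (𝓞 ℚ) h 𝔓 ∧ (∀ X : geomTorsion W ((2 ^ M : ℕ) : ℤ), h • h • X = X) ∧ ∃ P : geomTorsion W ((2 ^ M : ℕ) : ℤ), (2 : ℤ) ^ (M - 1) • (P + h • P) ≠ 0)) →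
      OppShape W K ι τ M e u a 0 →
      conjAct W τ ((2 ^ M : ℕ) : ℤ) (d.kolyvaginClass Nat.prime_two M) = u • d.kolyvaginClass Nat.prime_two M →
      (∃ ρ ∈ torsionFixing (W.baseChange K) ((2 ^ M : ℕ) : ℤ),
          ((2 ^ (κ₀ a) : ℕ) : ℤ) • h1Eval (W.baseChange K) ((2 ^ M : ℕ) : ℤ) (d.kolyvaginClass Nat.prime_two M) ρ ≠ 0) →
      False

/-- OSR · OPPOSITE-SIGN RECIPROCITY AT 2 WITH A KUMMER PARTNER — risk (d″) of the card TYPED (v7.7; the multi-term generalisation of S1's LANDED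
two-term swap `KolyvaginLowerBoundAtTwo.primeSwapAtTwoLossy_core` / `localTatePairing_add_eq_zero_of_swap` / `swapPairing_pow_smul_ne_zero_at_two`).
On U1's habitat, for the complex conjugation `τ` and a sign `u`, there is a LOSS `C` (uniform in the level) such that: if `n` is a square-free
Kolyvagin conductor with MARGIN ONE at level `M ≥ 1`, `m ∣ n`, `z ∈ H_{𝓕(m)}(K,E[2^M])` (`Jetchev2008.modifiedSelmerGroup … m`: transverse at `m`,
Kummer elsewhere — in particular at the primes of `n/m`) is an EXACT `(−u)`-eigenclass, `c_M(n)` (datum `d`) an exact `u`-eigenclass, `ℓ ∤ n` a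
Kolyvagin prime of index `≥ M+1` with a place `v ∣ ℓ` at which `2^a·z` and `2^b·c_M(n)` are NOT locally trivial, and `j + M + C ≤ a + b`, then for
EVERY datum `dup` at `n·ℓ` compatible with `d` (GK2's four clauses) SOME prime `q' ∣ n/m` has a place `w ∣ q'` with `2^j·c_M(nℓ) ∉ H¹_𝓕(K_w)`
(singular order `> 2^j`).  PROOF MAP (all tree theorems but the k-term sum): `C⁺ := 2^t·c_M(nℓ) ∈ H_{𝓕(nℓ)}` (T2, `t = |Δ_min|+4`,
`KolyvaginLowerBoundAtTwo` frame); Poitou–Tate for `(z, C⁺)` with the hybrid self-dual transverse structure (`sum_localTatePairingZMod_selmer_eq_zero`,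
`dualTransported_selmerF_eq_of_isImaginaryQuadratic`, exact Kummer self-duality `dualTransported_kummerSelmerStructure_inr`): the places of `m`
(both transverse), the places off `nℓ` (both Kummer) and `∞` vanish EXACTLY, leaving `B_ℓ + Σ_{q' ∣ n/m} ⟨z, C⁺⟩_{q'} = 0`; at `ℓ` the classes
`z` (Kummer, `2^a loc z ≠ 0`) and `C⁺` (transverse, `2^{b−t} loc C⁺ ∉ Kummer` by Q2-UP `KolyvaginRelationAtTwo` (mod P372) from `2^b c_M(n) ∉ ker loc`)
have the SAME sign `−u = ε(nℓ)` (sign law + `u = ε(n)` by the visible-order squeeze `2c ≠ 0`), so P7a `swapPairing_pow_smul_ne_zero_at_two` gives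
`2^{a+b−t+1−M−c₇} B_ℓ ≠ 0`; hence some seed term is non-zero at that exponent, so `2^{…} loc_{q'} C⁺ ≠ 0`, and exact transversality at `q'`
(margin one, `kolyvaginClass_mem_transverseKer_two` + Selmer complement) turns «`∈ 𝒯` and `≠ 0`» into «`∉ H¹_𝓕`».  `C = t + c₇ + O(1)`.
Why it might fail: only in the bookkeeping — the k-term reciprocity with the hybrid structure at ALL places of `nℓ` (S1 did two terms), and the
one-bit sign glitches at 2 (absorbed in `C`).  Cheapest falsifier: the S1 core's own hypotheses list (hP4 hP5 hP7a hP7b hQ2 hT2 hS2) instantiated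
with a Kummer partner instead of a relaxed one — if one of them has no Kummer analogue the map breaks there.
CORNER `m = n` (critic T-OSR-1, #317): there the conclusion quantifies over the primes of `n/n = 1` and reads `False`, i.e. OSR asserts that its
hypotheses — an exact `(−u)`-partner `z ∈ H_{𝓕(n)}` and `c_M(n)` exact of sign `u`, both locally non-trivial over a deep `ℓ ∤ n`, with room
`j + M + C ≤ a + b` — are jointly unsatisfiable.  This corner is CONTAINED AND USED: the kernel proof (section `OSRProof`; by contradiction from
«`2^j c_M(nℓ)` is Kummer at every seed place», vacuous at `m = n`, to `C″ ∈ H¹_{𝓕(mℓ)}`, reciprocity, `B_ℓ = 0` against P7a) is uniform in `m ∣ n`,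
and `loneSeedPartnerAtTwo_of` (Zζ) calls OSR precisely with `m := n` (STATUS since v7.8: PROVED modulo P372, `oppositeSignReciprocityAtTwo_holds`).
[cite: Kolyvagin1991StructureSha, Prop. 8] [cite: GrossLMS1991, §9 Prop. 9.1, §6 Prop. 6.2] [cite: McCallumLMS1991, §5] [cite: MazurRubin2004, Thm. 2.3.4] -/
def OppositeSignReciprocityAtTwo : Prop :=
  ∀ (W : WeierstrassCurve ℚ) [W.IsElliptic] [W.IsGloballyMinimal], ¬ W.HasCM → (Literature.NumberTheory.EllipticCurves.Rank1Residual.GoodOrd W 2 ∨ Literature.NumberTheory.EllipticCurves.Rank1Residual.Mult W 2) → (∀ m : ℕ, W.HasSurjectiveModNGaloisRep (2 ^ m : ℕ)) → ∀ (K : Type) [Field K] [NumberField K], Literature.NumberTheory.EllipticCurves.IsImaginaryQuadratic K → ∀ [NeZero (W.conductorNorm ℤ)], Literature.NumberTheory.EllipticCurves.SatisfiesHeegnerHypothesis (W.conductorNorm ℤ) K → Odd (NumberField.discr K) → NumberField.discr K ≠ -3 → AddSubgroup.torsionBy (W.baseChange K).toAffine.Point (2 : ℤ) = ⊥ → Literature.NumberTheory.EllipticCurves.SatisfiesHeegnerHypothesis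 2 K → ∀ (Dt : Literature.NumberTheory.EllipticCurves.ModularForms.ModularParametrizationData W (W.conductorNorm ℤ)) (β : ℤ) (ι : K →+* ℂ) [∀ k : ℕ, NumberField (ringClassField K ι k)], (4 * (W.conductorNorm ℤ : ℤ)) ∣ β ^ 2 - NumberField.discr K →
    ∀ (τ : K ≃ₐ[ℚ] K), τ ≠ 1 → ∀ (u : ℤ), (u = 1 ∨ u = -1) →
    ∃ C : ℕ, ∀ (M m n ℓ a b j : ℕ) (d : Literature.NumberTheory.EllipticCurves.KolyvaginHeegnerData Dt β ι n)
      (z : galH1Torsion (W.baseChange K) ((2 ^ M : ℕ) : ℤ)),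
      Literature.NumberTheory.EllipticCurves.KolyvaginDescent.KolSupp (Literature.NumberTheory.EllipticCurves.Zhang2014.IsKolyvaginPrime (W.conductorNorm ℤ) W K 2) n →
      1 ≤ M → (((M + 1 : ℕ) : ℕ) : ℕ∞) ≤ Literature.NumberTheory.EllipticCurves.Zhang2014.levelIndex W 2 n → m ∣ n →
      z ∈ Jetchev2008.modifiedSelmerGroup W K ι ((2 ^ M : ℕ) : ℤ) m →
      conjAct W τ ((2 ^ M : ℕ) : ℤ) z = (-u) • z →
      conjAct W τ ((2 ^ M : ℕ) : ℤ) (d.kolyvaginClass Nat.prime_two M) = u • d.kolyvaginClass Nat.prime_two M →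
      Literature.NumberTheory.EllipticCurves.Zhang2014.IsKolyvaginPrime (W.conductorNorm ℤ) W K 2 ℓ → ¬ ℓ ∣ n →
      M + 1 ≤ Literature.NumberTheory.EllipticCurves.Zhang2014.kolyvaginIndex W 2 ℓ →
      ∀ (v : IsDedekindDomain.HeightOneSpectrum (NumberField.RingOfIntegers K)), (ℓ : NumberField.RingOfIntegers K) ∈ v.asIdeal →
      ((2 ^ a : ℕ) : ℤ) • z ∉ (W.baseChange K).torsionLocalKer (v.adicCompletion K) ((2 ^ M : ℕ) : ℤ) →
      ((2 ^ b : ℕ) : ℤ) • d.kolyvaginClass Nat.prime_two M ∉ (W.baseChange K).torsionLocalKer (v.adicCompletion K) ((2 ^ M : ℕ) : ℤ) →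
      j + M + C ≤ a + b →
      ∀ (dup : Literature.NumberTheory.EllipticCurves.KolyvaginHeegnerData Dt β ι (n * ℓ)),
        (∀ l' ∈ n.primeFactors, ∀ (x : ringClassField K ι n) (x' : ringClassField K ι (n * ℓ)), (x : ℂ) = x' → ((dup.σ l' x' : ringClassField K ι (n * ℓ)) : ℂ) = (d.σ l' x : ℂ)) →
        (∀ t ∈ d.S, ∃ t' ∈ dup.S, ∀ (x : ringClassField K ι n) (x' : ringClassField K ι (n * ℓ)), (x : ℂ) = x' → ((t' x' : ringClassField K ι (n * ℓ)) : ℂ) = (t x : ℂ)) →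
        (∀ t' ∈ dup.S, ∃ t ∈ d.S, ∀ (x : ringClassField K ι n) (x' : ringClassField K ι (n * ℓ)), (x : ℂ) = x' → ((t' x' : ringClassField K ι (n * ℓ)) : ℂ) = (t x : ℂ)) →
        (∀ (x : ringClassField K ι n) (x' : ringClassField K ι (n * ℓ)), (x : ℂ) = x' → dup.emb x' = d.emb x) →
        ∃ q' ∈ (n / m).primeFactors, ∃ w : IsDedekindDomain.HeightOneSpectrum (NumberField.RingOfIntegers K),
          (q' : NumberField.RingOfIntegers K) ∈ w.asIdeal ∧
          ((2 ^ j : ℕ) : ℤ) • dup.kolyvaginClass Nat.prime_two M ∉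
            WeierstrassCurve.selmerLocalKer (W.baseChange K) (w.adicCompletion K) ((2 ^ M : ℕ) : ℤ)

/-- SRS · SIGNED REFILL SUPPLY AT 2 (v7.7: the supply half of the signed refill law of card §v7.4, TYPED; price M; the refill law's risk (α)).
If the `(−u)`-part of the engine Selmer group `H_{𝓕(e)}(K,E[2^M])` has shape `Sh(0, a)` (no exact `(−u)`-class beyond `2^a` modulo phantoms) and
`q ∤ e` is a seed prime (`qe` square-free Kolyvagin, margin one), then `H_{𝓕(qe)}` contains an EXACT `(−u)`-eigenclass `z` of order `≥ 2^{M−a−C}`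
(`C` uniform in the level).  PROOF MAP: at the inert place `λ ∣ q`, `H¹(K_λ,E[2^M]) = H¹_f ⊕ H¹_tr`, and per sign `ε` the parts `H¹_f^ε`, `H¹_tr^ε`
are CYCLIC of order `2^M` (`E[2^M]` is free of rank one over `ℤ/2^M[τ]`: `τ` mod 2 is a transvection, Q1; `H¹_tr ≅ E[2^M](−1)` and `τ` inverts
`μ_{2^M}`); the local Tate pairing is SYMMETRIC, `τ`-invariant (`localTatePairingZMod_conjActPlace`) so opposite signs pair into the 2-torsion and
same signs perfectly up to one bit (`RegularRefillSign`, `invWeilPairing_symm`); the image `L` of the `q`-relaxed Selmer group is LAGRANGIAN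
(`#L = 2^{2M}` by the Poitou–Tate Euler characteristic, isotropic by reciprocity — the tree's `TransverseLagrangianAtTwo` mechanism) and `τ`-stable,
so up to two bits `L = L⁺ ⊕ L⁻` with `L^ε` Lagrangian in the plane `H¹_f^ε ⊕ H¹_tr^ε`; there `L^ε/(A^ε ⊕ B^ε)` (`A = L ∩ H¹_f`, `B = L ∩ H¹_tr`) is
the graph of an isomorphism of cyclic groups of order `2^γ`, and isotropy of its generator, `⟨x,x⟩ = 2^{α+β+1}·unit = 0`, forces `γ ≤ 1`:
`#A^ε · #B^ε ≥ 2^{M−1}` (the co-cyclic refill law `RegularRefill.natCard_le_two_mul_of_lagrangian_of_cyclic` is the model).  With `ε = −u`: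
`A^{−u} = loc_λ` of `H_{𝓕(e)}^{(−u)}` has exponent `≤ 2^{a+2}` (shape `Sh(0,a)` + Φ-KILL `RegularRefill.localization_eq_zero_of_forall_h1Eval_eq_zero`:
`D_λ ≤ Γ_{K(E[2^{M+1}])}` at index `≥ M+1`) and is nearly cyclic, so `B^{−u}` has an element of order `≥ 2^{M−a−C}`, the localisation of some
`x ∈ H_{𝓕(qe)}`; `z := (1 − uτ)x`.  Why it might fail: (α) the O(1) bits (τ-splitting of `L` at 2, the `ℤ/2^M ⊕ ℤ/2`-type glitches of `H¹_f^ε` when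
`a_q ≢ 0 mod 2^{M+1}`) must stay uniform in `M` — they are bounded by the number of places where 2-divisions occur (≤ 6), not by `M`.
Cheapest falsifier: `M = 3`, `a = 0`, `e = 1`, a curve with `Sel_8(E/K)^{(−u)} = 0`: SRS predicts a class of order `≥ 2^{3−C}` in `H_{𝓕(q)}` — vacuous
unless `C ≤ 2`, so test the sharp form `#A·#B ≥ 2^{M−1}` numerically on `H¹(K_λ, E[8])` for one Kolyvagin `q` (pure finite-group computation).
[cite: MazurRubin2004, §4.1 Prop. 4.1.5, Lemma 4.1.7] [cite: Howard2004Heegner, §1.5–1.6] [cite: GrossLMS1991, §9] [cite: PoonenRains2012, §2, §4] -/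
def SignedRefillSupplyAtTwo : Prop :=
  ∀ (W : WeierstrassCurve ℚ) [W.IsElliptic] [W.IsGloballyMinimal], ¬ W.HasCM → (Literature.NumberTheory.EllipticCurves.Rank1Residual.GoodOrd W 2 ∨ Literature.NumberTheory.EllipticCurves.Rank1Residual.Mult W 2) → (∀ m : ℕ, W.HasSurjectiveModNGaloisRep (2 ^ m : ℕ)) → ∀ (K : Type) [Field K] [NumberField K], Literature.NumberTheory.EllipticCurves.IsImaginaryQuadratic K → ∀ [NeZero (W.conductorNorm ℤ)], Literature.NumberTheory.EllipticCurves.SatisfiesHeegnerHypothesis (W.conductorNorm ℤ) K → Odd (NumberField.discr K) → NumberField.discr K ≠ -3 → AddSubgroup.torsionBy (W.baseChange K).toAffine.Point (2 : ℤ) = ⊥ → Literature.NumberTheory.EllipticCurves.SatisfiesHeegnerHypothesis 2 K → ∀ (Dt : Literature.NumberTheory.EllipticCurves.ModularForms.ModularParametrizationData W (W.conductorNorm ℤ)) (β : ℤ) (ι : K →+* ℂ) [∀ k : ℕ, NumberField (ringClassField K ι k)], (4 * (W.conductorNorm ℤ : ℤ)) ∣ β ^ 2 - NumberField.discr K →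
    ∀ (τ : K ≃ₐ[ℚ] K), τ ≠ 1 → ∀ (u : ℤ), (u = 1 ∨ u = -1) →
    ∃ C : ℕ, ∀ (a M q e : ℕ),
      Literature.NumberTheory.EllipticCurves.KolyvaginDescent.KolSupp (Literature.NumberTheory.EllipticCurves.Zhang2014.IsKolyvaginPrime (W.conductorNorm ℤ) W K 2) (q * e) →
      q.Prime → ¬ q ∣ e → 1 ≤ M → (((M + 1 : ℕ) : ℕ) : ℕ∞) ≤ Literature.NumberTheory.EllipticCurves.Zhang2014.levelIndex W 2 (q * e) →
      OppShape W K ι τ M e u a 0 → a + C < M →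
      ∃ z : galH1Torsion (W.baseChange K) ((2 ^ M : ℕ) : ℤ),
        z ∈ Jetchev2008.modifiedSelmerGroup W K ι ((2 ^ M : ℕ) : ℤ) (q * e) ∧
        conjAct W τ ((2 ^ M : ℕ) : ℤ) z = (-u) • z ∧
        ((2 ^ (M - (a + C) - 1) : ℕ) : ℤ) • z ≠ 0

/-- VISIBILITY IS MONOTONE IN THE EXPONENT (kernel algebra): `2^{x'}·y ≠ 0 ⟹ 2^x·y ≠ 0` for `x ≤ x'`. -/
theorem vis_mono {A : Type*} [AddCommGroup A] {y : A} {x x' : ℕ} (hx : x ≤ x')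
    (h : ((2 ^ x' : ℕ) : ℤ) • y ≠ 0) : ((2 ^ x : ℕ) : ℤ) • y ≠ 0 := by
  intro h0
  apply h
  obtain ⟨c, rfl⟩ := Nat.exists_eq_add_of_le hx
  rw [pow_add, Nat.cast_mul, mul_comm, mul_smul, h0, smul_zero]


/-! ## §5b (v8.1) THE SWα⁗ SPLIT: ENGINE SUPPLY (ES), SHAPE CUT (SC), SHAPE REFILL (SRF) — and SWα⁗ DERIVED in the kernel -/

/-- ES · DEEP REGULAR ENGINE SUPPLY AT 2 (v8.1 stub, size M; the Čebotarev half of SWα⁗).  On U1's habitat, for every sign `u`: there is a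
constant `C` (uniform in the level) such that for all levels `M ≥ 1`, target indices `I ≥ M+1`, bounds `bnd`, KEPT exact `(−u)`-eigenclasses
`y₁ … y_k`, a CUT class `z` (exact, sign `−u`) with `2^{a+C} z ∉ ℤ·y + {classes vanishing on Γ_{K(E[2^{M+1}])}}` and a walking class `c` (exact,
sign `u`) VISIBLE beyond `2^{b+C}` on `Γ_{K(E[2^M])}`, there is a Kolyvagin prime `ℓ > bnd` of index `≥ I`, REGULAR at level `M` (the walk's
engine clause: a Frobenius `h` at `ℓ` with `h² = 1` on `E[2^M]` and `2^{M−1}(P + hP) ≠ 0` for some `P`), with a place `v ∣ ℓ` of `K` at which every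
kept class is locally trivial, `2^a · loc_v z ≠ 0` and `2^b · loc_v c ≠ 0`.  = the tree's engine adapter
`WalkEngineAdapter.exists_regular_kolyvaginPrime_killing` (kept-killing, quotient-order cut, regularity; index `k+1` only) ⊗ the tree's deep window
Čebotarev `ChebotarevWindowPrimeAtTwo.exists_kolyvaginPrime_notMem_pair_of_heegner` (index `≥ M'` arbitrary, two eigenclasses keep their orders up to
two bits; U1's habitat: tower onto, `d_K` odd, Heegner).  Why it might fail: reading the classes on `Γ_{K(E[2^{M+1}])}` while prescribing Frobenius on
`K(E[2^I])`, `I ≫ M`, costs the exponent of `H¹(K(E[2^I])/K, E[2^M])` — bounded uniformly (`≤ 3` bits: full image over `K`, the centre `−1`, the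
phantom line K1⁺), which is what `C` absorbs; a regular deep Frobenius exists (`h ↦ (0 1; 1 0) mod 2^I`: `det = −1`, `tr = 0`, `h² = 1`,
`(1+h)E ∋` a point of order `2^M`).  Cheapest falsifier: `k = 0`, `I = M+1`: must reduce to the window theorem with `C = 2`.
[cite: MazurRubin2004, §4.1 Prop. 4.1.5] [cite: McCallumLMS1991, §3 Prop. 3.1, §5 (S₁(M))] [cite: GrossLMS1991, §9] [cite: LawsonWuthrich2016, Thm. 1] -/
def EngineSupplyAtTwo : Prop :=
  ∀ (W : WeierstrassCurve ℚ) [W.IsElliptic] [W.IsGloballyMinimal], ¬ W.HasCM → (Literature.NumberTheory.EllipticCurves.Rank1Residual.GoodOrd W 2 ∨ Literature.NumberTheory.EllipticCurves.Rank1Residual.Mult W 2) → (∀ m : ℕ, W.HasSurjectiveModNGaloisRep (2 ^ m : ℕ)) → ∀ (K : Type) [Field K] [NumberField K], Literature.NumberTheory.EllipticCurves.IsImaginaryQuadratic K → ∀ [NeZero (W.conductorNorm ℤ)], Literature.NumberTheory.EllipticCurves.SatisfiesHeegnerHypothesis (W.conductorNorm ℤ) K → Odd (NumberField.discr K) → NumberField.discr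 K ≠ -3 → AddSubgroup.torsionBy (W.baseChange K).toAffine.Point (2 : ℤ) = ⊥ → Literature.NumberTheory.EllipticCurves.SatisfiesHeegnerHypothesis 2 K → ∀ (Dt : Literature.NumberTheory.EllipticCurves.ModularForms.ModularParametrizationData W (W.conductorNorm ℤ)) (β : ℤ) (ι : K →+* ℂ) [∀ k : ℕ, NumberField (ringClassField K ι k)], (4 * (W.conductorNorm ℤ : ℤ)) ∣ β ^ 2 - NumberField.discr K →
    ∀ (τ : K ≃ₐ[ℚ] K), τ ≠ 1 → ∀ (u : ℤ), (u = 1 ∨ u = -1) →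
    ∃ C : ℕ, ∀ (M I bnd k a b : ℕ) (y : Fin k → galH1Torsion (W.baseChange K) ((2 ^ M : ℕ) : ℤ))
      (z c : galH1Torsion (W.baseChange K) ((2 ^ M : ℕ) : ℤ)),
      1 ≤ M → M + 1 ≤ I →
      (∀ i, conjAct W τ ((2 ^ M : ℕ) : ℤ) (y i) = (-u) • y i) →
      conjAct W τ ((2 ^ M : ℕ) : ℤ) z = (-u) • z →
      conjAct W τ ((2 ^ M : ℕ) : ℤ) c = u • c →
      (∀ bv : Fin k → ℤ, ¬ ∀ σ ∈ torsionFixing (W.baseChange K) ((2 ^ (M + 1) : ℕ) : ℤ),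
          h1Eval (W.baseChange K) ((2 ^ M : ℕ) : ℤ) (((2 ^ (a + C) : ℕ) : ℤ) • z - ∑ i, bv i • y i) σ = 0) →
      (∃ ρ ∈ torsionFixing (W.baseChange K) ((2 ^ M : ℕ) : ℤ),
          ((2 ^ (b + C) : ℕ) : ℤ) • h1Eval (W.baseChange K) ((2 ^ M : ℕ) : ℤ) c ρ ≠ 0) →
      ∃ ℓ : ℕ, bnd < ℓ ∧ Literature.NumberTheory.EllipticCurves.Zhang2014.IsKolyvaginPrime (W.conductorNorm ℤ) W K 2 ℓ ∧
        (I ≤ Literature.NumberTheory.EllipticCurves.Zhang2014.kolyvaginIndex W 2 ℓ ∧ (∃ (pl : HeightOneSpectrum (𝓞 ℚ)) (𝔓 : Ideal (absIntegers (𝓞 ℚ) ℚ)) (h : absoluteGaloisGroup ℚ), (ℓ : 𝓞 ℚ) ∈ pl.asIdeal ∧ 𝔓 ∈ pl.primesAbove ∧ IsArithFrobAt (𝓞 ℚ) h 𝔓 ∧ (∀ X : geomTorsion W ((2 ^ M : ℕ) : ℤ), h • h • X = X) ∧ ∃ P : geomTorsion W ((2 ^ M : ℕ) : ℤ), (2 :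 ℤ) ^ (M - 1) • (P + h • P) ≠ 0)) ∧
        ∃ v : IsDedekindDomain.HeightOneSpectrum (NumberField.RingOfIntegers K), (ℓ : NumberField.RingOfIntegers K) ∈ v.asIdeal ∧
          (∀ i, y i ∈ (W.baseChange K).torsionLocalKer (v.adicCompletion K) ((2 ^ M : ℕ) : ℤ)) ∧
          ((2 ^ a : ℕ) : ℤ) • z ∉ (W.baseChange K).torsionLocalKer (v.adicCompletion K) ((2 ^ M : ℕ) : ℤ) ∧
          ((2 ^ b : ℕ) : ℤ) • c ∉ (W.baseChange K).torsionLocalKer (v.adicCompletion K) ((2 ^ M : ℕ) : ℤ)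

/-- SC · SHAPE CUT AT 2 (v8.1 stub, size M; the CUT half of the signed refill law, = shape persistence across one engine step when `t ≥ 1`).
If the `(−u)`-part of `H_{𝓕(e)}(K,E[2^M])` has shape `Sh(t+1, a)` witnessed by `g₀, …, g_t`, and `ℓ ∤ e` is a Kolyvagin prime (`eℓ` square-free
Kolyvagin, margin one) with a place `v ∣ ℓ` at which the kept classes `g₁ … g_t` are locally trivial and `g₀` is CUT deeply (`2^{M−a−1} loc_v g₀ ≠ 0`),
then the `(−u)`-part of `H_{𝓕(eℓ)}` has shape `Sh(t, gC a)` (witness: `g₁ … g_t`; `gC` uniform in `M`).  PROOF MAP: the kept classes lie in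
`H_{𝓕(eℓ)}` (`ModifiedSelmerLocallyTrivialSurvival.mem_modifiedSelmerGroup_mul_of_localization_eq_zero`) and stay nearly free (sub-family); at
`λ ∣ ℓ`, `A^{−u} ∋ loc g₀` of order `≥ 2^{M−a}` so `#B^{−u} ≤ 2^{a+O(1)}` (Lagrangian `L = A ⊕ B` per sign up to two bits, `#L^{−u} ≤ 2^{M+3}`:
`SignedRefillLaw`, exact transversality `f ∩ tr = 0` at margin one), hence every exact `(−u)`-class `y ∈ H_{𝓕(eℓ)}` has `2^{a+O(1)} loc_ℓ y = 0`,
`2^{a+O(1)} y ∈ H_{𝓕(e)}`, `2^{2a+O(1)} y ≡ Σ bᵢ gᵢ`; localising at `ℓ` (Φ-KILL `RegularRefill.localization_eq_zero_of_forall_h1Eval_eq_zero`) kills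
`b₀` up to `2^{a+1}`: `2^{3a+O(1)} y ≡ Σ_{i≥1} bᵢ' gᵢ`.  Why it might fail: only with the O(1) of the per-sign Lagrangian splitting at 2 (the same
(α) as SRS, now a tree theorem with `C = 7`).  Cheapest falsifier: `t = 0` kept classes, `a = 0`: SC must give `Sh(0, gC 0)` at `eℓ`, i.e. NO
exact `(−u)`-class of `H_{𝓕(eℓ)}` beyond `2^{gC 0}` once `loc_ℓ g₀` has full order — the co-cyclic refill law read upward.
[cite: MazurRubin2004, §4.1 Prop. 4.1.5, Lemma 4.1.7] [cite: Howard2004Heegner, §1.5–1.6] [cite: Kolyvagin1991StructureSha, Prop. 8] -/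
def ShapeCutAtTwo : Prop :=
  ∀ (W : WeierstrassCurve ℚ) [W.IsElliptic] [W.IsGloballyMinimal], ¬ W.HasCM → (Literature.NumberTheory.EllipticCurves.Rank1Residual.GoodOrd W 2 ∨ Literature.NumberTheory.EllipticCurves.Rank1Residual.Mult W 2) → (∀ m : ℕ, W.HasSurjectiveModNGaloisRep (2 ^ m : ℕ)) → ∀ (K : Type) [Field K] [NumberField K], Literature.NumberTheory.EllipticCurves.IsImaginaryQuadratic K → ∀ [NeZero (W.conductorNorm ℤ)], Literature.NumberTheory.EllipticCurves.SatisfiesHeegnerHypothesis (W.conductorNorm ℤ) K → Odd (NumberField.discr K) → NumberField.discr K ≠ -3 → AddSubgroup.torsionBy (W.baseChange K).toAffine.Point (2 : ℤ) = ⊥ → Literature.NumberTheory.EllipticCurves.SatisfiesHeegnerHypothesis 2 K → ∀ (Dt : Literature.NumberTheory.EllipticCurves.ModularForms.ModularParametrizationData W (W.conductorNorm ℤ)) (β : ℤ) (ι : K →+* ℂ) [∀ k : ℕ, NumberField (ringClassField K ι k)], (4 * (W.conductorNorm ℤ : ℤ)) ∣ β ^ 2 - NumberField.discr K →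
    ∀ (τ : K ≃ₐ[ℚ] K), τ ≠ 1 → ∀ (u : ℤ), (u = 1 ∨ u = -1) →
    ∃ gC : ℕ → ℕ, ∀ (M e ℓ a t : ℕ) (g : Fin (t + 1) → galH1Torsion (W.baseChange K) ((2 ^ M : ℕ) : ℤ)),
      Literature.NumberTheory.EllipticCurves.KolyvaginDescent.KolSupp (Literature.NumberTheory.EllipticCurves.Zhang2014.IsKolyvaginPrime (W.conductorNorm ℤ) W K 2) (e * ℓ) →
      ℓ.Prime → ¬ ℓ ∣ e → 1 ≤ M → (((M + 1 : ℕ) : ℕ) : ℕ∞) ≤ Literature.NumberTheory.EllipticCurves.Zhang2014.levelIndex W 2 (e * ℓ) →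
      (∀ i, g i ∈ Jetchev2008.modifiedSelmerGroup W K ι ((2 ^ M : ℕ) : ℤ) e) →
      (∀ i, conjAct W τ ((2 ^ M : ℕ) : ℤ) (g i) = (-u) • g i) →
      (∀ b : Fin (t + 1) → ℤ, (∀ σ ∈ torsionFixing (W.baseChange K) ((2 ^ (M + 1) : ℕ) : ℤ),
          h1Eval (W.baseChange K) ((2 ^ M : ℕ) : ℤ) (∑ i, b i • g i) σ = 0) → ∀ i, (2 : ℤ) ^ (M - a) ∣ b i) →
      (∀ y : galH1Torsion (W.baseChange K) ((2 ^ M : ℕ) : ℤ), y ∈ Jetchev2008.modifiedSelmerGroup W K ι ((2 ^ M : ℕ) : ℤ) e →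
        conjAct W τ ((2 ^ M : ℕ) : ℤ) y = (-u) • y →
        ∃ b : Fin (t + 1) → ℤ, ∀ σ ∈ torsionFixing (W.baseChange K) ((2 ^ (M + 1) : ℕ) : ℤ),
          h1Eval (W.baseChange K) ((2 ^ M : ℕ) : ℤ) (((2 : ℤ) ^ a) • y - ∑ i, b i • g i) σ = 0) →
      (∃ v : IsDedekindDomain.HeightOneSpectrum (NumberField.RingOfIntegers K), (ℓ : NumberField.RingOfIntegers K) ∈ v.asIdeal ∧
          (∀ i : Fin t, g i.succ ∈ (W.baseChange K).torsionLocalKer (v.adicCompletion K) ((2 ^ M : ℕ) : ℤ)) ∧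
          ((2 ^ (M - a - 1) : ℕ) : ℤ) • g 0 ∉ (W.baseChange K).torsionLocalKer (v.adicCompletion K) ((2 ^ M : ℕ) : ℤ)) →
      OppShape W K ι τ M (e * ℓ) u (gC a) t

/-- SRF · SHAPE REFILL AT 2 (v8.1 stub, size M; the SUPPLY half of the signed refill law at an ENGINE prime together with its uniqueness, = shape
persistence across one engine step when `t = 0`).  If the `(−u)`-part of `H_{𝓕(e)}` has shape `Sh(0, a)` and `ℓ ∤ e` is a Kolyvagin prime
(`eℓ` square-free Kolyvagin, margin one), then the `(−u)`-part of `H_{𝓕(eℓ)}` has shape `Sh(1, gR a)`.  PROOF MAP: the tree's SRS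
`RegularWalk.signedRefillSupplyAtTwo` AT `ℓ` gives an exact `(−u)`-class `x ∈ H_{𝓕(ℓe)}` of order `≥ 2^{M−a−7}` — nearly free (a phantom multiple
`b x` has `2bx = 0`: `RegularWalk.two_zsmul_eq_zero_of_res_eq_zero`) and with `loc_ℓ x` of order `≥ 2^{M−2a−O(1)}` (else a multiple of `x` beyond
`2^a` would lie in `H_{𝓕(e)}^{(−u)}`); `B^{−u} ⊆ H¹_tr^{−u} ≅ ℤ/2^M ⊕ (≤ one bit)` so every exact `(−u)`-class `y ∈ H_{𝓕(eℓ)}` has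
`2^{a+O(1)} loc y = β loc x`, `2^{a+O(1)} y − βx ∈ H_{𝓕(e)}^{(−u)}`, `2^{2a+O(1)} y ≡ 2^a β x`.  Why it might fail: only with the O(1) of the
`ℤ/2^M ⊕ ℤ/2`-glitch of `H¹_tr^{−u}(K_λ, E[2^M])` (uniform: index `≥ M+1`).  Cheapest falsifier: `a ≥ M` makes the hypothesis vacuous-true and the
conclusion must still hold — it does (`gR a ≥ a ≥ M` makes `Sh(1, gR a)` trivial), so test `a = 0`, `e = 1`, `M = 3` on a curve with
`Sel_8(E/K)^{(−u)} = 0`: `H_{𝓕(ℓ)}^{(−u)}` must be nearly CYCLIC.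
[cite: MazurRubin2004, §4.1 Prop. 4.1.5, Lemma 4.1.7] [cite: Howard2004Heegner, §1.5–1.6] [cite: GrossLMS1991, §9] -/
def ShapeRefillAtTwo : Prop :=
  ∀ (W : WeierstrassCurve ℚ) [W.IsElliptic] [W.IsGloballyMinimal], ¬ W.HasCM → (Literature.NumberTheory.EllipticCurves.Rank1Residual.GoodOrd W 2 ∨ Literature.NumberTheory.EllipticCurves.Rank1Residual.Mult W 2) → (∀ m : ℕ, W.HasSurjectiveModNGaloisRep (2 ^ m : ℕ)) → ∀ (K : Type) [Field K] [NumberField K], Literature.NumberTheory.EllipticCurves.IsImaginaryQuadratic K → ∀ [NeZero (W.conductorNorm ℤ)], Literature.NumberTheory.EllipticCurves.SatisfiesHeegnerHypothesis (W.conductorNorm ℤ) K → Odd (NumberField.discr K) → NumberField.discr K ≠ -3 → AddSubgroup.torsionBy (W.baseChange K).toAffine.Point (2 : ℤ) = ⊥ → Literature.NumberTheory.EllipticCurves.SatisfiesHeegnerHypothesis 2 K → ∀ (Dt : Literature.NumberTheory.EllipticCurves.ModularForms.ModularParametrizationData W (W.conductorNorm ℤ)) (β : ℤ) (ι : K →+*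 ℂ) [∀ k : ℕ, NumberField (ringClassField K ι k)], (4 * (W.conductorNorm ℤ : ℤ)) ∣ β ^ 2 - NumberField.discr K →
    ∀ (τ : K ≃ₐ[ℚ] K), τ ≠ 1 → ∀ (u : ℤ), (u = 1 ∨ u = -1) →
    ∃ gR : ℕ → ℕ, ∀ (M e ℓ a : ℕ),
      Literature.NumberTheory.EllipticCurves.KolyvaginDescent.KolSupp (Literature.NumberTheory.EllipticCurves.Zhang2014.IsKolyvaginPrime (W.conductorNorm ℤ) W K 2) (e * ℓ) →
      ℓ.Prime → ¬ ℓ ∣ e → 1 ≤ M → (((M + 1 : ℕ) : ℕ) : ℕ∞) ≤ Literature.NumberTheory.EllipticCurves.Zhang2014.levelIndex W 2 (e * ℓ) →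
      OppShape W K ι τ M e u a 0 →
      OppShape W K ι τ M (e * ℓ) u (gR a) 1

/-! ### Kernel bookkeeping for the derivation of SWα⁗ -/

/-- Near-freeness is monotone in the error. -/
theorem free_mono {W : WeierstrassCurve ℚ} {K : Type} [Field K] [NumberField K] {M a d t : ℕ}
    {g : Fin t → galH1Torsion (W.baseChange K) ((2 ^ M : ℕ) : ℤ)} (had : a ≤ d)
    (hfree : ∀ b : Fin t → ℤ, (∀ σ ∈ torsionFixing (W.baseChange K) ((2 ^ (M + 1) : ℕ) : ℤ),
        h1Eval (W.baseChange K) ((2 ^ M : ℕ) : ℤ) (∑ i, b i • g i) σ = 0) → ∀ i, (2 : ℤ) ^ (M - a) ∣ b i) :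
    ∀ b : Fin t → ℤ, (∀ σ ∈ torsionFixing (W.baseChange K) ((2 ^ (M + 1) : ℕ) : ℤ),
        h1Eval (W.baseChange K) ((2 ^ M : ℕ) : ℤ) (∑ i, b i • g i) σ = 0) → ∀ i, (2 : ℤ) ^ (M - d) ∣ b i :=
  fun b hb i ↦ dvd_trans (pow_dvd_pow 2 (by omega)) (hfree b hb i)

/-- The no-medium-class clause is monotone in the error. -/
theorem span_mono {W : WeierstrassCurve ℚ} [W.IsElliptic] {K : Type} [Field K] [NumberField K] {ι : K →+* ℂ}
    [∀ k : ℕ, NumberField (ringClassField K ι k)] {τ : K ≃ₐ[ℚ] K} {M e : ℕ} {u : ℤ} {a d t : ℕ}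
    {g : Fin t → galH1Torsion (W.baseChange K) ((2 ^ M : ℕ) : ℤ)} (had : a ≤ d)
    (hspan : ∀ y : galH1Torsion (W.baseChange K) ((2 ^ M : ℕ) : ℤ), y ∈ Jetchev2008.modifiedSelmerGroup W K ι ((2 ^ M : ℕ) : ℤ) e →
        conjAct W τ ((2 ^ M : ℕ) : ℤ) y = (-u) • y →
        ∃ b : Fin t → ℤ, ∀ σ ∈ torsionFixing (W.baseChange K) ((2 ^ (M + 1) : ℕ) : ℤ),
          h1Eval (W.baseChange K) ((2 ^ M : ℕ) : ℤ) (((2 : ℤ) ^ a) • y - ∑ i, b i • g i) σ = 0) :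
    ∀ y : galH1Torsion (W.baseChange K) ((2 ^ M : ℕ) : ℤ), y ∈ Jetchev2008.modifiedSelmerGroup W K ι ((2 ^ M : ℕ) : ℤ) e →
        conjAct W τ ((2 ^ M : ℕ) : ℤ) y = (-u) • y →
        ∃ b : Fin t → ℤ, ∀ σ ∈ torsionFixing (W.baseChange K) ((2 ^ (M + 1) : ℕ) : ℤ),
          h1Eval (W.baseChange K) ((2 ^ M : ℕ) : ℤ) (((2 : ℤ) ^ d) • y - ∑ i, b i • g i) σ = 0 := by
  intro y hy hyτ
  obtain ⟨b, hb⟩ := hspan y hy hyτ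
  obtain ⟨r, rfl⟩ := Nat.exists_eq_add_of_le had
  refine ⟨fun i ↦ (2 : ℤ) ^ r * b i, fun σ hσ ↦ ?_⟩
  have hle : torsionFixing (W.baseChange K) ((2 ^ (M + 1) : ℕ) : ℤ) ≤ torsionFixing (W.baseChange K) ((2 ^ M : ℕ) : ℤ) :=
    KolyvaginLowerBoundAtTwo.torsionFixing_le_of_dvd _ (KolyvaginAtTwo.RegularValueEngine.natCast_two_pow_dvd_succ M)
  have heq : ((2 : ℤ) ^ (a + r)) • y - ∑ i, ((2 : ℤ) ^ r * b i) • g i = (2 : ℤ) ^ r • (((2 : ℤ) ^ a) • y - ∑ i, b i • g i) := by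
    rw [zsmul_sub, smul_smul, ← pow_add, add_comm r a, KolyvaginAtTwo.RegularWalk.zsmul_finset_sum]
    simp only [smul_smul]
  rw [heq, h1Eval_zsmul _ _ _ _ (hle hσ), hb σ hσ, smul_zero]

/-- Shape errors are monotone: `Sh(t, a) ⟹ Sh(t, d)` for `a ≤ d` (same witness). -/
theorem oppShape_mono {W : WeierstrassCurve ℚ} [W.IsElliptic] {K : Type} [Field K] [NumberField K] {ι : K →+* ℂ}
    [∀ k : ℕ, NumberField (ringClassField K ι k)] {τ : K ≃ₐ[ℚ] K} {M e : ℕ} {u : ℤ} {a d t : ℕ} (had : a ≤ d)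
    (h : OppShape W K ι τ M e u a t) : OppShape W K ι τ M e u d t := by
  obtain ⟨g, hmem, hsign, hfree, hspan⟩ := h
  exact ⟨g, hmem, hsign, free_mono had hfree, span_mono had hspan⟩

/-- `KolSupp` is hereditary. [folklore] -/
theorem kolSupp_of_dvd {Kol : ℕ → Prop} {m n : ℕ} (h : Literature.NumberTheory.EllipticCurves.KolyvaginDescent.KolSupp Kol n) (hmn : m ∣ n) :
    Literature.NumberTheory.EllipticCurves.KolyvaginDescent.KolSupp Kol m :=
  ⟨h.1.squarefree_of_dvd hmn, fun q hq ↦ h.2 q (Nat.primeFactors_mono hmn h.1.ne_zero hq)⟩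

/-- `KolSupp` of `n ℓ` for a fresh Kolyvagin prime `ℓ`. [folklore] -/
theorem kolSupp_mul_of_prime {Kol : ℕ → Prop} {n ℓ : ℕ} (h : Literature.NumberTheory.EllipticCurves.KolyvaginDescent.KolSupp Kol n)
    (hℓ : ℓ.Prime) (hKℓ : Kol ℓ) (hℓn : ¬ ℓ ∣ n) :
    Literature.NumberTheory.EllipticCurves.KolyvaginDescent.KolSupp Kol (n * ℓ) := by
  have hcop : Nat.Coprime n ℓ := (Nat.coprime_comm.mp ((Nat.Prime.coprime_iff_not_dvd hℓ).mpr hℓn))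
  refine ⟨(Nat.squarefree_mul hcop).mpr ⟨h.1, hℓ.squarefree⟩, fun q hq ↦ ?_⟩
  rw [Nat.primeFactors_mul h.1.ne_zero hℓ.ne_zero, hℓ.primeFactors, Finset.mem_union, Finset.mem_singleton] at hq
  rcases hq with hq | rfl
  · exact h.2 q hq
  · exact hKℓ

/-- The margin `M ≤ M(n)` is hereditary. [folklore] -/
theorem levelIndex_of_dvd {W : WeierstrassCurve ℚ} [W.IsElliptic] [W.IsGloballyMinimal] {M m n : ℕ} (hn : n ≠ 0) (hmn : m ∣ n)
    (h : ((M : ℕ) : ℕ∞) ≤ Literature.NumberTheory.EllipticCurves.Zhang2014.levelIndex W 2 n) :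
    ((M : ℕ) : ℕ∞) ≤ Literature.NumberTheory.EllipticCurves.Zhang2014.levelIndex W 2 m :=
  Zhang2014.natCast_le_levelIndex_iff.mpr fun q hq ↦
    Zhang2014.natCast_le_levelIndex_iff.mp h q (Nat.primeFactors_mono hmn hn hq)

/-- The margin of `n ℓ`. [folklore] -/
theorem levelIndex_mul_of_prime {W : WeierstrassCurve ℚ} [W.IsElliptic] [W.IsGloballyMinimal] {M n ℓ : ℕ} (hn : n ≠ 0) (hℓ : ℓ.Prime)
    (h : ((M : ℕ) : ℕ∞) ≤ Literature.NumberTheory.EllipticCurves.Zhang2014.levelIndex W 2 n)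
    (hℓM : M ≤ Literature.NumberTheory.EllipticCurves.Zhang2014.kolyvaginIndex W 2 ℓ) :
    ((M : ℕ) : ℕ∞) ≤ Literature.NumberTheory.EllipticCurves.Zhang2014.levelIndex W 2 (n * ℓ) := by
  refine Zhang2014.natCast_le_levelIndex_iff.mpr fun q hq ↦ ?_
  rw [Nat.primeFactors_mul hn hℓ.ne_zero, hℓ.primeFactors, Finset.mem_union, Finset.mem_singleton] at hq
  rcases hq with hq | rfl
  · exact Zhang2014.natCast_le_levelIndex_iff.mp h q hq
  · exact hℓM

/-- An element of `E[n]` (as a subtype) is killed by `n` (kernel algebra). [folklore] -/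
theorem geomTorsion_zsmul_self_eq_zero {k : Type} [Field k] (V : WeierstrassCurve k) (n : ℤ) (P : geomTorsion V n) :
    n • P = 0 := by
  apply Subtype.ext
  rw [AddSubgroupClass.coe_zsmul, ZeroMemClass.coe_zero]
  exact (mem_geomTorsion_iff V n (P : geomPoints V)).mp P.2

/-- A class killed by `2` is not visible beyond `2^{x+1}`: if `2^{x+1}·[c, ρ] ≠ 0` then `2·c ≠ 0`. -/
theorem two_zsmul_ne_zero_of_vis {W : WeierstrassCurve ℚ} {K : Type} [Field K] [NumberField K] {M x : ℕ}
    {c : galH1Torsion (W.baseChange K) ((2 ^ M : ℕ) : ℤ)} {ρ : absoluteGaloisGroup K}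
    (hρ : ρ ∈ torsionFixing (W.baseChange K) ((2 ^ M : ℕ) : ℤ))
    (h : ((2 ^ (x + 1) : ℕ) : ℤ) • h1Eval (W.baseChange K) ((2 ^ M : ℕ) : ℤ) c ρ ≠ 0) : (2 : ℤ) • c ≠ 0 := by
  intro h2
  apply h
  have hsplit : ((2 ^ (x + 1) : ℕ) : ℤ) = ((2 ^ x : ℕ) : ℤ) * (2 : ℤ) := by push_cast; ring
  rw [hsplit, mul_smul, ← h1Eval_zsmul _ _ _ _ hρ, h2, h1Eval_zero _ _ hρ, smul_zero]

/-- The level exceeds any visible exponent: `2^x·[c, ρ] ≠ 0 ⟹ x < M`. -/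
theorem lt_level_of_vis {W : WeierstrassCurve ℚ} {K : Type} [Field K] [NumberField K] {M x : ℕ}
    {c : galH1Torsion (W.baseChange K) ((2 ^ M : ℕ) : ℤ)} {ρ : absoluteGaloisGroup K}
    (h : ((2 ^ x : ℕ) : ℤ) • h1Eval (W.baseChange K) ((2 ^ M : ℕ) : ℤ) c ρ ≠ 0) : x < M := by
  by_contra hle
  push Not at hle
  apply h
  exact KolyvaginLowerBoundAtTwo.two_pow_zsmul_eq_zero_of_le_swap hle
    (geomTorsion_zsmul_self_eq_zero _ _ _)


set_option maxHeartbeats 1600000 in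
/-- **SWα⁗ DERIVED IN THE KERNEL (v8.1).**  {ES, SC, SRF} (the three v8.1 stubs) + OSR (kernel, mod P372) + SRS (tree) ⟹
`ShedSeedPrimeShapedAtTwo` — the statement registered since v7.7 is now a THEOREM of the line modulo three typed M-lemmas.  THE WALK OF ONE STEP:
(0) the walking class `c = c_M(se)` is visible beyond `2^(v + κ a)`, so `2c ≠ 0`, the level is large, and the sign `u` IS `−w(E)(−1)^{#(se)}`
(tree sign law `sign_conjAct_kolyvaginClass_two`) — hence every Kolyvagin class with the same number of prime factors has sign `u` again;
(1) THE PARTNER: if `t ≥ 1` the basis class `g₀ ∈ H_{𝓕(e)}^{(−u)}` (near-freeness makes `2^(M−a−1) g₀` non-medium); if `t = 0` the corner gives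
`#s ≥ 2`, a seed prime `q₀ ∣ s`, and SRS supplies an exact `(−u)`-class `z ∈ H_{𝓕(q₀e)}` of order `≥ 2^(M−a−C_R−1)` (non-phantom one bit down:
`RegularWalk.two_zsmul_eq_zero_of_res_eq_zero`); (2) ES: a deep regular engine prime `ℓ > se` killing the kept classes, cutting the partner and
keeping `c` alive at `ℓ`; (3) OSR names a SEED prime `q' ∣ s` with `2^v·loc_{q'} c_M(seℓ) ∉ Sel-condition`; (4) JET UP/DOWN give the data at
`seℓ` and `s'(eℓ)`, `s = q's'`; (5) the new shape at `eℓ` is SC's `Sh(t, gC(a+C_E))` or SRF's `Sh(1, gR a)`, weakened to `g a := max`.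
Constants: `κ a = a + 2C_E + C_O + C_R + 2`, `g a = max (gC (a + C_E)) (gR a)`.  No summit / crux is proved by this theorem; BSD is NOT proved. -/
theorem shedSeedPrimeShapedAtTwo_of (hE : EngineSupplyAtTwo) (hSC : ShapeCutAtTwo) (hSRF : ShapeRefillAtTwo)
    (hO : OppositeSignReciprocityAtTwo) (hR : SignedRefillSupplyAtTwo) : ShedSeedPrimeShapedAtTwo := by
  intro W _ _ hCM hred hsurj K _ _ hK _ hH hodd hd3 htors hH2 Dt β ι _ hβ τ hτ1 u hu
  obtain ⟨CE, hES⟩ := hE W hCM hred hsurj K hK hH hodd hd3 htors hH2 Dt β ι hβ τ hτ1 u hu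
  obtain ⟨gC, hCut⟩ := hSC W hCM hred hsurj K hK hH hodd hd3 htors hH2 Dt β ι hβ τ hτ1 u hu
  obtain ⟨gR, hRef⟩ := hSRF W hCM hred hsurj K hK hH hodd hd3 htors hH2 Dt β ι hβ τ hτ1 u hu
  obtain ⟨CO, hOSR⟩ := hO W hCM hred hsurj K hK hH hodd hd3 htors hH2 Dt β ι hβ τ hτ1 u hu
  obtain ⟨CR, hSRS⟩ := hR W hCM hred hsurj K hK hH hodd hd3 htors hH2 Dt β ι hβ τ hτ1 u hu
  refine ⟨fun a ↦ a + 2 * CE + CO + CR + 1 + 1, fun a ↦ max (gC (a + CE)) (gR a), ?_⟩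
  intro a t I M v s e d hKol hs1 hM hMI hidx heng hshape hcorner hcsign hvis
  obtain ⟨ρ, hρ, hvisρ⟩ := hvis
  beta_reduce at hvisρ
  -- (0) sizes, `2c ≠ 0`
  have hMbig : v + (a + 2 * CE + CO + CR + 1 + 1) < M := lt_level_of_vis hvisρ
  have h2c : (2 : ℤ) • d.kolyvaginClass Nat.prime_two M ≠ 0 :=
    two_zsmul_ne_zero_of_vis (x := v + (a + 2 * CE + CO + CR + 1)) hρ hvisρ
  have hn0 : s * e ≠ 0 := hKol.1.ne_zero
  have hs0 : s ≠ 0 := left_ne_zero_of_mul hn0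
  have he0 : e ≠ 0 := right_ne_zero_of_mul hn0
  have hsqs : Squarefree s := hKol.1.squarefree_of_dvd (dvd_mul_right s e)
  -- (0') the exact sign `u = −w(E)(−1)^#(se)`
  have hD4 : NumberField.discr K ≠ -4 := by
    intro h4
    rw [h4] at hodd
    exact (Int.not_even_iff_odd.mpr hodd) ⟨-2, by norm_num⟩
  have h21 : W.HasSurjectiveModNGaloisRep ((2 : ℤ) ^ 1) := by simpa using hsurj 1
  have hnK : ∀ q ∈ (s * e).primeFactors, Literature.NumberTheory.EllipticCurves.Zhang2014.IsKolyvaginPrime (W.conductorNorm ℤ) W K 2 q ∧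
      M ≤ Literature.NumberTheory.EllipticCurves.Zhang2014.kolyvaginIndex W 2 q :=
    fun q hq ↦ ⟨hKol.2 q hq, le_trans (Nat.le_succ M) (Zhang2014.natCast_le_levelIndex_iff.mp hidx q hq)⟩
  obtain ⟨hw', hcw'⟩ := GenusExact.KolyvaginClassSign.sign_conjAct_kolyvaginClass_two hK hd3 hD4 hodd hH h21 τ hτ1 Dt β ι hKol.1 hM hnK d
  generalize hwgen : (-W.rootNumber * (-1) ^ (s * e).primeFactors.card : ℤ) = w' at hw' hcw'
  have huw : u = w' := by
    rcases hu with rfl | rfl <;> rcases hw' with rfl | rfl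
    · rfl
    · exfalso
      apply h2c
      rw [show (2 : ℤ) • d.kolyvaginClass Nat.prime_two M = (1 : ℤ) • d.kolyvaginClass Nat.prime_two M - (-1 : ℤ) • d.kolyvaginClass Nat.prime_two M by
        rw [one_zsmul, neg_one_zsmul, sub_neg_eq_add, two_zsmul], ← hcsign, ← hcw', sub_self]
    · exfalso
      apply h2c
      rw [show (2 : ℤ) • d.kolyvaginClass Nat.prime_two M = (1 : ℤ) • d.kolyvaginClass Nat.prime_two M - (-1 : ℤ) • d.kolyvaginClass Nat.prime_two M by
        rw [one_zsmul, neg_one_zsmul, sub_neg_eq_add, two_zsmul], ← hcsign, ← hcw', sub_self]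
    · rfl
  -- (0'') Gross's CM facts (PROVED Literature), `d_K < −4`, the UP data at every fresh Kolyvagin prime
  have hCM1 : phi_heegnerPointOfConductor_mem_range_map_ringClassField (W.conductorNorm ℤ) W K :=
    phi_heegnerPointOfConductor_mem_range_map_ringClassField_holds (W.conductorNorm ℤ) W K
  have hD : NumberField.discr K < -4 := GenusKoly.discr_lt_neg_four_of_odd hK hodd hd3
  obtain ⟨dℓ, hdℓ⟩ := Summit.BirchSwinnertonDyer.Rank1Residual.JET.exists_compatible_data_of_grossCM hCM1 hK hD hH 2 Dt β ι hKol.1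
    (fun l hl ↦ hKol.2 l hl) d
  -- (E) engine-prime bookkeeping
  have prep : ∀ ℓ : ℕ, Literature.NumberTheory.EllipticCurves.Zhang2014.IsKolyvaginPrime (W.conductorNorm ℤ) W K 2 ℓ → s * e < ℓ →
      I ≤ Literature.NumberTheory.EllipticCurves.Zhang2014.kolyvaginIndex W 2 ℓ →
      ℓ.Prime ∧ ¬ ℓ ∣ e ∧ Literature.NumberTheory.EllipticCurves.KolyvaginDescent.KolSupp (Literature.NumberTheory.EllipticCurves.Zhang2014.IsKolyvaginPrime (W.conductorNorm ℤ) W K 2) (e * ℓ) ∧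
        (((M + 1 : ℕ) : ℕ) : ℕ∞) ≤ Literature.NumberTheory.EllipticCurves.Zhang2014.levelIndex W 2 (e * ℓ) := by
    intro ℓ hKolℓ hlt hIℓ
    have hℓn : ¬ ℓ ∣ s * e := fun h ↦ absurd (Nat.le_of_dvd (Nat.pos_of_ne_zero hn0) h) (by omega)
    have hℓe : ¬ ℓ ∣ e := fun h ↦ hℓn (dvd_mul_of_dvd_right h s)
    exact ⟨hKolℓ.1, hℓe, kolSupp_mul_of_prime (kolSupp_of_dvd hKol (dvd_mul_left e s)) hKolℓ.1 hKolℓ hℓe,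
      levelIndex_mul_of_prime he0 hKolℓ.1 (levelIndex_of_dvd hn0 (dvd_mul_left e s) hidx) (le_trans hMI hIℓ)⟩
  -- (T) THE COMMON TAIL: OSR names the seed prime; JET UP/DOWN; bookkeeping; hand over the new shape.
  have tail : ∀ (m₁ t' aE bO ℓ : ℕ) (z : galH1Torsion (W.baseChange K) ((2 ^ M : ℕ) : ℤ))
      (w : IsDedekindDomain.HeightOneSpectrum (NumberField.RingOfIntegers K)),
      m₁ ∣ s → z ∈ Jetchev2008.modifiedSelmerGroup W K ι ((2 ^ M : ℕ) : ℤ) (m₁ * e) →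
      conjAct W τ ((2 ^ M : ℕ) : ℤ) z = (-u) • z →
      Literature.NumberTheory.EllipticCurves.Zhang2014.IsKolyvaginPrime (W.conductorNorm ℤ) W K 2 ℓ → s * e < ℓ →
      I ≤ Literature.NumberTheory.EllipticCurves.Zhang2014.kolyvaginIndex W 2 ℓ →
      (∃ (pl : HeightOneSpectrum (𝓞 ℚ)) (𝔓 : Ideal (absIntegers (𝓞 ℚ) ℚ)) (h : absoluteGaloisGroup ℚ), (ℓ : 𝓞 ℚ) ∈ pl.asIdeal ∧ 𝔓 ∈ pl.primesAbove ∧ IsArithFrobAt (𝓞 ℚ) h 𝔓 ∧ (∀ X : geomTorsion W ((2 ^ M : ℕ) : ℤ), h • h • X = X) ∧ ∃ P : geomTorsion W ((2 ^ M : ℕ) : ℤ), (2 : ℤ) ^ (M - 1) • (P + h • P) ≠ 0) →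
      (ℓ : NumberField.RingOfIntegers K) ∈ w.asIdeal →
      ((2 ^ aE : ℕ) : ℤ) • z ∉ (W.baseChange K).torsionLocalKer (w.adicCompletion K) ((2 ^ M : ℕ) : ℤ) →
      ((2 ^ bO : ℕ) : ℤ) • d.kolyvaginClass Nat.prime_two M ∉ (W.baseChange K).torsionLocalKer (w.adicCompletion K) ((2 ^ M : ℕ) : ℤ) →
      v + M + CO ≤ aE + bO →
      OppShape W K ι τ M (e * ℓ) u (max (gC (a + CE)) (gR a)) t' →
        ∃ (q s' f t' : ℕ) (d' : Literature.NumberTheory.EllipticCurves.KolyvaginHeegnerData Dt β ι (s' * (e * f))),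
          s = q * s' ∧ q.Prime ∧
          (∀ p ∈ (e * f).primeFactors, I ≤ Literature.NumberTheory.EllipticCurves.Zhang2014.kolyvaginIndex W 2 p ∧ (∃ (pl : HeightOneSpectrum (𝓞 ℚ)) (𝔓 : Ideal (absIntegers (𝓞 ℚ) ℚ)) (h : absoluteGaloisGroup ℚ), (p : 𝓞 ℚ) ∈ pl.asIdeal ∧ 𝔓 ∈ pl.primesAbove ∧ IsArithFrobAt (𝓞 ℚ) h 𝔓 ∧ (∀ X : geomTorsion W ((2 ^ M : ℕ) : ℤ), h • h • X = X) ∧ ∃ P : geomTorsion W ((2 ^ M : ℕ) : ℤ), (2 : ℤ) ^ (M - 1) • (P + h • P) ≠ 0)) ∧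
          s'.primeFactors.card + 1 = s.primeFactors.card ∧
          (s' * (e * f)).primeFactors.card = (s * e).primeFactors.card ∧
          Literature.NumberTheory.EllipticCurves.KolyvaginDescent.KolSupp (Literature.NumberTheory.EllipticCurves.Zhang2014.IsKolyvaginPrime (W.conductorNorm ℤ) W K 2) (s' * (e * f)) ∧
          (((M + 1 : ℕ) : ℕ) : ℕ∞) ≤ Literature.NumberTheory.EllipticCurves.Zhang2014.levelIndex W 2 (s' * (e * f)) ∧
          OppShape W K ι τ M (e * f) u (max (gC (a + CE)) (gR a)) t' ∧
          conjAct W τ ((2 ^ M : ℕ) : ℤ) (d'.kolyvaginClass Nat.prime_two M) = u • d'.kolyvaginClass Nat.prime_two M ∧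
          ∃ dup : Literature.NumberTheory.EllipticCurves.KolyvaginHeegnerData Dt β ι (s' * (e * f) * q),
          Squarefree (s' * (e * f) * q) ∧ ¬ q ∣ s' * (e * f) ∧
          (∀ l' ∈ (s' * (e * f) * q).primeFactors, Literature.NumberTheory.EllipticCurves.Zhang2014.IsKolyvaginPrime (W.conductorNorm ℤ) W K 2 l' ∧ M ≤ Literature.NumberTheory.EllipticCurves.Zhang2014.kolyvaginIndex W 2 l') ∧
          (∀ l' ∈ (s' * (e * f)).primeFactors, ∀ (x : Literature.NumberTheory.EllipticCurves.ringClassField K ι (s' * (e * f))) (x' : Literature.NumberTheory.EllipticCurves.ringClassField K ι (s' * (e * f) * q)), (x : ℂ) = x' → ((dup.σ l' x' : Literature.NumberTheory.EllipticCurves.ringClassField K ι (s' * (e * f) * q)) : ℂ) = (d'.σ l' x : ℂ)) ∧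
          (∀ t ∈ d'.S, ∃ t' ∈ dup.S, ∀ (x : Literature.NumberTheory.EllipticCurves.ringClassField K ι (s' * (e * f))) (x' : Literature.NumberTheory.EllipticCurves.ringClassField K ι (s' * (e * f) * q)), (x : ℂ) = x' → ((t' x' : Literature.NumberTheory.EllipticCurves.ringClassField K ι (s' * (e * f) * q)) : ℂ) = (t x : ℂ)) ∧
          (∀ t' ∈ dup.S, ∃ t ∈ d'.S, ∀ (x : Literature.NumberTheory.EllipticCurves.ringClassField K ι (s' * (e * f))) (x' : Literature.NumberTheory.EllipticCurves.ringClassField K ι (s' * (e * f) * q)), (x : ℂ) = x' → ((t' x' : Literature.NumberTheory.EllipticCurves.ringClassField K ι (s' * (e * f) * q)) : ℂ) = (t x : ℂ)) ∧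
          (∀ (x : Literature.NumberTheory.EllipticCurves.ringClassField K ι (s' * (e * f))) (x' : Literature.NumberTheory.EllipticCurves.ringClassField K ι (s' * (e * f) * q)), (x : ℂ) = x' → dup.emb x' = d'.emb x) ∧
          ∃ w : IsDedekindDomain.HeightOneSpectrum (NumberField.RingOfIntegers K), (q : NumberField.RingOfIntegers K) ∈ w.asIdeal ∧
            ((2 ^ v : ℕ) : ℤ) • dup.kolyvaginClass Nat.prime_two M ∉ WeierstrassCurve.selmerLocalKer (W.baseChange K) (w.adicCompletion K) ((2 ^ M : ℕ) : ℤ) := by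
    intro m₁ t' aE bO ℓ z w hm₁ hzmem hzsign hKolℓ hlt hIℓ hreg hw hzloc hcloc hroom hshape'
    obtain ⟨hℓprime, hℓe, hKoleℓ, hidxeℓ⟩ := prep ℓ hKolℓ hlt hIℓ
    have hℓn : ¬ ℓ ∣ s * e := fun h ↦ absurd (Nat.le_of_dvd (Nat.pos_of_ne_zero hn0) h) (by omega)
    have hℓS : ℓ ∉ (s * e).primeFactors := fun h ↦ hℓn (Nat.dvd_of_mem_primeFactors h)
    have hIℓM : M + 1 ≤ Literature.NumberTheory.EllipticCurves.Zhang2014.kolyvaginIndex W 2 ℓ := le_trans hMI hIℓ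
    have hmdvd : m₁ * e ∣ s * e := Nat.mul_dvd_mul_right hm₁ e
    obtain ⟨hσ, hS, hS', hemb⟩ := hdℓ ℓ hKolℓ hℓS
    -- OSR
    obtain ⟨q', hq'mem, w₂, hw₂, hnotSel⟩ := hOSR M (m₁ * e) (s * e) ℓ aE bO v d z hKol hM hidx hmdvd hzmem hzsign hcsign hKolℓ hℓn hIℓM
      w hw hzloc hcloc hroom (dℓ ℓ hKolℓ hℓS) hσ hS hS' hemb
    -- `q'` is a SEED prime
    have hdiv : s * e / (m₁ * e) = s / m₁ := by
      obtain ⟨k, rfl⟩ := hm₁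
      have hm₁0 : 0 < m₁ := Nat.pos_of_ne_zero (left_ne_zero_of_mul hs0)
      rw [show m₁ * k * e = m₁ * e * k by ring, Nat.mul_div_cancel_left k (Nat.mul_pos hm₁0 (Nat.pos_of_ne_zero he0)),
        Nat.mul_div_cancel_left k hm₁0]
    rw [hdiv] at hq'mem
    have hq's : q' ∈ s.primeFactors := Nat.primeFactors_mono (Nat.div_dvd_of_dvd hm₁) hs0 hq'mem
    have hq' : q'.Prime := Nat.prime_of_mem_primeFactors hq's
    have hq'dvd : q' ∣ s := Nat.dvd_of_mem_primeFactors hq's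
    obtain ⟨s', hsq⟩ : ∃ s' : ℕ, s = q' * s' := ⟨s / q', (Nat.mul_div_cancel' hq'dvd).symm⟩
    have hs'0 : s' ≠ 0 := fun h ↦ hs0 (by rw [hsq, h, mul_zero])
    have hq's' : ¬ q' ∣ s' := fun h ↦ hq'.ne_one (Nat.isUnit_iff.mp (hsqs q' (by rw [hsq]; exact Nat.mul_dvd_mul_left q' h)))
    have hN : s * e * ℓ = s' * (e * ℓ) * q' := by rw [hsq]; ring
    have hdvdN : s' * (e * ℓ) ∣ s * e * ℓ := ⟨q', hN⟩
    have hKolN : Literature.NumberTheory.EllipticCurves.KolyvaginDescent.KolSupp (Literature.NumberTheory.EllipticCurves.Zhang2014.IsKolyvaginPrime (W.conductorNorm ℤ) W K 2) (s * e * ℓ) := kolSupp_mul_of_prime hKol hℓprime hKolℓ hℓn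
    have hKol' : Literature.NumberTheory.EllipticCurves.KolyvaginDescent.KolSupp (Literature.NumberTheory.EllipticCurves.Zhang2014.IsKolyvaginPrime (W.conductorNorm ℤ) W K 2) (s' * (e * ℓ)) := kolSupp_of_dvd hKolN hdvdN
    have hidxN : (((M + 1 : ℕ) : ℕ) : ℕ∞) ≤ Literature.NumberTheory.EllipticCurves.Zhang2014.levelIndex W 2 (s * e * ℓ) :=
      levelIndex_mul_of_prime hn0 hℓprime hidx hIℓM
    have hidx' : (((M + 1 : ℕ) : ℕ) : ℕ∞) ≤ Literature.NumberTheory.EllipticCurves.Zhang2014.levelIndex W 2 (s' * (e * ℓ)) :=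
      levelIndex_of_dvd hKolN.1.ne_zero hdvdN hidxN
    -- JET DOWN: the datum at `s'(eℓ)` compatible with the UP datum at `seℓ`
    obtain ⟨d', hσ', hT', hT'', hemb'⟩ :=
      Summit.BirchSwinnertonDyer.Rank1Residual.JET.exists_compatible_datum_of_dvd_of_grossCM hK hD hH 2 Dt β ι hKolN.1
        (fun l hl ↦ hKolN.2 l hl) hdvdN (dℓ ℓ hKolℓ hℓS)
    -- cardinalities
    have hse'0 : s' * e ≠ 0 := mul_ne_zero hs'0 he0
    have hℓse' : ¬ ℓ ∣ s' * e := fun h ↦ hℓn (dvd_trans h ⟨q', by rw [hsq]; ring⟩)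
    have hq'se' : ¬ q' ∣ s' * e := fun h ↦ hq'.ne_one (Nat.isUnit_iff.mp (hKol.1 q' (by
      rw [show s * e = q' * (s' * e) by rw [hsq, mul_assoc]]
      exact Nat.mul_dvd_mul_left q' h)))
    have hcard' : s'.primeFactors.card + 1 = s.primeFactors.card := by
      rw [hsq, mul_comm, KolyvaginAtTwo.RegularWalk.card_primeFactors_mul_of_not_dvd hs'0 hq' hq's']
    have hcardn : (s' * (e * ℓ)).primeFactors.card = (s * e).primeFactors.card := by
      rw [show s' * (e * ℓ) = s' * e * ℓ by ring, KolyvaginAtTwo.RegularWalk.card_primeFactors_mul_of_not_dvd hse'0 hℓprime hℓse',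
        show s * e = s' * e * q' by rw [hsq]; ring, KolyvaginAtTwo.RegularWalk.card_primeFactors_mul_of_not_dvd hse'0 hq' hq'se']
    -- the engine clause at `eℓ`
    have hdeepf : ∀ p ∈ (e * ℓ).primeFactors, I ≤ Literature.NumberTheory.EllipticCurves.Zhang2014.kolyvaginIndex W 2 p ∧ (∃ (pl : HeightOneSpectrum (𝓞 ℚ)) (𝔓 : Ideal (absIntegers (𝓞 ℚ) ℚ)) (h : absoluteGaloisGroup ℚ), (p : 𝓞 ℚ) ∈ pl.asIdeal ∧ 𝔓 ∈ pl.primesAbove ∧ IsArithFrobAt (𝓞 ℚ) h 𝔓 ∧ (∀ X : geomTorsion W ((2 ^ M : ℕ) : ℤ), h • h • X = X) ∧ ∃ P : geomTorsion W ((2 ^ M : ℕ) : ℤ), (2 : ℤ) ^ (M - 1) • (P + h • P) ≠ 0) := by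
      intro p hp
      rw [Nat.primeFactors_mul he0 hℓprime.ne_zero, hℓprime.primeFactors, Finset.mem_union, Finset.mem_singleton] at hp
      rcases hp with hp | rfl
      · exact heng p hp
      · exact ⟨hIℓ, hreg⟩
    -- the sign of `c_M(s'(eℓ))`
    have hnK' : ∀ q ∈ (s' * (e * ℓ)).primeFactors, Literature.NumberTheory.EllipticCurves.Zhang2014.IsKolyvaginPrime (W.conductorNorm ℤ) W K 2 q ∧
        M ≤ Literature.NumberTheory.EllipticCurves.Zhang2014.kolyvaginIndex W 2 q :=
      fun q hq ↦ ⟨hKol'.2 q hq, le_trans (Nat.le_succ M) (Zhang2014.natCast_le_levelIndex_iff.mp hidx' q hq)⟩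
    obtain ⟨-, hc'⟩ := GenusExact.KolyvaginClassSign.sign_conjAct_kolyvaginClass_two hK hd3 hD4 hodd hH h21 τ hτ1 Dt β ι hKol'.1 hM hnK' d'
    rw [hcardn, hwgen, ← huw] at hc'
    -- all factors of `seℓ` are Kolyvagin with margin
    have hallN : ∀ l' ∈ (s * e * ℓ).primeFactors, Literature.NumberTheory.EllipticCurves.Zhang2014.IsKolyvaginPrime (W.conductorNorm ℤ) W K 2 l' ∧
        M ≤ Literature.NumberTheory.EllipticCurves.Zhang2014.kolyvaginIndex W 2 l' :=
      fun q hq ↦ ⟨hKolN.2 q hq, le_trans (Nat.le_succ M) (Zhang2014.natCast_le_levelIndex_iff.mp hidxN q hq)⟩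
    have hq'N : ¬ q' ∣ s' * (e * ℓ) := fun h ↦ hq'.ne_one (Nat.isUnit_iff.mp (hKolN.1 q' (by
      rw [hN]
      exact Nat.mul_dvd_mul_right h q')))
    refine ⟨q', s', ℓ, t', d', hsq, hq', hdeepf, hcard', hcardn, hKol', hidx', hshape', hc', ?_⟩
    -- the UP datum transported to the literal conductor `s' * (e * ℓ) * q'`
    generalize hX : s' * (e * ℓ) * q' = X
    have hXN : X = s * e * ℓ := by rw [← hX, hN]
    subst hXN
    exact ⟨dℓ ℓ hKolℓ hℓS, hKolN.1, hq'N, hallN, hσ', hT', hT'', hemb', w₂, hw₂, hnotSel⟩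
  -- (S) THE TWO CASES OF THE SHAPE
  obtain ⟨g, hgmem, hgsign, hgfree, hgspan⟩ := id hshape
  cases t with
  | succ t =>
    -- CUT `g 0`: ES's span hypothesis from near-freeness at error `a`
    have hspanES : ∀ bv : Fin t → ℤ, ¬ ∀ σ ∈ torsionFixing (W.baseChange K) ((2 ^ (M + 1) : ℕ) : ℤ),
        h1Eval (W.baseChange K) ((2 ^ M : ℕ) : ℤ) (((2 ^ (M - (a + CE) - 1 + CE) : ℕ) : ℤ) • g 0 - ∑ i, bv i • g i.succ) σ = 0 := by
      intro bv hall
      have hsum : ∑ i : Fin (t + 1), (Fin.cons (((2 ^ (M - (a + CE) - 1 + CE) : ℕ) : ℤ)) (fun i ↦ -bv i) : Fin (t + 1) → ℤ) i • g i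
          = (((2 ^ (M - (a + CE) - 1 + CE) : ℕ) : ℤ)) • g 0 - ∑ i : Fin t, bv i • g i.succ := by
        rw [Fin.sum_univ_succ, Fin.cons_zero, sub_eq_add_neg, ← Finset.sum_neg_distrib]
        congr 1
        refine Finset.sum_congr rfl fun i _ ↦ ?_
        rw [Fin.cons_succ, neg_zsmul]
      have key := hgfree (Fin.cons (((2 ^ (M - (a + CE) - 1 + CE) : ℕ) : ℤ)) (fun i ↦ -bv i)) (fun σ hσ ↦ by rw [hsum]; exact hall σ hσ) 0
      rw [Fin.cons_zero] at key
      have key' : 2 ^ (M - a) ∣ 2 ^ (M - (a + CE) - 1 + CE) := by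
        have h2 : ((2 : ℤ) ^ (M - a)) = ((2 ^ (M - a) : ℕ) : ℤ) := by push_cast; rfl
        rw [h2] at key
        exact Int.natCast_dvd_natCast.mp key
      have := (Nat.pow_dvd_pow_iff_le_right (by norm_num : 1 < 2)).mp key'
      omega
    have hvisE : ∃ ρ ∈ torsionFixing (W.baseChange K) ((2 ^ M : ℕ) : ℤ),
        ((2 ^ ((v + CO + a + CE + 1) + CE) : ℕ) : ℤ) • h1Eval (W.baseChange K) ((2 ^ M : ℕ) : ℤ) (d.kolyvaginClass Nat.prime_two M) ρ ≠ 0 :=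
      ⟨ρ, hρ, vis_mono (by omega) hvisρ⟩
    obtain ⟨ℓ, hlt, hKolℓ, ⟨hIℓ, hreg⟩, w, hw, hyloc, hzloc, hcloc⟩ :=
      hES M I (s * e) t (M - (a + CE) - 1) (v + CO + a + CE + 1) (fun i ↦ g i.succ) (g 0) (d.kolyvaginClass Nat.prime_two M)
        hM hMI (fun i ↦ hgsign i.succ) (hgsign 0) hcsign hspanES hvisE
    obtain ⟨hℓprime, hℓe, hKoleℓ, hidxeℓ⟩ := prep ℓ hKolℓ hlt hIℓ
    -- SC at error `a + C_E`
    have shape' : OppShape W K ι τ M (e * ℓ) u (gC (a + CE)) t :=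
      hCut M e ℓ (a + CE) t g hKoleℓ hℓprime hℓe hM hidxeℓ hgmem hgsign (free_mono (Nat.le_add_right a CE) hgfree)
        (span_mono (Nat.le_add_right a CE) hgspan) ⟨w, hw, hyloc, hzloc⟩
    exact tail 1 t (M - (a + CE) - 1) (v + CO + a + CE + 1) ℓ (g 0) w (one_dvd s) (by rw [one_mul]; exact hgmem 0) (hgsign 0)
      hKolℓ hlt hIℓ hreg hw hzloc hcloc (by omega) (oppShape_mono (le_max_left _ _) shape')
  | zero =>
    -- REFILL: the corner gives a second seed prime `q₀`; SRS supplies the partner in `H_(𝓕(q₀e))`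
    have h2s : 2 ≤ s.primeFactors.card := by
      rcases hcorner with h | h
      · omega
      · exact h
    obtain ⟨q₀, hq₀⟩ : s.primeFactors.Nonempty := Finset.card_pos.mp (by omega)
    have hq₀p : q₀.Prime := Nat.prime_of_mem_primeFactors hq₀
    have hq₀s : q₀ ∣ s := Nat.dvd_of_mem_primeFactors hq₀
    have hq₀e : ¬ q₀ ∣ e := fun h ↦ hq₀p.ne_one (Nat.isUnit_iff.mp (hKol.1 q₀ (mul_dvd_mul hq₀s h)))
    have hKolq : Literature.NumberTheory.EllipticCurves.KolyvaginDescent.KolSupp (Literature.NumberTheory.EllipticCurves.Zhang2014.IsKolyvaginPrime (W.conductorNorm ℤ) W K 2) (q₀ * e) := kolSupp_of_dvd hKol (Nat.mul_dvd_mul_right hq₀s e)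
    have hidxq : (((M + 1 : ℕ) : ℕ) : ℕ∞) ≤ Literature.NumberTheory.EllipticCurves.Zhang2014.levelIndex W 2 (q₀ * e) :=
      levelIndex_of_dvd hn0 (Nat.mul_dvd_mul_right hq₀s e) hidx
    obtain ⟨z, hzmem, hzsign, hzne⟩ := hSRS a M q₀ e hKolq hq₀p hq₀e hM hidxq hshape (by omega)
    have hvisE : ∃ ρ ∈ torsionFixing (W.baseChange K) ((2 ^ M : ℕ) : ℤ),
        ((2 ^ ((v + CO + a + CR + CE + 2) + CE) : ℕ) : ℤ) • h1Eval (W.baseChange K) ((2 ^ M : ℕ) : ℤ) (d.kolyvaginClass Nat.prime_two M) ρ ≠ 0 :=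
      ⟨ρ, hρ, vis_mono (by omega) hvisρ⟩
    have hES0 := hES M I (s * e) 0 (M - (a + CR + CE + 1) - 1) (v + CO + a + CR + CE + 2) (fun i ↦ Fin.elim0 i) z (d.kolyvaginClass Nat.prime_two M)
      hM hMI (fun i ↦ Fin.elim0 i) hzsign hcsign
    obtain ⟨ℓ, hlt, hKolℓ, ⟨hIℓ, hreg⟩, w, hw, -, hzloc, hcloc⟩ := hES0 (by
      intro bv hall
      apply hzne
      have hres : ∀ σ ∈ torsionFixing (W.baseChange K) ((2 ^ (M + 1) : ℕ) : ℤ),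
          h1Eval (W.baseChange K) ((2 ^ M : ℕ) : ℤ) ((((2 ^ (M - (a + CR + CE + 1) - 1 + CE) : ℕ) : ℤ)) • z) σ = 0 := by
        intro σ hσ
        have h := hall σ hσ
        rwa [Fin.sum_univ_zero, sub_zero] at h
      have h2z := KolyvaginAtTwo.RegularWalk.two_zsmul_eq_zero_of_res_eq_zero W hK (hsurj (M + 1)) hres
      have hpow : ((2 ^ (M - (a + CR + CE + 1) - 1 + CE + 1) : ℕ) : ℤ) • z = 0 := by
        rw [show ((2 ^ (M - (a + CR + CE + 1) - 1 + CE + 1) : ℕ) : ℤ) = 2 * ((2 ^ (M - (a + CR + CE + 1) - 1 + CE) : ℕ) : ℤ) by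
          push_cast; ring, mul_zsmul]
        exact h2z
      exact KolyvaginLowerBoundAtTwo.two_pow_zsmul_eq_zero_of_le_swap (by omega) hpow) hvisE
    obtain ⟨hℓprime, hℓe, hKoleℓ, hidxeℓ⟩ := prep ℓ hKolℓ hlt hIℓ
    -- SRF
    have shape' : OppShape W K ι τ M (e * ℓ) u (gR a) 1 := hRef M e ℓ a hKoleℓ hℓprime hℓe hM hidxeℓ hshape
    exact tail q₀ 1 (M - (a + CR + CE + 1) - 1) (v + CO + a + CR + CE + 2) ℓ z w hq₀s hzmem hzsign
      hKolℓ hlt hIℓ hreg hw hzloc hcloc (by omega) (oppShape_mono (le_max_right _ _) shape')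

/-- S0ʳ (INPUT stub, statement unchanged since v7). -/
theorem stub_roomSeedAtTwo : KolyvaginRoomSeedAtTwo := by
  sorry

/-- KERNEL (v8.2, tree-fed): LD · LEVEL DROP HOLDS — TREE theorem `KolyvaginAtTwo.RegularWalk.levelDropAtTwo` (p727017, the pen's landable
file landed by krr2-p2 g18), whose statement is this file's `LevelDropAtTwo` verbatim.  Unconditional. -/
theorem levelDropAtTwo_holds : LevelDropAtTwo :=
  Summit.BirchSwinnertonDyer.BirchSwinnertonDyer.Theorems.KolyvaginAtTwo.RegularWalk.levelDropAtTwo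

/-- KERNEL (v8.2, tree-fed): START⁗ · THE START SHAPE HOLDS — TREE theorem `KolyvaginAtTwo.RegularWalk.startShapeAtTwo` (p725345, krr2-p2 g18's
independent proof, `a₀ = J + 1 + d`), whose statement is this file's `StartShapeAtTwo` with `OppShape … 1 u a₀ t` unfolded.  Unconditional. -/
theorem startShapeAtTwo_holds : StartShapeAtTwo :=
  Summit.BirchSwinnertonDyer.BirchSwinnertonDyer.Theorems.KolyvaginAtTwo.RegularWalk.startShapeAtTwo

/-! ## §ES (v8.6) ES IS A THEOREM — the pen's two landable Theorems files inlined VERBATIM until they land (p735554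
`KolyvaginRankRigidityAtTwoDeepEngineAdapter` = `ESInline.RegularValueEngine.*`, then `KolyvaginRankRigidityAtTwoEngineSupplyAtTwo` =
`ESInline.RegularWalk.*`; both farm-checked rc 0, 0 sorry, axioms standard): DL + homothety `9` + deep sign transfer + DA (tree adapter at
level `I − 1` on inflated classes) ⟹ ES (`C = 4`).  v8.7 replaces this section by the tree name.
[cite: GrossLMS1991, §9] [cite: MazurRubin2004, §4.1, Prop. 4.1.5] [cite: McCallumLMS1991, §3 Prop. 3.1] -/
section ESInline

open Function Finset
open Literature.NumberTheory.EllipticCurves.KolyvaginPairing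

namespace ESInline.RegularValueEngine

/-! ### §1 DL — deep homothety loss -/

/-- **DEEP HOMOTHETY LOSS.**  If `σ ∈ Γ_L` acts on `V[d]` as the scalar `λ` and `x ∈ H¹(L, V[n])`, `n ∣ d`, restricts to
zero on `Γ_{L(V[d])}`, then `(λ − 1)·x` restricts to zero on `Γ_{L(V[n])}`: for `ρ ∈ Γ_{L(V[n])}` the commutator
`σρσ⁻¹ρ⁻¹` lies in `Γ_{L(V[d])}` and `[x, σρσ⁻¹ρ⁻¹] = σ[x,ρ] − [x,ρ] = (λ−1)[x,ρ]`. [cite: GrossLMS1991, §9 (pairing after Prop. 9.1)] -/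
theorem h1Eval_smul_eq_zero_of_deep {L : Type} [Field L] (V : WeierstrassCurve L) {n d : ℤ} (hnd : n ∣ d)
    {σ : absoluteGaloisGroup L} {lam : ℤ} (hσ : ∀ P : geomTorsion V d, σ • P = lam • P)
    (x : galH1Torsion V n) (hx : ∀ ρ ∈ torsionFixing V d, h1Eval V n x ρ = 0) :
    ∀ ρ ∈ torsionFixing V n, h1Eval V n ((lam - 1) • x) ρ = 0 := by
  intro ρ hρ
  -- the commutator fixes `V[d]`
  have hcomm : σ * ρ * σ⁻¹ * ρ⁻¹ ∈ torsionFixing V d := by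
    rw [mem_torsionFixing_iff]
    intro P
    have hc : ∀ Q : geomTorsion V d, ρ • (lam • Q) = lam • (ρ • Q) := fun Q ↦
      map_zsmul (DistribSMul.toAddMonoidHom (geomTorsion V d) ρ) lam Q
    rw [mul_smul, mul_smul, mul_smul, hσ, ← hc, ← hσ, smul_inv_smul, smul_inv_smul]
  -- `σ` acts as `lam` on `V[n] ⊆ V[d]`
  have hσn : ∀ Q : geomTorsion V n, σ • Q = lam • Q := fun Q ↦ by
    have h := hσ (AddSubgroup.inclusion (V.geomTorsion_le_of_dvd hnd) Q)
    apply Subtype.ext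
    exact congrArg (fun X : geomTorsion V d ↦ (X : geomPoints V)) h
  have hconj : σ * ρ * σ⁻¹ ∈ torsionFixing V n := (torsionFixing_normal V n).conj_mem ρ hρ σ
  have h0 := hx _ hcomm
  rw [h1Eval_mul V n x hconj, h1Eval_inv V n x hρ, h1Eval_conj V n x σ hρ, hσn] at h0
  rw [h1Eval_zsmul V n _ x hρ, sub_eq_add_neg, add_zsmul, neg_zsmul, one_zsmul]
  exact h0

/-- **A homothety `9 = 3²` on `E[2^I]` inside `Γ_K`** (`[K:ℚ] = 2`, `ρ̄_{E,2^I}` onto): `P ↦ 3P` is an automorphism of the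
finite group `E[2^I]` (`gcd(3, 2^I) = 1`), and every square of `Aut E[2^I]` is realised by `Γ_K`
(`RatClosure.exists_smul_eq_of_sq`). [cite: GrossLMS1991, §9 (before Prop. 9.1)] -/
theorem exists_smul_eq_nine (W : WeierstrassCurve ℚ) [W.IsElliptic] (K : Type) [Field K] [NumberField K]
    (hK2 : Module.finrank ℚ K = 2) (I : ℕ) (hsurjI : W.HasSurjectiveModNGaloisRep ((2 ^ I : ℕ) : ℤ)) :
    ∃ σ : absoluteGaloisGroup K, ∀ P : geomTorsion (W.baseChange K) ((2 ^ I : ℕ) : ℤ), σ • P = (9 : ℤ) • P := by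
  haveI : NeZero (2 ^ I) := ⟨pow_ne_zero I two_ne_zero⟩
  haveI hEK : (W.baseChange K).IsElliptic := by unfold WeierstrassCurve.baseChange; infer_instance
  haveI : Finite (geomTorsion (W.baseChange K) ((2 ^ I : ℕ) : ℤ)) :=
    finite_geomTorsion_of_neZero (W.baseChange K) (2 ^ I)
  let f : geomTorsion (W.baseChange K) ((2 ^ I : ℕ) : ℤ) →+ geomTorsion (W.baseChange K) ((2 ^ I : ℕ) : ℤ) :=
    DistribSMul.toAddMonoidHom _ (3 : ℤ)
  have hf : ∀ P, f P = (3 : ℤ) • P := fun P ↦ rfl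
  have hkill : ∀ R : geomTorsion (W.baseChange K) ((2 ^ I : ℕ) : ℤ), ((2 ^ I : ℕ) : ℤ) • R = 0 := fun R ↦
    Subtype.ext (by exact_mod_cast (mem_geomTorsion_iff (W.baseChange K) _ _).mp R.2)
  have hinj : Function.Injective f := by
    intro P Q hPQ
    rw [hf, hf] at hPQ
    rw [← sub_eq_zero] at hPQ ⊢
    rw [← smul_sub] at hPQ
    set D := P - Q
    have h3 : addOrderOf D ∣ 3 := by exact_mod_cast (addOrderOf_dvd_iff_zsmul_eq_zero.mpr hPQ)
    have h2 : addOrderOf D ∣ 2 ^ I := by exact_mod_cast (addOrderOf_dvd_iff_zsmul_eq_zero.mpr (hkill D))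
    have hcop : Nat.gcd 3 (2 ^ I) = 1 := (Nat.Coprime.pow_right I (by norm_num : Nat.Coprime 3 2))
    have h1 : addOrderOf D ∣ 1 := hcop ▸ Nat.dvd_gcd h3 h2
    exact AddMonoid.addOrderOf_eq_one_iff.mp (Nat.dvd_one.mp h1)
  have hbij : Function.Bijective f := ⟨hinj, Finite.injective_iff_surjective.mp hinj⟩
  obtain ⟨g, hg⟩ := RatClosure.exists_smul_eq_of_sq (K := K) W hK2 hsurjI (AddEquiv.ofBijective f hbij)
  refine ⟨g, fun P ↦ ?_⟩
  rw [hg, AddEquiv.ofBijective_apply, AddEquiv.ofBijective_apply, hf, hf, smul_smul]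
  norm_num

/-! ### §2 Deep sign transfer -/

section SignTransfer

variable {K : Type} [Field K] [NumberField K] (W : WeierstrassCurve ℚ)

/-- `τ_*` preserves "same restriction to `Γ_{K(E[d])}`" for classes of level `n ∣ d` (an involutive lift of `τ` conjugates
`Γ_{K(E[d])}` into itself; `[τ_* x, ρ] = τ̃ [x, τ̃ρτ̃]`).  The adapter's `forall_h1Eval_conjAct_eq` is `d = 2n`.
[cite: GrossLMS1991, §9] -/
theorem forall_h1Eval_conjAct_eq_of_dvd (hK : IsImaginaryQuadratic K) {τ : K ≃ₐ[ℚ] K} (hτ : τ ≠ 1) {n d : ℤ}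
    (hnd : n ∣ d) {x x' : galH1Torsion (W.baseChange K) n}
    (h : ∀ ρ ∈ torsionFixing (W.baseChange K) d,
      h1Eval (W.baseChange K) n x ρ = h1Eval (W.baseChange K) n x' ρ) :
    ∀ ρ ∈ torsionFixing (W.baseChange K) d,
      h1Eval (W.baseChange K) n (conjAct W τ n x) ρ = h1Eval (W.baseChange K) n (conjAct W τ n x') ρ := by
  obtain ⟨c₀, hc₀⟩ := exists_isComplexConjugation (Rat.castHom ℝ)
  have ht : IsLiftOfAut τ (absGaloisTransport (K := ℚ) (L := K) c₀).toRingEquiv :=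
    RatClosure.isLiftOfAut_absGaloisTransport_of_isImaginaryQuadratic hK hτ hc₀
  have hinv : ∀ z, (absGaloisTransport (K := ℚ) (L := K) c₀).toRingEquiv
      ((absGaloisTransport (K := ℚ) (L := K) c₀).toRingEquiv z) = z := fun z ↦
    RatClosure.absGaloisTransport_absGaloisTransport_of_sq_eq_one hc₀.sq_eq_one z
  have hle : torsionFixing (W.baseChange K) d ≤ torsionFixing (W.baseChange K) n :=
    KolyvaginLowerBoundAtTwo.torsionFixing_le_of_dvd _ hnd
  intro ρ hρ
  rw [ht.h1Eval_conjAct W _ x (hle hρ), ht.h1Eval_conjAct W _ x' (hle hρ),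
    h _ (ht.conjGalCMH_mem_torsionFixing W hinv _ hρ)]

end SignTransfer

/-! ### §3 DA — the deep engine adapter, from the tree adapter at level `I − 1` on inflated classes -/

/-- **DA · DEEP ENGINE ADAPTER AT 2.**  `exists_regular_kolyvaginPrime_killing` (p691126) VERBATIM except: `k + 1 ≤ kolyvaginIndex` ↦
`I ≤ kolyvaginIndex` for a given deep level `I ≥ k+1`; surjectivity of `ρ̄_{E,2^m}` for all `m` (U1's habitat); the two cut laws read on
`Γ_{K(E[2^I])}` instead of `Γ_{K(E[2^{k+1}])}`.  Proof: the tree adapter at level `k' := I − 1` on the `torsionH1OfDvd`-inflated classes,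
everything pulled back along `ι_*`; regularity descends with `P := 2^{k'−k} P'`.
[cite: MazurRubin2004, §4.1, Prop. 4.1.5] [cite: McCallumLMS1991, §3 Prop. 3.1, (3)] [cite: GrossLMS1991, §9] -/
theorem deepEngineAdapterAtTwo :
  ∀ (W : WeierstrassCurve ℚ) [W.IsElliptic] [W.IsGloballyMinimal] [NeZero (W.conductorNorm ℤ)]
    (K : Type) [Field K] [NumberField K], IsImaginaryQuadratic K → Odd (NumberField.discr K) →
    SatisfiesHeegnerHypothesis (W.conductorNorm ℤ) K → ∀ {k I : ℕ}, 1 ≤ k → k + 1 ≤ I →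
    (∀ m : ℕ, W.HasSurjectiveModNGaloisRep (2 ^ m : ℕ)) →
    ∀ {τ : K ≃ₐ[ℚ] K}, τ ≠ 1 →
    ∀ (S : AddSubgroup (galH1Torsion (W.baseChange K) ((2 ^ k : ℕ) : ℤ))) [Finite S],
    (∀ x ∈ S, conjAct W τ ((2 ^ k : ℕ) : ℤ) x ∈ S) →
    ∀ {m : ℕ} (y : Fin m → galH1Torsion (W.baseChange K) ((2 ^ k : ℕ) : ℤ)), (∀ i, y i ∈ S) →
    ∀ (sy : Fin m → ℤ), (∀ i, conjAct W τ ((2 ^ k : ℕ) : ℤ) (y i) = sy i • y i) →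
    ∀ {p q : galH1Torsion (W.baseChange K) ((2 ^ k : ℕ) : ℤ)}, p ∈ S → q ∈ S → ∀ {sp sq : ℤ},
    conjAct W τ ((2 ^ k : ℕ) : ℤ) p = sp • p → conjAct W τ ((2 ^ k : ℕ) : ℤ) q = sq • q → ∀ (bnd : ℕ),
    ∃ ℓ : ℕ, bnd < ℓ ∧ Zhang2014.IsKolyvaginPrime (W.conductorNorm ℤ) W K 2 ℓ ∧
      I ≤ Zhang2014.kolyvaginIndex W 2 ℓ ∧
      (∃ (pl : HeightOneSpectrum (𝓞 ℚ)) (𝔓 : Ideal (absIntegers (𝓞 ℚ) ℚ)) (h : absoluteGaloisGroup ℚ),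
        (ℓ : 𝓞 ℚ) ∈ pl.asIdeal ∧ 𝔓 ∈ pl.primesAbove ∧ IsArithFrobAt (𝓞 ℚ) h 𝔓 ∧
        (∀ X : geomTorsion W ((2 ^ k : ℕ) : ℤ), h • h • X = X) ∧
        ∃ P : geomTorsion W ((2 ^ k : ℕ) : ℤ), (2 : ℤ) ^ (k - 1) • (P + h • P) ≠ 0) ∧
      ∀ v : HeightOneSpectrum (𝓞 K), (ℓ : 𝓞 K) ∈ v.asIdeal →
        (∀ i, galoisCohomology.localization ((W.baseChange K).torsionGaloisModule ((2 ^ k : ℕ) : ℤ))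
          (Sum.inr v : Place K) 1 (y i) = 0) ∧
        (∀ a : ℤ, a • galoisCohomology.localization ((W.baseChange K).torsionGaloisModule ((2 ^ k : ℕ) : ℤ))
            (Sum.inr v : Place K) 1 p = 0 ↔
          ∃ b : Fin m → ℤ, ∀ ρ ∈ torsionFixing (W.baseChange K) ((2 ^ I : ℕ) : ℤ),
            h1Eval (W.baseChange K) ((2 ^ k : ℕ) : ℤ) (a • p - ∑ i, b i • y i) ρ = 0) ∧
        (∀ a : ℤ, a • galoisCohomology.localization ((W.baseChange K).torsionGaloisModule ((2 ^ k : ℕ) : ℤ))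
            (Sum.inr v : Place K) 1 q = 0 ↔
          ∃ b : Fin m → ℤ, ∀ ρ ∈ torsionFixing (W.baseChange K) ((2 ^ I : ℕ) : ℤ),
            h1Eval (W.baseChange K) ((2 ^ k : ℕ) : ℤ) (a • q - ∑ i, b i • y i) ρ = 0) := by
  intro W _ _ _ K _ _ hK hodd hH k I hk hkI hsurj τ hτ S _ hSτ m y hy sy hyτ p q hp hq sp sq hpτ hqτ bnd
  classical
  haveI : Fact (Nat.Prime 2) := ⟨Nat.prime_two⟩
  haveI hEK : (W.baseChange K).IsElliptic := by unfold WeierstrassCurve.baseChange; infer_instance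
  obtain ⟨k', rfl⟩ : ∃ k', I = k' + 1 := ⟨I - 1, by omega⟩
  have hkk' : k ≤ k' := by omega
  have hk' : 1 ≤ k' := le_trans hk hkk'
  have hdvd : ((2 ^ k : ℕ) : ℤ) ∣ ((2 ^ k' : ℕ) : ℤ) := by exact_mod_cast pow_dvd_pow 2 hkk'
  have hle' : torsionFixing (W.baseChange K) ((2 ^ (k' + 1) : ℕ) : ℤ) ≤
      torsionFixing (W.baseChange K) ((2 ^ k' : ℕ) : ℤ) :=
    KolyvaginLowerBoundAtTwo.torsionFixing_le_of_dvd _ (by exact_mod_cast pow_dvd_pow 2 (Nat.le_succ k'))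
  -- ### the inflation `ι_* : H¹(K, E[2^k]) → H¹(K, E[2^k'])`
  set ι : galH1Torsion (W.baseChange K) ((2 ^ k : ℕ) : ℤ) →+ galH1Torsion (W.baseChange K) ((2 ^ k' : ℕ) : ℤ) :=
    torsionH1OfDvd (W.baseChange K) hdvd with hιdef
  set incl : geomTorsion (W.baseChange K) ((2 ^ k : ℕ) : ℤ) →+ geomTorsion (W.baseChange K) ((2 ^ k' : ℕ) : ℤ) :=
    AddSubgroup.inclusion ((W.baseChange K).geomTorsion_le_of_dvd hdvd) with hincl
  have hincl_inj : Function.Injective incl := AddSubgroup.inclusion_injective _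
  have hιeval : ∀ (x : galH1Torsion (W.baseChange K) ((2 ^ k : ℕ) : ℤ)),
      ∀ ρ ∈ torsionFixing (W.baseChange K) ((2 ^ k' : ℕ) : ℤ),
      h1Eval (W.baseChange K) ((2 ^ k' : ℕ) : ℤ) (ι x) ρ =
        incl (h1Eval (W.baseChange K) ((2 ^ k : ℕ) : ℤ) x ρ) := fun x ρ hρ ↦
    KolyvaginAtTwo.RegularValueEngine.h1Eval_torsionH1OfDvd (W.baseChange K) hdvd x hρ
  have hιτ : ∀ x, conjAct W τ ((2 ^ k' : ℕ) : ℤ) (ι x) = ι (conjAct W τ ((2 ^ k : ℕ) : ℤ) x) := fun x ↦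
    conjAct_torsionH1OfDvd W τ hdvd x
  -- ### the inflated span and data
  set S' : AddSubgroup (galH1Torsion (W.baseChange K) ((2 ^ k' : ℕ) : ℤ)) := S.map ι with hS'
  haveI : Finite S' := by
    refine Finite.of_surjective (fun s : S ↦ (⟨ι s, AddSubgroup.mem_map_of_mem ι s.2⟩ : S')) ?_
    rintro ⟨x, hx⟩
    obtain ⟨s, hs, rfl⟩ := AddSubgroup.mem_map.mp hx
    exact ⟨⟨s, hs⟩, rfl⟩
  have hS'τ : ∀ x ∈ S', conjAct W τ ((2 ^ k' : ℕ) : ℤ) x ∈ S' := by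
    intro x hx
    obtain ⟨s, hs, rfl⟩ := AddSubgroup.mem_map.mp hx
    rw [hιτ]
    exact AddSubgroup.mem_map_of_mem ι (hSτ s hs)
  have hy' : ∀ i, ι (y i) ∈ S' := fun i ↦ AddSubgroup.mem_map_of_mem ι (hy i)
  have hyτ' : ∀ i, conjAct W τ ((2 ^ k' : ℕ) : ℤ) (ι (y i)) = sy i • ι (y i) := fun i ↦ by
    rw [hιτ, hyτ, map_zsmul]
  have hpτ' : conjAct W τ ((2 ^ k' : ℕ) : ℤ) (ι p) = sp • ι p := by rw [hιτ, hpτ, map_zsmul]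
  have hqτ' : conjAct W τ ((2 ^ k' : ℕ) : ℤ) (ι q) = sq • ι q := by rw [hιτ, hqτ, map_zsmul]
  have hρ2 : W.HasSurjectiveModNGaloisRep 2 := by simpa using hsurj 1
  -- ### the tree's adapter at level `k'`
  obtain ⟨ℓ, hbnd, hKol, hidx, hreg, hloc⟩ :=
    KolyvaginAtTwo.RegularValueEngine.exists_regular_kolyvaginPrime_killing W hK hodd hH hk' hρ2 (hsurj (k' + 1)) hτ
      S' hS'τ (fun i ↦ ι (y i)) hy' sy hyτ' (AddSubgroup.mem_map_of_mem ι hp) (AddSubgroup.mem_map_of_mem ι hq)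
      hpτ' hqτ' bnd
  refine ⟨ℓ, hbnd, hKol, hidx, ?_, ?_⟩
  · -- ### regularity descends from level `2^k'` to level `2^k` (tree pattern of `RegularValueEngineTwoLevel`, `P := 2^(k'-k) P'`)
    obtain ⟨pl, 𝔓, h, hpl, h𝔓, hfrob, hinv, P', hP'⟩ := hreg
    have hleQ := W.geomTorsion_le_of_dvd hdvd
    refine ⟨pl, 𝔓, h, hpl, h𝔓, hfrob, fun X ↦ ?_, ?_⟩
    · have h1 := hinv ⟨(X : geomPoints W), hleQ X.2⟩
      have h2 : h • h • (X : geomPoints W) = X := congrArg Subtype.val h1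
      exact Subtype.ext h2
    · have h2P : (2 : ℤ) ^ (k' - k) • (P' : geomPoints W) ∈ geomTorsion W ((2 ^ k : ℕ) : ℤ) := by
        rw [mem_geomTorsion_iff, smul_smul,
          show ((2 ^ k : ℕ) : ℤ) * 2 ^ (k' - k) = ((2 ^ k' : ℕ) : ℤ) by
            push_cast; rw [← pow_add, Nat.add_sub_cancel' hkk']]
        exact (mem_geomTorsion_iff W _ _).mp P'.2
      refine ⟨⟨(2 : ℤ) ^ (k' - k) • (P' : geomPoints W), h2P⟩, fun h0 ↦ hP' ?_⟩
      obtain ⟨m, hm⟩ : ∃ m, k = m + 1 := ⟨k - 1, (Nat.sub_add_cancel hk).symm⟩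
      subst hm
      rw [Nat.add_sub_cancel] at h0
      have h1 : (2 : ℤ) ^ m • ((2 : ℤ) ^ (k' - (m + 1)) • (P' : geomPoints W) +
          h • ((2 : ℤ) ^ (k' - (m + 1)) • (P' : geomPoints W))) = 0 := by
        have h1' := congrArg Subtype.val h0
        simpa only [AddSubgroupClass.coe_zsmul, AddSubgroup.coe_add, AddSubgroup.torsionBy.coe_smul,
          ZeroMemClass.coe_zero] using h1'
      apply Subtype.ext
      rw [AddSubgroupClass.coe_zsmul, ZeroMemClass.coe_zero, AddSubgroup.coe_add, AddSubgroup.torsionBy.coe_smul,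
        show k' - 1 = m + (k' - (m + 1)) by omega, pow_add, mul_smul, smul_add,
        smul_comm ((2 : ℤ) ^ (k' - (m + 1))) h]
      exact h1
  · -- ### local statements pulled back along `ι_*`
    intro v hv
    haveI : CharZero (v.adicCompletion K) := charZero_of_injective_algebraMap (algebraMap K _).injective
    obtain ⟨hy0, hpcut, hqcut⟩ := hloc v hv
    have htriv : ∀ (g : absoluteGaloisGroup (v.adicCompletion K))
        (Q : geomTorsion (W.baseChange K) ((2 ^ k' : ℕ) : ℤ)), resGal (K := K) (v.adicCompletion K) g • Q = Q :=
      fun g Q ↦ by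
      rw [resGal_eq_absGaloisRestrict]
      exact Summit.BirchSwinnertonDyer.Rank1Residual.JET.GlobalDuality.galoisRep_toLocal_apply_eq_self W K hK hKol
        (Nat.le_of_succ_le hidx) v hv g Q
    have e1 : ∀ X : galH1Torsion (W.baseChange K) ((2 ^ k : ℕ) : ℤ),
        X ∈ (W.baseChange K).torsionLocalKer (v.adicCompletion K) ((2 ^ k : ℕ) : ℤ) ↔
          ι X ∈ (W.baseChange K).torsionLocalKer (v.adicCompletion K) ((2 ^ k' : ℕ) : ℤ) := fun X ↦
      mem_torsionLocalKer_iff_torsionH1OfDvd_mem (W.baseChange K) (v.adicCompletion K) (pow_dvd_pow 2 hkk')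
        (pow_ne_zero k two_ne_zero) (pow_ne_zero k' two_ne_zero) htriv X
    have hdict : ∀ X : galH1Torsion (W.baseChange K) ((2 ^ k : ℕ) : ℤ),
        galoisCohomology.localization ((W.baseChange K).torsionGaloisModule ((2 ^ k : ℕ) : ℤ))
            (Sum.inr v : Place K) 1 X = 0 ↔
          galoisCohomology.localization ((W.baseChange K).torsionGaloisModule ((2 ^ k' : ℕ) : ℤ))
            (Sum.inr v : Place K) 1 (ι X) = 0 := fun X ↦
      ((mem_torsionLocalKer_iff_res_eq_zero (W.baseChange K) (v.adicCompletion K) (k := 2 ^ k)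
          (pow_ne_zero k two_ne_zero) X).symm.trans
        ((e1 X).trans (mem_torsionLocalKer_iff_res_eq_zero (W.baseChange K) (v.adicCompletion K) (k := 2 ^ k')
          (pow_ne_zero k' two_ne_zero) (ι X))))
    have hdict' : ∀ (a : ℤ) (X : galH1Torsion (W.baseChange K) ((2 ^ k : ℕ) : ℤ)),
        a • galoisCohomology.localization ((W.baseChange K).torsionGaloisModule ((2 ^ k : ℕ) : ℤ))
            (Sum.inr v : Place K) 1 X = 0 ↔
          a • galoisCohomology.localization ((W.baseChange K).torsionGaloisModule ((2 ^ k' : ℕ) : ℤ))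
            (Sum.inr v : Place K) 1 (ι X) = 0 := fun a X ↦ by
      -- the two `zsmul` transports are stated first and proved by `map_zsmul` up to definitional unfolding (the `ℤ`-actions on
      -- `H¹` are not syntactically the `Module` path, so a direct `rw [← map_zsmul …]` does not find its pattern)
      have e1 : a • galoisCohomology.localization ((W.baseChange K).torsionGaloisModule ((2 ^ k : ℕ) : ℤ))
            (Sum.inr v : Place K) 1 X =
          galoisCohomology.localization ((W.baseChange K).torsionGaloisModule ((2 ^ k : ℕ) : ℤ))
            (Sum.inr v : Place K) 1 (a • X) :=
        (map_zsmul (galoisCohomology.localization ((W.baseChange K).torsionGaloisModule ((2 ^ k : ℕ) : ℤ))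
          (Sum.inr v : Place K) 1) a X).symm
      have e2 : a • galoisCohomology.localization ((W.baseChange K).torsionGaloisModule ((2 ^ k' : ℕ) : ℤ))
            (Sum.inr v : Place K) 1 (ι X) =
          galoisCohomology.localization ((W.baseChange K).torsionGaloisModule ((2 ^ k' : ℕ) : ℤ))
            (Sum.inr v : Place K) 1 (ι (a • X)) :=
        ((congrArg (galoisCohomology.localization ((W.baseChange K).torsionGaloisModule ((2 ^ k' : ℕ) : ℤ))
            (Sum.inr v : Place K) 1) (map_zsmul ι a X)).trans
          (map_zsmul (galoisCohomology.localization ((W.baseChange K).torsionGaloisModule ((2 ^ k' : ℕ) : ℤ))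
            (Sum.inr v : Place K) 1) a (ι X))).symm
      rw [e1, e2]
      exact hdict (a • X)
    have hpull : ∀ (a : ℤ) (X : galH1Torsion (W.baseChange K) ((2 ^ k : ℕ) : ℤ)) (b : Fin m → ℤ),
        ∀ ρ ∈ torsionFixing (W.baseChange K) ((2 ^ (k' + 1) : ℕ) : ℤ),
        (h1Eval (W.baseChange K) ((2 ^ k' : ℕ) : ℤ) (a • ι X - ∑ i, b i • ι (y i)) ρ = 0 ↔
          h1Eval (W.baseChange K) ((2 ^ k : ℕ) : ℤ) (a • X - ∑ i, b i • y i) ρ = 0) := by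
      intro a X b ρ hρ
      have hρk' : ρ ∈ torsionFixing (W.baseChange K) ((2 ^ k' : ℕ) : ℤ) := hle' hρ
      have hX : a • ι X - ∑ i, b i • ι (y i) = ι (a • X - ∑ i, b i • y i) := by
        simp only [map_sub, map_sum, map_zsmul]
      rw [hX, hιeval _ ρ hρk']
      exact ⟨fun h0 ↦ hincl_inj (by rw [h0, map_zero]), fun h0 ↦ by rw [h0, map_zero]⟩
    refine ⟨fun i ↦ (hdict (y i)).mpr (hy0 i), fun a ↦ ?_, fun a ↦ ?_⟩
    · refine (hdict' a p).trans ((hpcut a).trans (exists_congr fun b ↦ forall₂_congr fun ρ hρ ↦ ?_))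
      exact hpull a p b ρ hρ
    · refine (hdict' a q).trans ((hqcut a).trans (exists_congr fun b ↦ forall₂_congr fun ρ hρ ↦ ?_))
      exact hpull a q b ρ hρ

end ESInline.RegularValueEngine

namespace ESInline.RegularWalk

/-! ### ES from DA (loss constant `C = 4`) -/

section Plumbing

variable {V : Type*} [AddCommGroup V]

/-- The span of finitely many classes killed by `q ≠ 0` is finite (image of the finite set of coefficient vectors modulo `q`).
(Same statement as the GK2-side `GenusExact.finite_closure_range_of_zsmul_eq_zero`, copied so that this KRR file imports no
`GenusKolyvaginAtTwo` module.) [folklore] -/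
theorem finite_span_of_zsmul_eq_zero {m : ℕ} (gens : Fin m → V) {q : ℕ} (hq : q ≠ 0)
    (hkill : ∀ v : V, (q : ℤ) • v = 0) :
    (AddSubgroup.closure (Set.range gens) : Set V).Finite := by
  classical
  set f : (Fin m → Fin q) → V := fun a ↦ ∑ i, ((a i : ℕ) : ℤ) • gens i with hf
  refine (Set.finite_range f).subset fun v hv ↦ ?_
  obtain ⟨a, rfl⟩ := AddSubgroup.exists_of_mem_closure_range gens v hv
  haveI : NeZero q := ⟨hq⟩
  refine ⟨fun i ↦ ⟨(a i).natMod q, Int.natMod_lt hq⟩, ?_⟩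
  simp only [hf]
  refine Finset.sum_congr rfl fun i _ ↦ ?_
  have hdecomp : a i = (q : ℤ) * (a i / q) + (((a i).natMod q : ℕ) : ℤ) := by
    rw [Int.natMod, Int.toNat_of_nonneg (Int.emod_nonneg _ (by exact_mod_cast hq))]
    exact (Int.mul_ediv_add_emod (a i) q).symm
  conv_rhs => rw [hdecomp, add_smul, mul_comm, mul_smul, hkill, smul_zero, zero_add]

/-- `2^(a+4) • z − Σ (16 bᵢ) • yᵢ = 2 • (8 • (2^a • z − Σ bᵢ • yᵢ))`, generic spelling (safe to instantiate on `H¹(K, E[2^M])`, whose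
`ℤ`-action is not syntactically the `Module` path). [folklore] -/
theorem two_pow_add_four_zsmul_sub_sum_eq {k : ℕ} (a : ℕ) (z : V) (y : Fin k → V) (b' : Fin k → ℤ) :
    ((2 ^ (a + 4) : ℕ) : ℤ) • z - ∑ i, (16 * b' i) • y i =
      (2 : ℤ) • ((9 - 1 : ℤ) • (((2 ^ a : ℕ) : ℤ) • z - ∑ i, b' i • y i)) := by
  rw [smul_smul, smul_sub, Finset.smul_sum]
  congr 1
  · rw [smul_smul]; congr 1; push_cast; ring
  · refine Finset.sum_congr rfl fun i _ ↦ ?_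
    rw [smul_smul, show (2 : ℤ) * (9 - 1) = 16 from rfl]

/-- `(2^b • c − s) + (2^b • c + s) = 2^(b+1) • c`, generic spelling. [folklore] -/
theorem two_pow_zsmul_sub_add_add_eq (b : ℕ) (c s : V) :
    (((2 ^ b : ℕ) : ℤ) • c - s) + (((2 ^ b : ℕ) : ℤ) • c + s) = ((2 ^ (b + 1) : ℕ) : ℤ) • c := by
  rw [sub_add_add_cancel, ← add_zsmul]; congr 1; push_cast; ring

/-- `n • u • c − Σ bᵢ • (−u) • yᵢ = u • (n • c + Σ bᵢ • yᵢ)`, generic spelling. [folklore] -/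
theorem zsmul_smul_sub_sum_eq {k : ℕ} (u n : ℤ) (c : V) (y : Fin k → V) (b' : Fin k → ℤ) :
    n • u • c - ∑ x, b' x • (-u) • y x = u • (n • c + ∑ i, b' i • y i) := by
  rw [smul_add, Finset.smul_sum, sub_eq_add_neg, ← Finset.sum_neg_distrib]
  congr 1
  · rw [smul_comm]
  · exact Finset.sum_congr rfl fun i _ ↦ by rw [smul_comm (b' i) (-u) (y i), neg_smul, neg_neg]

/-- THE SIGN TRICK, generic spelling: an additive map acting as `u` on `c` and as `−u` on every `yᵢ` sends `n • c − Σ bᵢ • yᵢ` to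
`u • (n • c + Σ bᵢ • yᵢ)`. [folklore] -/
theorem map_sub_sum_eq_smul_of_sign {k : ℕ} {F : Type*} [FunLike F V V] [AddMonoidHomClass F V V] (f : F) (u n : ℤ)
    (c : V) (y : Fin k → V) (b' : Fin k → ℤ) (hc : f c = u • c) (hy : ∀ i, f (y i) = (-u) • y i) :
    f (n • c - ∑ i, b' i • y i) = u • (n • c + ∑ i, b' i • y i) := by
  rw [map_sub, map_zsmul, hc, map_sum, ← zsmul_smul_sub_sum_eq u n c y b']
  congr 1
  exact Finset.sum_congr rfl fun i _ ↦ by rw [map_zsmul, hy]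

/-- A class killed by a unit `u = ±1` is zero, generic spelling. [folklore] -/
theorem eq_zero_of_unit_zsmul_eq_zero (u : ℤ) (hu : u = 1 ∨ u = -1) (E : V) (h : u • E = 0) : E = 0 := by
  rcases hu with rfl | rfl
  · rwa [one_zsmul] at h
  · rwa [neg_one_zsmul, neg_eq_zero] at h

end Plumbing

/-- **ES · DEEP REGULAR ENGINE SUPPLY AT 2** — the pen's v8.x stub `EngineSupplyAtTwo`, byte-for-byte, as a theorem (`C = 4`).
See the module docstring. [cite: GrossLMS1991, §9] [cite: MazurRubin2004, §4.1, Prop. 4.1.5] -/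
theorem engineSupplyAtTwo :
  ∀ (W : WeierstrassCurve ℚ) [W.IsElliptic] [W.IsGloballyMinimal], ¬ W.HasCM → (Literature.NumberTheory.EllipticCurves.Rank1Residual.GoodOrd W 2 ∨ Literature.NumberTheory.EllipticCurves.Rank1Residual.Mult W 2) → (∀ m : ℕ, W.HasSurjectiveModNGaloisRep (2 ^ m : ℕ)) → ∀ (K : Type) [Field K] [NumberField K], Literature.NumberTheory.EllipticCurves.IsImaginaryQuadratic K → ∀ [NeZero (W.conductorNorm ℤ)], Literature.NumberTheory.EllipticCurves.SatisfiesHeegnerHypothesis (W.conductorNorm ℤ) K → Odd (NumberField.discr K) → NumberField.discr K ≠ -3 → AddSubgroup.torsionBy (W.baseChange K).toAffine.Point (2 : ℤ) = ⊥ → Literature.NumberTheory.EllipticCurves.SatisfiesHeegnerHypothesis 2 K → ∀ (Dt : Literature.NumberTheory.EllipticCurves.ModularForms.ModularParametrizationData W (W.conductorNorm ℤ)) (β : ℤ) (ι : K →+* ℂ) [∀ k : ℕ, NumberField (ringClassField K ι k)], (4 * (W.conductorNorm ℤ : ℤ)) ∣ β ^ 2 - NumberField.discr K →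
    ∀ (τ : K ≃ₐ[ℚ] K), τ ≠ 1 → ∀ (u : ℤ), (u = 1 ∨ u = -1) →
    ∃ C : ℕ, ∀ (M I bnd k a b : ℕ) (y : Fin k → galH1Torsion (W.baseChange K) ((2 ^ M : ℕ) : ℤ))
      (z c : galH1Torsion (W.baseChange K) ((2 ^ M : ℕ) : ℤ)),
      1 ≤ M → M + 1 ≤ I →
      (∀ i, conjAct W τ ((2 ^ M : ℕ) : ℤ) (y i) = (-u) • y i) →
      conjAct W τ ((2 ^ M : ℕ) : ℤ) z = (-u) • z →
      conjAct W τ ((2 ^ M : ℕ) : ℤ) c = u • c →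
      (∀ bv : Fin k → ℤ, ¬ ∀ σ ∈ torsionFixing (W.baseChange K) ((2 ^ (M + 1) : ℕ) : ℤ),
          h1Eval (W.baseChange K) ((2 ^ M : ℕ) : ℤ) (((2 ^ (a + C) : ℕ) : ℤ) • z - ∑ i, bv i • y i) σ = 0) →
      (∃ ρ ∈ torsionFixing (W.baseChange K) ((2 ^ M : ℕ) : ℤ),
          ((2 ^ (b + C) : ℕ) : ℤ) • h1Eval (W.baseChange K) ((2 ^ M : ℕ) : ℤ) c ρ ≠ 0) →
      ∃ ℓ : ℕ, bnd < ℓ ∧ Literature.NumberTheory.EllipticCurves.Zhang2014.IsKolyvaginPrime (W.conductorNorm ℤ) W K 2 ℓ ∧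
        (I ≤ Literature.NumberTheory.EllipticCurves.Zhang2014.kolyvaginIndex W 2 ℓ ∧ (∃ (pl : HeightOneSpectrum (𝓞 ℚ)) (𝔓 : Ideal (absIntegers (𝓞 ℚ) ℚ)) (h : absoluteGaloisGroup ℚ), (ℓ : 𝓞 ℚ) ∈ pl.asIdeal ∧ 𝔓 ∈ pl.primesAbove ∧ IsArithFrobAt (𝓞 ℚ) h 𝔓 ∧ (∀ X : geomTorsion W ((2 ^ M : ℕ) : ℤ), h • h • X = X) ∧ ∃ P : geomTorsion W ((2 ^ M : ℕ) : ℤ), (2 : ℤ) ^ (M - 1) • (P + h • P) ≠ 0)) ∧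
        ∃ v : IsDedekindDomain.HeightOneSpectrum (NumberField.RingOfIntegers K), (ℓ : NumberField.RingOfIntegers K) ∈ v.asIdeal ∧
          (∀ i, y i ∈ (W.baseChange K).torsionLocalKer (v.adicCompletion K) ((2 ^ M : ℕ) : ℤ)) ∧
          ((2 ^ a : ℕ) : ℤ) • z ∉ (W.baseChange K).torsionLocalKer (v.adicCompletion K) ((2 ^ M : ℕ) : ℤ) ∧
          ((2 ^ b : ℕ) : ℤ) • c ∉ (W.baseChange K).torsionLocalKer (v.adicCompletion K) ((2 ^ M : ℕ) : ℤ) := by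
  intro W _ _ _hCM _hred hsurj K _ _ hK _ hH hodd _hd3 _htors _hH2 _Dt _β _ι _ _hβ τ hτ u hu
  refine ⟨4, ?_⟩
  intro M I bnd k a b y z c hM hMI hyτ hzτ hcτ hzspan hcvis
  classical
  haveI : NeZero (2 ^ M) := ⟨pow_ne_zero M two_ne_zero⟩
  haveI hEK : (W.baseChange K).IsElliptic := by unfold WeierstrassCurve.baseChange; infer_instance
  -- levels
  have hdvdMI : ((2 ^ M : ℕ) : ℤ) ∣ ((2 ^ I : ℕ) : ℤ) := by exact_mod_cast pow_dvd_pow 2 (by omega : M ≤ I)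
  have hleIM : torsionFixing (W.baseChange K) ((2 ^ I : ℕ) : ℤ) ≤ torsionFixing (W.baseChange K) ((2 ^ M : ℕ) : ℤ) :=
    KolyvaginLowerBoundAtTwo.torsionFixing_le_of_dvd _ hdvdMI
  have hleM1M : torsionFixing (W.baseChange K) ((2 ^ (M + 1) : ℕ) : ℤ) ≤
      torsionFixing (W.baseChange K) ((2 ^ M : ℕ) : ℤ) :=
    KolyvaginLowerBoundAtTwo.torsionFixing_le_of_dvd _ (by exact_mod_cast pow_dvd_pow 2 (Nat.le_succ M))
  -- the homothety `9` on `E[2^I]`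
  obtain ⟨σ, hσ⟩ := RegularValueEngine.exists_smul_eq_nine W K hK.1 I (hsurj I)
  -- the span of the classes: finite and `τ`-stable
  let gens : Fin (k + 1 + 1) → galH1Torsion (W.baseChange K) ((2 ^ M : ℕ) : ℤ) := Fin.cons z (Fin.cons c y)
  set S : AddSubgroup (galH1Torsion (W.baseChange K) ((2 ^ M : ℕ) : ℤ)) := AddSubgroup.closure (Set.range gens)
    with hS
  haveI : Finite S :=
    (finite_span_of_zsmul_eq_zero gens (q := 2 ^ M) (pow_ne_zero M two_ne_zero)
      (zsmul_galH1Torsion_eq_zero _ _)).to_subtype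
  have hzS : z ∈ S := AddSubgroup.subset_closure ⟨0, by simp [gens]⟩
  have hcS : c ∈ S := AddSubgroup.subset_closure ⟨(0 : Fin (k + 1)).succ, by simp [gens]⟩
  have hyS : ∀ i, y i ∈ S := fun i ↦ AddSubgroup.subset_closure ⟨i.succ.succ, by simp [gens]⟩
  have hgen : ∀ i, conjAct W τ ((2 ^ M : ℕ) : ℤ) (gens i) ∈ S := by
    intro i
    refine Fin.cases ?_ (fun j ↦ ?_) i
    · simp only [gens, Fin.cons_zero, hzτ]; exact S.zsmul_mem hzS _
    · refine Fin.cases ?_ (fun j' ↦ ?_) j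
      · simp only [gens, Fin.cons_succ, Fin.cons_zero, hcτ]; exact S.zsmul_mem hcS _
      · simp only [gens, Fin.cons_succ, hyτ]; exact S.zsmul_mem (hyS j') _
  have hSτ : ∀ x ∈ S, conjAct W τ ((2 ^ M : ℕ) : ℤ) x ∈ S := by
    intro x hx
    refine AddSubgroup.closure_induction (p := fun x _ ↦ conjAct W τ ((2 ^ M : ℕ) : ℤ) x ∈ S) ?_ ?_ ?_ ?_ hx
    · rintro _ ⟨i, rfl⟩; exact hgen i
    · rw [map_zero]; exact S.zero_mem
    · intro x₁ x₂ _ _ h₁ h₂; rw [map_add]; exact S.add_mem h₁ h₂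
    · intro x₁ _ h₁; rw [map_neg]; exact S.neg_mem h₁
  -- the deep adapter
  obtain ⟨ℓ, hbnd, hKol, hidx, hreg, hloc⟩ :=
    RegularValueEngine.deepEngineAdapterAtTwo W K hK hodd hH hM hMI hsurj hτ S hSτ y hyS (fun _ ↦ -u) hyτ hzS hcS hzτ
      hcτ bnd
  obtain ⟨v, hv⟩ := KolyvaginAtTwo.RegularWalk.exists_place_natCast_mem_of_kolyvaginPrime W hKol
  haveI : CharZero (v.adicCompletion K) := charZero_of_injective_algebraMap (algebraMap K _).injective
  obtain ⟨hy0, hzcut, hccut⟩ := hloc v hv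
  refine ⟨ℓ, hbnd, hKol, ⟨hidx, hreg⟩, v, hv, ?_, ?_, ?_⟩
  · -- kept classes die locally
    intro i
    exact (mem_torsionLocalKer_iff_res_eq_zero (W.baseChange K) (v.adicCompletion K) (k := 2 ^ M)
      (pow_ne_zero M two_ne_zero) (y i)).mpr (hy0 i)
  · -- `2^a z` survives locally
    intro hmem
    have hres := (mem_torsionLocalKer_iff_res_eq_zero (W.baseChange K) (v.adicCompletion K) (k := 2 ^ M)
      (pow_ne_zero M two_ne_zero) _).mp hmem
    have hloc0 : ((2 ^ a : ℕ) : ℤ) • galoisCohomology.localization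
        ((W.baseChange K).torsionGaloisModule ((2 ^ M : ℕ) : ℤ)) (Sum.inr v : Place K) 1 z = 0 := by
      rw [← map_zsmul]; exact hres
    obtain ⟨b', hb'⟩ := (hzcut _).mp hloc0
    have hDL := RegularValueEngine.h1Eval_smul_eq_zero_of_deep (W.baseChange K) hdvdMI hσ _ hb'
    refine hzspan (fun i ↦ 16 * b' i) fun ρ hρ ↦ ?_
    have hρM : ρ ∈ torsionFixing (W.baseChange K) ((2 ^ M : ℕ) : ℤ) := hleM1M hρ
    have h1 := hDL ρ hρM
    have hid : ((2 ^ (a + 4) : ℕ) : ℤ) • z - ∑ i, (16 * b' i) • y i =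
        (2 : ℤ) • ((9 - 1 : ℤ) • (((2 ^ a : ℕ) : ℤ) • z - ∑ i, b' i • y i)) :=
      two_pow_add_four_zsmul_sub_sum_eq a z y b'
    show h1Eval (W.baseChange K) ((2 ^ M : ℕ) : ℤ) (((2 ^ (a + 4) : ℕ) : ℤ) • z - ∑ i, (16 * b' i) • y i) ρ = 0
    rw [hid, h1Eval_zsmul _ _ _ _ hρM, h1, smul_zero]
  · -- `2^b c` survives locally
    intro hmem
    have hres := (mem_torsionLocalKer_iff_res_eq_zero (W.baseChange K) (v.adicCompletion K) (k := 2 ^ M)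
      (pow_ne_zero M two_ne_zero) _).mp hmem
    have hloc0 : ((2 ^ b : ℕ) : ℤ) • galoisCohomology.localization
        ((W.baseChange K).torsionGaloisModule ((2 ^ M : ℕ) : ℤ)) (Sum.inr v : Place K) 1 c = 0 := by
      rw [← map_zsmul]; exact hres
    obtain ⟨b', hb'⟩ := (hccut _).mp hloc0
    -- sign trick at the deep level
    have hτX := RegularValueEngine.forall_h1Eval_conjAct_eq_of_dvd W hK hτ hdvdMI
      (x := ((2 ^ b : ℕ) : ℤ) • c - ∑ i, b' i • y i) (x' := 0)
      (fun ρ hρ ↦ by rw [hb' ρ hρ, h1Eval_zero _ _ (hleIM hρ)])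
    have hconj : conjAct W τ ((2 ^ M : ℕ) : ℤ) (((2 ^ b : ℕ) : ℤ) • c - ∑ i, b' i • y i) =
        u • (((2 ^ b : ℕ) : ℤ) • c + ∑ i, b' i • y i) :=
      map_sub_sum_eq_smul_of_sign (conjAct W τ ((2 ^ M : ℕ) : ℤ)) u _ c y b' hcτ hyτ
    have hY : ∀ ρ ∈ torsionFixing (W.baseChange K) ((2 ^ I : ℕ) : ℤ),
        h1Eval (W.baseChange K) ((2 ^ M : ℕ) : ℤ) (((2 ^ (b + 1) : ℕ) : ℤ) • c) ρ = 0 := by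
      intro ρ hρ
      have hρM : ρ ∈ torsionFixing (W.baseChange K) ((2 ^ M : ℕ) : ℤ) := hleIM hρ
      have h1 := hb' ρ hρ
      have h2 := hτX ρ hρ
      rw [map_zero, h1Eval_zero _ _ hρM, hconj, h1Eval_zsmul _ _ _ _ hρM] at h2
      have h3 : h1Eval (W.baseChange K) ((2 ^ M : ℕ) : ℤ) (((2 ^ b : ℕ) : ℤ) • c + ∑ i, b' i • y i) ρ = 0 :=
        eq_zero_of_unit_zsmul_eq_zero u hu _ h2
      have h4 : (((2 ^ b : ℕ) : ℤ) • c - ∑ i, b' i • y i) + (((2 ^ b : ℕ) : ℤ) • c + ∑ i, b' i • y i) =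
          ((2 ^ (b + 1) : ℕ) : ℤ) • c :=
        two_pow_zsmul_sub_add_add_eq b c (∑ i, b' i • y i)
      rw [← h4, h1Eval_add _ _ _ _ hρM, h1, h3, add_zero]
    obtain ⟨ρ₀, hρ₀, hne⟩ := hcvis
    apply hne
    have hDL := RegularValueEngine.h1Eval_smul_eq_zero_of_deep (W.baseChange K) hdvdMI hσ _ hY ρ₀ hρ₀
    rw [h1Eval_zsmul _ _ _ _ hρ₀, h1Eval_zsmul _ _ _ _ hρ₀, smul_smul] at hDL
    have h5 : ((2 ^ (b + 4) : ℕ) : ℤ) = (9 - 1) * ((2 ^ (b + 1) : ℕ) : ℤ) := by push_cast; ring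
    rw [h5]; exact hDL

end ESInline.RegularWalk

end ESInline

/-- KERNEL (v8.6): ES · DEEP REGULAR ENGINE SUPPLY HOLDS — `ESInline.RegularWalk.engineSupplyAtTwo` (the pen's landable text; tree landing
p735554 + sequel), whose statement is this file's `EngineSupplyAtTwo` byte-for-byte.  Unconditional. -/
theorem engineSupplyAtTwo_holds : EngineSupplyAtTwo :=
  ESInline.RegularWalk.engineSupplyAtTwo

/-- KERNEL (v8.6, tree-fed): SC · THE SHAPE CUT HOLDS — TREE theorem `KolyvaginAtTwo.RegularWalk.shapeCutAtTwo` (p729679, krr2-p2 g18's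
proof of the pen's v8.1 statement, `gC a = 3a + 2`), whose statement is this file's `ShapeCutAtTwo` up to definitional unfolding of `OppShape`.
Unconditional. -/
theorem shapeCutAtTwo_holds : ShapeCutAtTwo :=
  Summit.BirchSwinnertonDyer.BirchSwinnertonDyer.Theorems.KolyvaginAtTwo.RegularWalk.shapeCutAtTwo

/-- KERNEL (v8.3, tree-fed): SRF · THE SHAPE REFILL HOLDS — TREE theorem `KolyvaginAtTwo.RegularWalk.shapeRefillAtTwo` (p728771,
krr2-p2 g18's proof of the pen's v8.1 statement, `gR a = 2a + 8`), whose statement is this file's `ShapeRefillAtTwo` with both `OppShape`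
terms unfolded (definitional unfolding).  Unconditional. -/
theorem shapeRefillAtTwo_holds : ShapeRefillAtTwo :=
  Summit.BirchSwinnertonDyer.BirchSwinnertonDyer.Theorems.KolyvaginAtTwo.RegularWalk.shapeRefillAtTwo


/-- KERNEL (v8.0): SRS · THE SUPPLY HALF OF THE SIGNED REFILL LAW HOLDS — tree theorem `KolyvaginAtTwo.RegularWalk.signedRefillSupplyAtTwo`
(krr2-p2 g18, p723829; `C = 7`), whose statement is this file's `SignedRefillSupplyAtTwo` with `OppShape … 0` unfolded (definitional unfolding). -/
theorem signedRefillSupplyAtTwo_holds : SignedRefillSupplyAtTwo :=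
  Summit.BirchSwinnertonDyer.BirchSwinnertonDyer.Theorems.KolyvaginAtTwo.RegularWalk.signedRefillSupplyAtTwo

/-- P372 · PRINT stub: Gross 1991 Prop. 3.7(2) / Nekovář 2007 Prop. 4.9 (Eichler–Shimura congruence for Heegner points; image-free named
Literature fact, the one print input under which GK2's Q2 at 2 is a tree theorem). -/
theorem stub_heegnerCongruence : Literature.NumberTheory.EllipticCurves.GrossLMS1991.prop37_2_frobeniusCongruence := by
  sorry

/-- KERNEL (v8.2, tree-fed): OSR · opposite-sign reciprocity at 2 HOLDS modulo P372 — TREE theorem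
`KolyvaginLowerBoundAtTwo.oppositeSignReciprocityAtTwo_of_frobeniusCongruence` (p724710, krr2-p2 g18's landing of the pen's OSR proof in three
Theorems files), whose statement is this file's `OppositeSignReciprocityAtTwo` verbatim, applied to the print stub `stub_heegnerCongruence`.
Conditional on P372 only. -/
theorem oppositeSignReciprocityAtTwo_holds : OppositeSignReciprocityAtTwo :=
  Summit.BirchSwinnertonDyer.BirchSwinnertonDyer.Theorems.KolyvaginLowerBoundAtTwo.oppositeSignReciprocityAtTwo_of_frobeniusCongruence
    stub_heegnerCongruence

/-- KERNEL (v8.6): SWα⁗ · THE SHAPED SHED HOLDS modulo P372 (print) only — `shedSeedPrimeShapedAtTwo_of` (§5b) applied to ES (kernel, §ES),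
SC (tree, p729679), SRF (tree, p728771), OSR (kernel mod P372) and SRS (tree).  No crux / summit is proved; BSD is NOT proved. -/
theorem shedSeedPrimeShapedAtTwo_holds : ShedSeedPrimeShapedAtTwo :=
  shedSeedPrimeShapedAtTwo_of engineSupplyAtTwo_holds shapeCutAtTwo_holds shapeRefillAtTwo_holds oppositeSignReciprocityAtTwo_holds
    signedRefillSupplyAtTwo_holds

/-- Q2 at 2 BY NAME (GK2 item stmt-BirchSwinnertonDyer-24880), a tree theorem modulo P372 (gk2-p2 g7, p614530). -/
theorem kolyvaginRelationAtTwo_of_print :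
    Summit.BirchSwinnertonDyer.BirchSwinnertonDyer.Theses.GenusKolyvaginAtTwo.KolyvaginRelationAtTwo :=
  Summit.BirchSwinnertonDyer.BirchSwinnertonDyer.Theorems.GenusExact.kolyvaginRelationAtTwo_of_frobeniusCongruence stub_heegnerCongruence

/-- EV · SINGULAR-TO-VISIBLE (v7.7: a KERNEL THEOREM, re-typed class-generally with margin one; was a routine stub).  For a Kolyvagin prime `q` of
index `≥ M + 1`, a place `w ∣ q` of `K` and ANY class `x ∈ H¹(K, E[2^M])`: if `2^j · x` is not locally trivial at `w` then `x` has VISIBLE order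
`> 2^j` (`2^j · [x, ρ] ≠ 0` for some `ρ ∈ Γ_{K(E[2^M])}`): the image of `Γ_{K_w} → Γ_K` fixes `E[2^{M+1}]` (Φ-KILL, the tree's
`RegularRefill.localization_eq_zero_of_forall_h1Eval_eq_zero`), `Γ_{K(E[2^{M+1}])} ≤ Γ_{K(E[2^M])}`, and `ker loc_w = torsionLocalKer`
(`KolyvaginLowerBoundAtTwo.mem_torsionLocalKer_two_pow_iff`). [cite: McCallumLMS1991, Prop. 4.4 (proof)] [cite: GrossLMS1991, §9] -/
def SingularToVisibleAtTwo : Prop :=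
  ∀ (W : WeierstrassCurve ℚ) [W.IsElliptic] [W.IsGloballyMinimal], ¬ W.HasCM → (Literature.NumberTheory.EllipticCurves.Rank1Residual.GoodOrd W 2 ∨ Literature.NumberTheory.EllipticCurves.Rank1Residual.Mult W 2) → (∀ m : ℕ, W.HasSurjectiveModNGaloisRep (2 ^ m : ℕ)) → ∀ (K : Type) [Field K] [NumberField K], Literature.NumberTheory.EllipticCurves.IsImaginaryQuadratic K → ∀ [NeZero (W.conductorNorm ℤ)], Literature.NumberTheory.EllipticCurves.SatisfiesHeegnerHypothesis (W.conductorNorm ℤ) K → Odd (NumberField.discr K) → NumberField.discr K ≠ -3 → AddSubgroup.torsionBy (W.baseChange K).toAffine.Point (2 : ℤ) = ⊥ → Literature.NumberTheory.EllipticCurves.SatisfiesHeegnerHypothesis 2 K → ∀ (Dt : Literature.NumberTheory.EllipticCurves.ModularForms.ModularParametrizationData W (W.conductorNorm ℤ)) (β : ℤ) (ι : K →+* ℂ) [∀ k : ℕ, NumberField (ringClassField K ι k)], (4 * (W.conductorNorm ℤ : ℤ)) ∣ β ^ 2 - NumberField.discr K →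
    ∀ (M q j : ℕ) (x : galH1Torsion (W.baseChange K) ((2 ^ M : ℕ) : ℤ)),
      Literature.NumberTheory.EllipticCurves.Zhang2014.IsKolyvaginPrime (W.conductorNorm ℤ) W K 2 q →
      M + 1 ≤ Literature.NumberTheory.EllipticCurves.Zhang2014.kolyvaginIndex W 2 q →
      ∀ (w : IsDedekindDomain.HeightOneSpectrum (NumberField.RingOfIntegers K)), (q : NumberField.RingOfIntegers K) ∈ w.asIdeal →
      ((2 ^ j : ℕ) : ℤ) • x ∉ (W.baseChange K).torsionLocalKer (w.adicCompletion K) ((2 ^ M : ℕ) : ℤ) →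
      ∃ ρ ∈ torsionFixing (W.baseChange K) ((2 ^ M : ℕ) : ℤ),
        ((2 ^ j : ℕ) : ℤ) • h1Eval (W.baseChange K) ((2 ^ M : ℕ) : ℤ) x ρ ≠ 0

/-- **EV holds** (kernel, sorry-free). -/
theorem singularToVisibleAtTwo_holds : SingularToVisibleAtTwo := by
  intro W _ _ hCM hred hsurj K _ _ hK _ hH hodd hd3 htors hH2 Dt β ι _ hβ M q j x hKol hidx w hw hnot
  by_contra hvis
  push Not at hvis
  apply hnot
  rw [KolyvaginLowerBoundAtTwo.mem_torsionLocalKer_two_pow_iff W M w]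
  have hle : torsionFixing (W.baseChange K) ((2 ^ (M + 1) : ℕ) : ℤ) ≤ torsionFixing (W.baseChange K) ((2 ^ M : ℕ) : ℤ) :=
    KolyvaginLowerBoundAtTwo.torsionFixing_le_of_dvd _ (KolyvaginAtTwo.RegularValueEngine.natCast_two_pow_dvd_succ M)
  refine KolyvaginAtTwo.RegularRefill.localization_eq_zero_of_forall_h1Eval_eq_zero W hK hKol hidx w hw fun ρ hρ ↦ ?_
  rw [h1Eval_zsmul _ _ _ _ (hle hρ)]
  exact hvis ρ (hle hρ)

/-- **Zζ holds given OSR and SRS** (kernel, sorry-free; v7.7).  The lone seed prime `s` (a prime: square-free, `#s ≤ 1`, `s ≠ 1`) and the engine part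
`e` with shape `Sh(0,a)`: if `c_M(se)` were visible beyond `2^{κ₀ a}`, `κ₀ a := a + C_osr + C_srs + 6`, then `M > a + C_srs + 3` (a class killed by
`2^M` cannot be visible beyond `2^M`), SRS supplies an exact `(−u)`-partner `z ∈ H_{𝓕(se)}` of order `≥ 2^{M−a−C_srs}`, the tree's pair Čebotarev
`exists_kolyvaginPrime_notMem_pair_of_heegner` supplies a Kolyvagin `ℓ ∤ se` of index `≥ M+1` with a place `v ∣ ℓ` where BOTH classes keep their
global orders up to two bits, Gross's CM facts supply a compatible datum at `seℓ`, and OSR with `m := n = se` returns a prime factor of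
`n/n = 1` — there is none. -/
theorem loneSeedPartnerAtTwo_of (hO : OppositeSignReciprocityAtTwo) (hR : SignedRefillSupplyAtTwo) : LoneSeedPartnerAtTwo := by
  intro W _ _ hCM hred hsurj K _ _ hK _ hH hodd hd3 htors hH2 Dt β ι _ hβ τ hτ u hu
  obtain ⟨C₁, hosr⟩ := hO W hCM hred hsurj K hK hH hodd hd3 htors hH2 Dt β ι hβ τ hτ u hu
  obtain ⟨C₂, hsrs⟩ := hR W hCM hred hsurj K hK hH hodd hd3 htors hH2 Dt β ι hβ τ hτ u hu
  refine ⟨fun a ↦ a + C₁ + C₂ + 6, fun a I M s e d hKol hs1 hcard hM hMI hidx hdeep hshape hsign hvis ↦ ?_⟩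
  obtain ⟨ρ, hρ, hvisρ⟩ := hvis
  -- the class is (globally) non-zero beyond `2^{κ₀ a}`
  have hcne : ((2 ^ (a + C₁ + C₂ + 6) : ℕ) : ℤ) • d.kolyvaginClass Nat.prime_two M ≠ 0 := by
    intro h0
    apply hvisρ
    rw [← h1Eval_zsmul _ _ _ _ hρ, h0, h1Eval_zero _ _ hρ]
  -- hence the level is large
  have hMbig : a + C₂ + 3 < M := by
    by_contra hle
    push Not at hle
    exact hcne (KolyvaginLowerBoundAtTwo.two_pow_zsmul_eq_zero_of_le_swap (by omega) (zsmul_galH1Torsion_eq_zero _ _ _))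
  -- the seed part is a single prime
  have hn0 : s * e ≠ 0 := hKol.1.ne_zero
  have hs0 : s ≠ 0 := left_ne_zero_of_mul hn0
  have hsqs : Squarefree s := hKol.1.squarefree_of_dvd (dvd_mul_right s e)
  have hcard1 : s.primeFactors.card = 1 := by
    have hne : s.primeFactors.Nonempty := by
      rw [Finset.nonempty_iff_ne_empty]
      intro h
      rcases Nat.primeFactors_eq_empty.mp h with h' | h'
      · exact hs0 h'
      · exact hs1 h'
    have hpos := Finset.card_pos.mpr hne
    omega
  obtain ⟨q, hq⟩ := Finset.card_eq_one.mp hcard1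
  have hqmem : q ∈ s.primeFactors := by rw [hq]; exact Finset.mem_singleton_self q
  have hsq : s = q := by
    have h := Nat.prod_primeFactors_of_squarefree hsqs
    rw [hq, Finset.prod_singleton] at h
    exact h.symm
  have hsprime : s.Prime := by rw [hsq]; exact Nat.prime_of_mem_primeFactors hqmem
  have hse : ¬ s ∣ e := fun h ↦ hs1 (Nat.isUnit_iff.mp (hKol.1 s (Nat.mul_dvd_mul_left s h)))
  -- SRS: the forced opposite-sign partner in `H_{𝓕(se)}`
  obtain ⟨z, hzmem, hzsign, hzne⟩ := hsrs a M s e hKol hsprime hse hM hidx hshape (by omega)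
  -- the tree's pair Čebotarev window: a deep Kolyvagin prime `ℓ ∤ se` keeping both global orders up to two bits
  have h2d : ¬ (2 : ℤ) ∣ NumberField.discr K := fun h ↦ (Int.not_even_iff_odd.mpr hodd) (even_iff_two_dvd.mpr h)
  have hu' : (-u = 1 ∨ -u = -1) := by rcases hu with rfl | rfl <;> norm_num
  obtain ⟨ℓ, hℓS, hKolℓ, hIℓ, v, hv, hcloc, hzloc⟩ :=
    KolyvaginLowerBoundAtTwo.exists_kolyvaginPrime_notMem_pair_of_heegner W K hsurj hK h2d hH hτ hM (Nat.le_succ M)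
      (d.kolyvaginClass Nat.prime_two M) z hu hu' hsign hzsign (s * e).primeFactors
  have hℓn : ¬ ℓ ∣ s * e := fun h ↦ hℓS (Nat.mem_primeFactors.mpr ⟨hKolℓ.1, h, hn0⟩)
  have hzloc' : ((2 ^ (M - (a + C₂) - 3) : ℕ) : ℤ) • z ∉ (W.baseChange K).torsionLocalKer (v.adicCompletion K) ((2 ^ M : ℕ) : ℤ) := by
    refine hzloc (M - (a + C₂) - 3) ?_
    have h3 : M - (a + C₂) - 3 + 2 = M - (a + C₂) - 1 := by omega
    rw [h3]
    exact hzne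
  have hcloc' : ((2 ^ (a + C₁ + C₂ + 4) : ℕ) : ℤ) • d.kolyvaginClass Nat.prime_two M ∉
      (W.baseChange K).torsionLocalKer (v.adicCompletion K) ((2 ^ M : ℕ) : ℤ) := by
    refine hcloc (a + C₁ + C₂ + 4) ?_
    have h6 : a + C₁ + C₂ + 4 + 2 = a + C₁ + C₂ + 6 := by omega
    rw [h6]
    exact hcne
  -- a compatible datum at `se·ℓ` (Gross's CM facts, PROVED in Literature)
  have hCM1 : phi_heegnerPointOfConductor_mem_range_map_ringClassField (W.conductorNorm ℤ) W K :=
    phi_heegnerPointOfConductor_mem_range_map_ringClassField_holds (W.conductorNorm ℤ) W K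
  have hD : NumberField.discr K < -4 := GenusKoly.discr_lt_neg_four_of_odd hK hodd hd3
  obtain ⟨dℓ, hdℓ⟩ := Summit.BirchSwinnertonDyer.Rank1Residual.JET.exists_compatible_data_of_grossCM hCM1 hK hD hH 2 Dt β ι hKol.1
    (fun l hl ↦ hKol.2 l hl) d
  obtain ⟨hσ, hS, hS', hemb⟩ := hdℓ ℓ hKolℓ hℓS
  -- OSR with `m := n = se`: a prime factor of `se / se = 1` — there is none
  obtain ⟨q', hq', -⟩ := hosr M (s * e) (s * e) ℓ (M - (a + C₂) - 3) (a + C₁ + C₂ + 4) 0 d z hKol hM hidx dvd_rfl hzmem hzsign hsign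
    hKolℓ hℓn hIℓ v hv hzloc' hcloc' (by omega) (dℓ ℓ hKolℓ hℓS) hσ hS hS' hemb
  rw [Nat.div_self (Nat.pos_of_ne_zero hn0), Nat.primeFactors_one] at hq'
  simp at hq'

/-! ## §6 (v7.4) KERNEL: the cut, the room bookkeeping, the shaped walk, the composition -/

/-- **THE CUT (kernel, v7.5/v7.7): SWα⁗ (main case `1 ≤ t ∨ 2 ≤ #s`) + Zζ (corner `t = 0 ∧ #s ≤ 1` vacuous; v7.7: itself derived from OSR + SRS) + Q2-at-2 + EV (v7.7: proved) ⟹ SW⁗**, with the loss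
function `κ_SW a := max (κ_α a) (κ₀ a)` and visibility monotone in the exponent (`vis_mono`). -/
theorem seedPrimeSwapShapedAtTwo_of (hα : ShedSeedPrimeShapedAtTwo) (hZ : LoneSeedPartnerAtTwo)
    (hQ2 : Summit.BirchSwinnertonDyer.BirchSwinnertonDyer.Theses.GenusKolyvaginAtTwo.KolyvaginRelationAtTwo)
    (hEV : SingularToVisibleAtTwo) : SeedPrimeSwapShapedAtTwo := by
  intro W _ _ hCM hred hsurj K _ _ hK _ hH hodd hd3 htors hH2 Dt β ι _ hβ τ hτ u hu
  obtain ⟨κ, g, hshed⟩ := hα W hCM hred hsurj K hK hH hodd hd3 htors hH2 Dt β ι hβ τ hτ u hu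
  obtain ⟨κ₀, hlone⟩ := hZ W hCM hred hsurj K hK hH hodd hd3 htors hH2 Dt β ι hβ τ hτ u hu
  have hev := hEV W hCM hred hsurj K hK hH hodd hd3 htors hH2 Dt β ι hβ
  have hd4 : NumberField.discr K ≠ -4 := by
    intro h4
    obtain ⟨k, hk⟩ := hodd
    omega
  refine ⟨fun a ↦ max (κ a) (κ₀ a), g, fun a t I M v s e d hKol hs1 hM hMI hidx hdeep hshape hsign hvis ↦ ?_⟩
  obtain ⟨ρ, hρ, hvisρ⟩ := hvis
  by_cases h01 : 1 ≤ t ∨ 2 ≤ s.primeFactors.card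
  · have hvisα : ∃ ρ ∈ torsionFixing (W.baseChange K) ((2 ^ M : ℕ) : ℤ),
        ((2 ^ (v + κ a) : ℕ) : ℤ) • h1Eval (W.baseChange K) ((2 ^ M : ℕ) : ℤ) (d.kolyvaginClass Nat.prime_two M) ρ ≠ 0 :=
      ⟨ρ, hρ, vis_mono (Nat.add_le_add_left (le_max_left (κ a) (κ₀ a)) v) hvisρ⟩
    obtain ⟨q, s', f, t', d', hsq, hq, hdeepf, hcard', hcardn, hKol', hidx', hshape', hsign', dup, hsqf, hqm, hall, hcσ, hcS₁,
      hcS₂, hcemb, w, hw, hnotSel⟩ := hshed a t I M v s e d hKol hs1 hM hMI hidx hdeep hshape h01 hsign hvisα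
    refine ⟨q, s', f, t', d', hsq, hq, hdeepf, hcard', hcardn, hKol', hidx', hshape', hsign', ?_⟩
    have hrel := hQ2 W hCM K hK hd3 hd4 hH hsurj Dt β ι M hM (s' * (e * f)) q hsqf hq hqm hall d' dup hcσ hcS₁ hcS₂ hcemb w hw v
    have hnotTors : ((2 ^ v : ℕ) : ℤ) • dup.kolyvaginClass Nat.prime_two M ∉
        (W.baseChange K).torsionLocalKer (w.adicCompletion K) ((2 ^ M : ℕ) : ℤ) := fun h ↦ hnotSel (hrel.1.mpr h)
    have hnotTors' : ((2 ^ v : ℕ) : ℤ) • d'.kolyvaginClass Nat.prime_two M ∉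
        (W.baseChange K).torsionLocalKer (w.adicCompletion K) ((2 ^ M : ℕ) : ℤ) := fun h ↦ hnotTors (hrel.2.mpr h)
    have hqse : q ∈ (s * e).primeFactors :=
      Nat.mem_primeFactors.mpr ⟨hq, Dvd.intro (s' * e) (by rw [hsq]; ring), hKol.1.ne_zero⟩
    exact hev M q v (d'.kolyvaginClass Nat.prime_two M) (hKol.2 q hqse) (Zhang2014.natCast_le_levelIndex_iff.mp hidx q hqse) w hw
      hnotTors'
  · -- the corner `t = 0 ∧ #s ≤ 1`: vacuous by Zζ
    exfalso
    have ht : ¬ 1 ≤ t := fun h ↦ h01 (Or.inl h)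
    have hs : ¬ 2 ≤ s.primeFactors.card := fun h ↦ h01 (Or.inr h)
    have ht0 : t = 0 := by omega
    subst ht0
    exact hlone a I M s e d hKol hs1 (by omega) hM hMI hidx hdeep hshape hsign
      ⟨ρ, hρ, vis_mono (le_trans (le_max_right (κ a) (κ₀ a)) (Nat.le_add_left _ v)) hvisρ⟩

/-- SW⁗ (sorry-free composition, v8.1): SWα⁗ DERIVED (`shedSeedPrimeShapedAtTwo_holds`, mod ES/SC/SRF/P372); Zζ DERIVED from OSR (mod P372)
and SRS (tree); Q2 by name mod P372; EV proved. -/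
theorem seedPrimeSwapShapedAtTwo_of_stubs : SeedPrimeSwapShapedAtTwo :=
  seedPrimeSwapShapedAtTwo_of shedSeedPrimeShapedAtTwo_holds
    (loneSeedPartnerAtTwo_of oppositeSignReciprocityAtTwo_holds signedRefillSupplyAtTwo_holds) kolyvaginRelationAtTwo_of_print
    singularToVisibleAtTwo_holds

/-- ROOM BOOKKEEPING (kernel): the room the walk needs to shed `j` seed primes starting from shape error `a` — `κ a` for the first shed,
then recursively from error `g a`. -/
def room (κ g : ℕ → ℕ) : ℕ → ℕ → ℕ
  | _, 0 => 0
  | a, j + 1 => κ a + room κ g (g a) j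

/-- THE SHAPED WALK (kernel): with room `room κ g a #(seed primes)` the seed primes are shed one at a time (strong induction on their number),
threading the level `M`, MARGIN ONE, the deep-index/regularity invariant of the engine part, the number of prime factors, the exact sign `u`
of the walking class and the SHAPE of the `(−u)`-part of the engine Selmer group (error `a ↦ g a`); at the end the conductor is all engine primes
(index `≥ M*`) and the class at the FIXED level is visibly non-zero, hence non-zero (`h1Eval_zero`). -/
theorem walk (W : WeierstrassCurve ℚ) [W.IsElliptic] [W.IsGloballyMinimal] {K : Type} [Field K] [NumberField K] [NeZero (W.conductorNorm ℤ)]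
    {Dt : Literature.NumberTheory.EllipticCurves.ModularForms.ModularParametrizationData W (W.conductorNorm ℤ)} {β : ℤ} {ι : K →+* ℂ}
    [∀ k : ℕ, NumberField (ringClassField K ι k)] {κ g : ℕ → ℕ} {M Mstar r : ℕ} {τ : K ≃ₐ[ℚ] K} {u : ℤ}
    (hM : 1 ≤ M) (hMstar : M + 1 ≤ Mstar)
    (hswap : ∀ (a t I N v s e : ℕ) (d : Literature.NumberTheory.EllipticCurves.KolyvaginHeegnerData Dt β ι (s * e)),
      Literature.NumberTheory.EllipticCurves.KolyvaginDescent.KolSupp (Literature.NumberTheory.EllipticCurves.Zhang2014.IsKolyvaginPrime (W.conductorNorm ℤ) W K 2) (s * e) →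
      s ≠ 1 → 1 ≤ N → N + 1 ≤ I → (((N + 1 : ℕ) : ℕ) : ℕ∞) ≤ Literature.NumberTheory.EllipticCurves.Zhang2014.levelIndex W 2 (s * e) →
      (∀ p ∈ (e).primeFactors, I ≤ Literature.NumberTheory.EllipticCurves.Zhang2014.kolyvaginIndex W 2 p ∧ (∃ (pl : HeightOneSpectrum (𝓞 ℚ)) (𝔓 : Ideal (absIntegers (𝓞 ℚ) ℚ)) (h : absoluteGaloisGroup ℚ), (p : 𝓞 ℚ) ∈ pl.asIdeal ∧ 𝔓 ∈ pl.primesAbove ∧ IsArithFrobAt (𝓞 ℚ) h 𝔓 ∧ (∀ X : geomTorsion W ((2 ^ N : ℕ) : ℤ), h • h • X = X) ∧ ∃ P : geomTorsion W ((2 ^ N : ℕ) : ℤ), (2 : ℤ) ^ (N - 1) • (P + h • P) ≠ 0)) →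
      OppShape W K ι τ N e u a t →
      conjAct W τ ((2 ^ N : ℕ) : ℤ) (d.kolyvaginClass Nat.prime_two N) = u • d.kolyvaginClass Nat.prime_two N →
      (∃ ρ ∈ torsionFixing (W.baseChange K) ((2 ^ N : ℕ) : ℤ),
          ((2 ^ (v + κ a) : ℕ) : ℤ) • h1Eval (W.baseChange K) ((2 ^ N : ℕ) : ℤ) (d.kolyvaginClass Nat.prime_two N) ρ ≠ 0) →
      ∃ (q s' f t' : ℕ) (d' : Literature.NumberTheory.EllipticCurves.KolyvaginHeegnerData Dt β ι (s' * (e * f))),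
        s = q * s' ∧ q.Prime ∧
        (∀ p ∈ (e * f).primeFactors, I ≤ Literature.NumberTheory.EllipticCurves.Zhang2014.kolyvaginIndex W 2 p ∧ (∃ (pl : HeightOneSpectrum (𝓞 ℚ)) (𝔓 : Ideal (absIntegers (𝓞 ℚ) ℚ)) (h : absoluteGaloisGroup ℚ), (p : 𝓞 ℚ) ∈ pl.asIdeal ∧ 𝔓 ∈ pl.primesAbove ∧ IsArithFrobAt (𝓞 ℚ) h 𝔓 ∧ (∀ X : geomTorsion W ((2 ^ N : ℕ) : ℤ), h • h • X = X) ∧ ∃ P : geomTorsion W ((2 ^ N : ℕ) : ℤ), (2 : ℤ) ^ (N - 1) • (P + h • P) ≠ 0)) ∧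
        s'.primeFactors.card + 1 = s.primeFactors.card ∧
        (s' * (e * f)).primeFactors.card = (s * e).primeFactors.card ∧
        Literature.NumberTheory.EllipticCurves.KolyvaginDescent.KolSupp (Literature.NumberTheory.EllipticCurves.Zhang2014.IsKolyvaginPrime (W.conductorNorm ℤ) W K 2) (s' * (e * f)) ∧
        (((N + 1 : ℕ) : ℕ) : ℕ∞) ≤ Literature.NumberTheory.EllipticCurves.Zhang2014.levelIndex W 2 (s' * (e * f)) ∧
        OppShape W K ι τ N (e * f) u (g a) t' ∧
        conjAct W τ ((2 ^ N : ℕ) : ℤ) (d'.kolyvaginClass Nat.prime_two N) = u • d'.kolyvaginClass Nat.prime_two N ∧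
        (∃ ρ ∈ torsionFixing (W.baseChange K) ((2 ^ N : ℕ) : ℤ),
          ((2 ^ (v) : ℕ) : ℤ) • h1Eval (W.baseChange K) ((2 ^ N : ℕ) : ℤ) (d'.kolyvaginClass Nat.prime_two N) ρ ≠ 0))
    :
    ∀ (j : ℕ) (a t s e v n : ℕ) (d : Literature.NumberTheory.EllipticCurves.KolyvaginHeegnerData Dt β ι n), n = s * e →
      s.primeFactors.card ≤ j →
      Literature.NumberTheory.EllipticCurves.KolyvaginDescent.KolSupp (Literature.NumberTheory.EllipticCurves.Zhang2014.IsKolyvaginPrime (W.conductorNorm ℤ) W K 2) (n) →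
      n.primeFactors.card = r → (((M + 1 : ℕ) : ℕ) : ℕ∞) ≤ Literature.NumberTheory.EllipticCurves.Zhang2014.levelIndex W 2 (n) →
      (∀ p ∈ (e).primeFactors, Mstar ≤ Literature.NumberTheory.EllipticCurves.Zhang2014.kolyvaginIndex W 2 p ∧ (∃ (pl : HeightOneSpectrum (𝓞 ℚ)) (𝔓 : Ideal (absIntegers (𝓞 ℚ) ℚ)) (h : absoluteGaloisGroup ℚ), (p : 𝓞 ℚ) ∈ pl.asIdeal ∧ 𝔓 ∈ pl.primesAbove ∧ IsArithFrobAt (𝓞 ℚ) h 𝔓 ∧ (∀ X : geomTorsion W ((2 ^ M : ℕ) : ℤ), h • h • X = X) ∧ ∃ P : geomTorsion W ((2 ^ M : ℕ) : ℤ), (2 : ℤ) ^ (M - 1) • (P + h • P) ≠ 0)) →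
      OppShape W K ι τ M e u a t →
      conjAct W τ ((2 ^ M : ℕ) : ℤ) (d.kolyvaginClass Nat.prime_two M) = u • d.kolyvaginClass Nat.prime_two M →
      room κ g a s.primeFactors.card ≤ v →
      (∃ ρ ∈ torsionFixing (W.baseChange K) ((2 ^ M : ℕ) : ℤ),
          ((2 ^ (v) : ℕ) : ℤ) • h1Eval (W.baseChange K) ((2 ^ M : ℕ) : ℤ) (d.kolyvaginClass Nat.prime_two M) ρ ≠ 0) →
      ∃ (n' : ℕ) (d' : Literature.NumberTheory.EllipticCurves.KolyvaginHeegnerData Dt β ι n'),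
        Literature.NumberTheory.EllipticCurves.KolyvaginDescent.KolSupp (Literature.NumberTheory.EllipticCurves.Zhang2014.IsKolyvaginPrime (W.conductorNorm ℤ) W K 2) (n') ∧
        n'.primeFactors.card = r ∧ ((Mstar : ℕ) : ℕ∞) ≤ Literature.NumberTheory.EllipticCurves.Zhang2014.levelIndex W 2 n' ∧
        d'.kolyvaginClass Nat.prime_two M ≠ 0 := by
  intro j
  induction j with
  | zero =>
    intro a t s e v n d hn hj hKol hcard hidx hdeep _ _ _ hvis
    have hs0 : s.primeFactors = ∅ := Finset.card_eq_zero.mp (Nat.le_zero.mp hj)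
    rcases Nat.primeFactors_eq_empty.mp hs0 with h0 | h1
    · exfalso
      subst h0
      have h00 : n = 0 := by rw [hn, Nat.zero_mul]
      exact (hKol.1.ne_zero) h00
    · subst h1
      have hne : n = e := by rw [hn, Nat.one_mul]
      refine ⟨n, d, hKol, hcard, ?_, ?_⟩
      · exact Zhang2014.natCast_le_levelIndex_iff.mpr fun p hp ↦ (hdeep p (by rw [← hne]; exact hp)).1
      · obtain ⟨ρ, hρ, hval⟩ := hvis
        intro hc
        apply hval
        rw [hc, h1Eval_zero _ _ hρ, smul_zero]
  | succ j ih =>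
    intro a t s e v n d hn hj hKol hcard hidx hdeep hshape hsign hv hvis
    by_cases hsj : s.primeFactors.card ≤ j
    · exact ih a t s e v n d hn hsj hKol hcard hidx hdeep hshape hsign hv hvis
    · have hcs : s.primeFactors.card = j + 1 := by omega
      have hs1 : s ≠ 1 := by
        rintro rfl
        simp [Nat.primeFactors_one] at hcs
      -- room: `κ a ≤ v` and the budget of the new state
      have hroom : room κ g a s.primeFactors.card = κ a + room κ g (g a) j := by rw [hcs]; rfl
      have hκv : κ a ≤ v := by rw [hroom] at hv; omega
      have hvis' : ∃ ρ ∈ torsionFixing (W.baseChange K) ((2 ^ M : ℕ) : ℤ),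
          ((2 ^ ((v - κ a) + κ a) : ℕ) : ℤ) • h1Eval (W.baseChange K) ((2 ^ M : ℕ) : ℤ) (d.kolyvaginClass Nat.prime_two M) ρ ≠ 0 := by
        rw [Nat.sub_add_cancel hκv]; exact hvis
      subst hn
      obtain ⟨q, s', f, t', d', hsq, hq, hdeep', hcard', hcardn', hKol', hidx', hshape', hsign', hvisℓ⟩ :=
        hswap a t Mstar M (v - κ a) s e d hKol hs1 hM hMstar hidx hdeep hshape hsign hvis'
      have hs'j : s'.primeFactors.card ≤ j := by omega
      have hcard'' : (s' * (e * f)).primeFactors.card = r := by rw [hcardn']; exact hcard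
      have hv' : room κ g (g a) s'.primeFactors.card ≤ v - κ a := by
        have h1 : s'.primeFactors.card = j := by omega
        rw [h1]; rw [hroom] at hv; omega
      exact ih (g a) t' s' (e * f) (v - κ a) (s' * (e * f)) d' rfl hs'j hKol' hcard'' hidx' hdeep' hshape' hsign' hv' hvisℓ

/-- **{S0ʳ, LD, START⁗, SW⁗} ⟹ DeepSeedAtTwo** (kernel).  ORDER OF CHOICES (the point of v7.4's bookkeeping): the complex conjugation `τ`;
from START⁗ the sign oracle and the uniform start error `a₀`; from SW⁗ the loss/shape functions for BOTH signs `u = ±1`; from S0ʳ the depth `r`;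
only THEN the room `R := max_u room(κ_u, g_u, a₀, r)` and a seed of visible order `> 2^{R+1}` at some level `M₁ ≤ M(n₁)`; LD drops to the
walk's level `M := M₁ − 1 ≥ 1` (margin one, visible order `> 2^R`); the sign `u` of the seed class picks the branch; the walk at target index
`M* + M + 1` sheds the `r`... seed primes and returns a conductor of `r` engine primes of index `≥ M*` with `c_M ≠ 0`. -/
theorem deepSeedAtTwo_of_swap (hS : KolyvaginRoomSeedAtTwo) (hLD : LevelDropAtTwo) (hT : StartShapeAtTwo)
    (hW : SeedPrimeSwapShapedAtTwo) : Vertical.DeepSeedAtTwo := by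
  intro W _ _ hCM hred hsurj K _ _ hK _ hH hodd hd3 htors hH2 Dt β ι hβ
  haveI : ∀ k : ℕ, NumberField (ringClassField K ι k) :=
    Summit.BirchSwinnertonDyer.Rank1Residual.JET.numberField_ringClassField K hK ι
  obtain ⟨τ, hτ1⟩ := Summit.BirchSwinnertonDyer.Rank1Residual.JET.exists_algEquiv_ne_one_of_isImaginaryQuadratic K hK
  obtain ⟨a₀, hstart⟩ := hT W hCM hred hsurj K hK hH hodd hd3 htors hH2 Dt β ι hβ τ hτ1
  have hsign := kolyvaginClassSignAtTwo_holds W hCM hred hsurj K hK hH hodd hd3 htors hH2 Dt β ι hβ τ hτ1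
  obtain ⟨κ₁, g₁, hsw₁⟩ := hW W hCM hred hsurj K hK hH hodd hd3 htors hH2 Dt β ι hβ τ hτ1 1 (Or.inl rfl)
  obtain ⟨κ₂, g₂, hsw₂⟩ := hW W hCM hred hsurj K hK hH hodd hd3 htors hH2 Dt β ι hβ τ hτ1 (-1) (Or.inr rfl)
  have hld := hLD W hCM hred hsurj K hK hH hodd hd3 htors hH2 Dt β ι hβ
  obtain ⟨r, hroom⟩ := hS W hCM hred hsurj K hK hH hodd hd3 htors hH2 Dt β ι hβ
  obtain ⟨n₁, d₁, M₁, hKol₁, hcard₁, hM₁, hidx₁, hvis₁⟩ := hroom (max (room κ₁ g₁ a₀ r) (room κ₂ g₂ a₀ r) + 1)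
  obtain ⟨hM2, hvis⟩ := hld n₁ M₁ (max (room κ₁ g₁ a₀ r) (room κ₂ g₂ a₀ r)) d₁ hM₁ hvis₁
  obtain ⟨M, rfl⟩ : ∃ M, M₁ = M + 1 := ⟨M₁ - 1, by omega⟩
  have hM : 1 ≤ M := by omega
  simp only [Nat.add_sub_cancel] at hvis
  refine ⟨r, M, hM, fun Mstar hMstar ↦ ?_⟩
  have hidxM' : ((M : ℕ) : ℕ∞) ≤ Literature.NumberTheory.EllipticCurves.Zhang2014.levelIndex W 2 n₁ :=
    le_trans (by exact_mod_cast Nat.le_succ M) hidx₁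
  obtain ⟨u, hu, hcu⟩ := hsign n₁ M d₁ hKol₁ hM hidxM'
  have hMs : M + 1 ≤ Mstar + M + 1 := by omega
  have hdeep1 : (∀ p ∈ ((1 : ℕ)).primeFactors, Mstar + M + 1 ≤ Literature.NumberTheory.EllipticCurves.Zhang2014.kolyvaginIndex W 2 p ∧ (∃ (pl : HeightOneSpectrum (𝓞 ℚ)) (𝔓 : Ideal (absIntegers (𝓞 ℚ) ℚ)) (h : absoluteGaloisGroup ℚ), (p : 𝓞 ℚ) ∈ pl.asIdeal ∧ 𝔓 ∈ pl.primesAbove ∧ IsArithFrobAt (𝓞 ℚ) h 𝔓 ∧ (∀ X : geomTorsion W ((2 ^ M : ℕ) : ℤ), h • h • X = X) ∧ ∃ P : geomTorsion W ((2 ^ M : ℕ) : ℤ), (2 : ℤ) ^ (M - 1) • (P + h • P) ≠ 0)) := fun p hp ↦ by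
    simp [Nat.primeFactors_one] at hp
  have fin : ∀ (n' : ℕ) (d' : Literature.NumberTheory.EllipticCurves.KolyvaginHeegnerData Dt β ι n'),
      Literature.NumberTheory.EllipticCurves.KolyvaginDescent.KolSupp (Literature.NumberTheory.EllipticCurves.Zhang2014.IsKolyvaginPrime (W.conductorNorm ℤ) W K 2) (n') ∧ n'.primeFactors.card = r ∧
        ((((Mstar + M + 1 : ℕ)) : ℕ) : ℕ∞) ≤ Literature.NumberTheory.EllipticCurves.Zhang2014.levelIndex W 2 n' ∧
        d'.kolyvaginClass Nat.prime_two M ≠ 0 →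
      ∃ (n : ℕ) (d : Literature.NumberTheory.EllipticCurves.KolyvaginHeegnerData Dt β ι n),
        Literature.NumberTheory.EllipticCurves.KolyvaginDescent.KolSupp (Literature.NumberTheory.EllipticCurves.Zhang2014.IsKolyvaginPrime (W.conductorNorm ℤ) W K 2) (n) ∧ n.primeFactors.card = r ∧
        ((Mstar : ℕ) : ℕ∞) ≤ Literature.NumberTheory.EllipticCurves.Zhang2014.levelIndex W 2 n ∧ d.kolyvaginClass Nat.prime_two M ≠ 0 :=
    fun n' d' h ↦ ⟨n', d', h.1, h.2.1, le_trans (by exact_mod_cast (show Mstar ≤ Mstar + M + 1 by omega)) h.2.2.1, h.2.2.2⟩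
  rcases hu with rfl | rfl
  · have hv : room κ₁ g₁ a₀ n₁.primeFactors.card ≤ max (room κ₁ g₁ a₀ r) (room κ₂ g₂ a₀ r) := by
      rw [hcard₁]; exact le_max_left _ _
    obtain ⟨t₁, ht₁⟩ := hstart M 1 hM (Or.inl rfl)
    obtain ⟨n', d', h⟩ :=
      walk W hM hMs hsw₁ n₁.primeFactors.card a₀ t₁ n₁ 1 _ n₁ d₁ (Nat.mul_one n₁).symm le_rfl hKol₁ hcard₁ hidx₁ hdeep1
        ht₁ hcu hv hvis
    exact fin n' d' h
  · have hv : room κ₂ g₂ a₀ n₁.primeFactors.card ≤ max (room κ₁ g₁ a₀ r) (room κ₂ g₂ a₀ r) := by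
      rw [hcard₁]; exact le_max_right _ _
    obtain ⟨t₂, ht₂⟩ := hstart M (-1) hM (Or.inr rfl)
    obtain ⟨n', d', h⟩ :=
      walk W hM hMs hsw₂ n₁.primeFactors.card a₀ t₂ n₁ 1 _ n₁ d₁ (Nat.mul_one n₁).symm le_rfl hKol₁ hcard₁ hidx₁ hdeep1
        ht₂ hcu hv hvis
    exact fin n' d' h

/-- COMPOSITION (kernel-checked, no sorry of its own): {S0ʳ, LD, START⁗, SW⁗} ⟹ DeepSeedAtTwo ⟹ U1 (v6 kernel `Vertical.*`);
concludes the ALIAS (gate skeleton rule: only `_of_stubs` below concludes the crux decl by name). -/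
theorem boundedDefect_of (hS : KolyvaginRoomSeedAtTwo) (hLD : LevelDropAtTwo) (hT : StartShapeAtTwo)
    (hW : SeedPrimeSwapShapedAtTwo) : Vertical.CruxAlias :=
  Vertical.boundedDefect_of_deepSeed (deepSeedAtTwo_of_swap hS hLD hT hW)

/-- THE SKELETON THEOREM — the ONLY theorem in this file whose conclusion is the crux decl `KolyvaginBoundedDefectAtTwo` BY NAME; zero hypotheses;
`sorry` enters only through the declared stubs `stub_*` (gate `#h21_check_skeleton` (i)–(iv)). -/
theorem KolyvaginBoundedDefectAtTwo_of_stubs : KolyvaginBoundedDefectAtTwo :=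
  Vertical.cruxAlias_iff.mp
    (boundedDefect_of stub_roomSeedAtTwo levelDropAtTwo_holds startShapeAtTwo_holds seedPrimeSwapShapedAtTwo_of_stubs)

end Summit.BirchSwinnertonDyer.BirchSwinnertonDyer.Cruxes.KolyvaginBoundedDefectAtTwo.KolyvaginSwap
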